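import Literature.MathematicalPhysics.QuantumLattice.HardCoreBosonCondensateWaveFunction
import Literature.MathematicalPhysics.QuantumLattice.HardCoreBosonGroundStateUnique
import Literature.MathematicalPhysics.QuantumLattice.FinDimSpectrumGibbsLimitProofs
import Literature.MathematicalPhysics.QuantumLattice.FinDimSpectrumSectorGibbsLimit
import Literature.MathematicalPhysics.QuantumLattice.SpinChainsAkltCorrelationProofs
import Literature.MathematicalPhysics.QuantumLattice.XXZAntiferromagnetThermalSpontaneousOrder
import Literature.MathematicalPhysics.QuantumLattice.SectorGroundProjContinuity
import Mathlib.Tactic.NoncommRing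
import HarnessLib

/-!
# Hard-core lattice bosons in the BEC phase: no gap for adding particles beyond half filling, and no cusp
# (Aizenman–Lieb–Seiringer–Solovej–Yngvason 2004, §4 "No cusp, no gap", eqs. (nogap), (nocusp); LSSY Ch. 11
# (11.28)–(11.30))

Topic `MathematicalPhysics/QuantumLattice`; companion of `HardCoreBosonOpticalLatticeBEC.lean` (Theorem 1 of
[AizenmanEtAl2004], positive temperature), `HardCoreBosonCondensateWaveFunction.lean` (Theorem 1, second clause),
`HardCoreBosonStaggeredDensity.lean` (Theorem 3) and `HardCoreBosonGroundStateUnique.lean` (Appendix A) for the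
hard-core lattice Bose gas in the staggered optical-lattice potential,
`hardCoreLatticeGas d L λ = -Σ_⟨xy⟩(S¹_xS¹_y + S²_xS²_y) + λΣ_x(½ + (-1)^xS³_x)` on the even torus `(ℤ/Lℤ)^d`
(Matsubara–Matsuda: `a†_x = S⁺_x`, `n_x = ½ + S³_x`).

The source, §4: "The system is in a Mott insulator state at zero temperature if a finite change in the chemical
potential is required to change the particle number in the ground state … if `E_k` denotes the lowest energy of
(ham) restricted to the sector of `½|Λ| + k` particles (which corresponds to `S³_tot = k` in the spin language), a gap
means that, for all `k`, `E_{-k} + E_k - 2E_0 ≥ c|k|` (eq:gap) … In this section we will show that whenever there is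
BEC then (eq:gap) fails. In fact, we will prove that `E_k - E_0 ≤ c_k/|Λ|` (nogap) for some `k`-dependent
`c_k > 0`, which is independent of `Λ`." Proof (last display of §4): "we use as a trial state `(S⁺_tot)^k|0⟩` …
`E_k ≤ E_0 + ½⟨[(S⁻_tot)^k,[H,(S⁺_tot)^k]]⟩/⟨(S⁻_tot)^k(S⁺_tot)^k⟩`. Since there is BEC,
`⟨(S⁻_tot)^k(S⁺_tot)^k⟩ ≥ c'_k|Λ|^{2k}` … All we have to show is that `[(S⁻_tot)^k,[H,(S⁺_tot)^k]] ≤ c″_k|Λ|^{2k-1}`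
… altogether there are `|Λ|^{2k+1}` factors, and the 2 commutators reduce the power by two."
And, for (nocusp) ("we prove that (eq:gap) fails for macroscopic `k` as well"): "consider the states
`|ψ_y⟩ = e^{iεS²_tot}(S¹_y+½)|0⟩` … `⟨ψ_y|ψ_y⟩ = ⟨0|S¹_y+½|0⟩ = ½` … `ΔE ≡ (2/|Λ|)Σ_y⟨ψ_y|H-E_0|ψ_y⟩` … (fircl)
`e^{-iεS²_tot}He^{iεS²_tot} ≤ H + iε[H,S²_tot] + const ε²|Λ|` … By Taylor's formula (taylor) … the norm of the double
commutator `[C,[C,A]]` … `Σ_y⟨0|(S¹_y+½)(H-E_0)(S¹_y+½)|0⟩ = ½Σ_y⟨0|[S¹_y,[H,S¹_y]]|0⟩ =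
½⟨0|Σ_⟨xy⟩2S²_xS²_y - λΣ_y(-1)^yS³_y|0⟩ = -½(E_0 - ½λ|Λ|)`, where we used rotational symmetry … The second term … is
zero by symmetry … `(2/|Λ|)Σ_y⟨0|(S¹_y+½)e^{-iεS²_tot}S³_tot e^{iεS²_tot}(S¹_y+½)|0⟩ = (2/|Λ|) sin ε ⟨0|(S¹_tot)²|0⟩`,
which is of the order `ε|Λ|` if there is BEC. Choosing `ε` proportional to the chemical potential `μ`, we obtain as
an upper bound for the ground state energy of `H - μS³_tot` `E_0(1-|Λ|^{-1}) + ½λ - cμ²|Λ|` for small `μ`, with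
`c > 0` in the case of BEC. By taking a Legendre transform, we arrive at (nocusp)."

## What this file proves (0 definitions, 0 named facts, 0 sorry)

* §0 **"the 2 commutators reduce the power by two"**, abstractly: `[A, B^k] = Σ_{j<k}B^j[A,B]B^{k-1-j}`
  (`mul_pow_sub_pow_mul_eq_sum`), `‖[A,B^k]‖ ≤ k a^{k-1}‖[A,B]‖` (`norm_mul_pow_sub_pow_mul_le`) and the nested bound
  `‖[M^k,[H,P^k]]‖ ≤ k²a^{k-1}((k-1)a^{k-2}bc + a^{k-1}e)` from `‖P‖,‖M‖ ≤ a`, `‖[M,P]‖ ≤ b`, `‖[H,P]‖ ≤ c`,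
  `‖[M,[H,P]]‖ ≤ e` (`norm_pow_comm_comm_pow_le`).
* §1 **the denominators** `⟨(S⁻)^k(S⁺)^k⟩`, abstractly for a ladder `[Z,P] = P`, `[P,Pᴴ] = 2Z` (`Z` Hermitian): the
  Casimir `PᴴP + Z² + Z` commutes with `P` and `Z` (`ladder_cas_mul_P`, `ladder_Z_mul_cas`),
  `‖Pv‖² = ⟨v,Cas v⟩ - (m²+m)‖v‖²` on the charge-`m` sector (`ladder_norm_sq_P_mulVec`), the Casimir is monotone
  along the ladder by Cauchy–Schwarz, whence `‖P^kΦ‖² ≥ Π_{j<k}(‖PΦ‖² - j(j+1))` for a unit `Φ` with `ZΦ = 0`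
  (`ladder_prod_le_norm_sq`).
* §2–§3 **locality**: `[Σ_y o_y, T] = Σ_{y∈supp T}[o_y, T]` (`sum_onSite_comm_eq_sum_filter`), the `2|supp T|ō` bound
  (`norm_sum_onSite_comm_le`) and support preservation (`isSupportedOn_sum_onSite_comm`); for the hard-core gas
  `[H, O] = -Σ_{x,i}[t_{x,x+eᵢ}, O] + λΣ_z(-1)^z[S³_z, O]` (`hardCoreLatticeGas_comm_eq`),
  `‖[H, Σo]‖ ≤ (2d+|λ|)ō|Λ|` (`norm_hardCoreLatticeGas_comm_sum_onSite_le`) and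
  `‖[Σo', [H, Σo]]‖ ≤ (8d+2|λ|)ōō'|Λ|` (`norm_sum_onSite_comm_hardCoreLatticeGas_comm_le`).
* §4 the ladder of the gas: `Σ_x a†_x = S⁺_tot` (`sum_cre_eq_totalSpin`), `[S³_tot, S⁺_tot] = S⁺_tot`
  (`totalSpin_two_comm_sum_cre`), `[S⁺_tot, S⁻_tot] = 2S³_tot` (`sum_cre_comm_conjTranspose`), norms
  `‖S^±_tot‖ ≤ |Λ|`, `‖S³_tot‖ ≤ |Λ|/2`, and `‖S⁺_totΦ‖² = Σ_{x,y}⟨Φ,(S¹_xS¹_y+S²_xS²_y)Φ⟩` for `S³_totΦ = 0`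
  (`star_sum_cre_mulVec_dotProduct_self`: the BEC order parameter `Σγ` is the first denominator).
* §5 **(nogap) with explicit constants** — `hardCoreLatticeGas_lowestEnergyInSector_le`: on an even torus of side
  `L ≥ 3`, `d ≥ 1`, any `λ`, if the (unique, half-filled) ground state `Φ` has `A = Σ_{x,y}⟨Φ,(S¹S¹+S²S²)Φ⟩ ≥ 2(k-1)k`
  then the sector `S³_tot = k` is nonempty and `E_k ≤ E_0 + k²((k-1)(2d+|λ|) + 8d+2|λ|)|Λ|^{2k-1}/(A/2)^k`;
  `hardCoreLatticeGas_lowestEnergyInSector_sub_groundEnergy_le`: with LRO `A ≥ q|Λ|²` and `2(k-1)k ≤ q|Λ|²`,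
  **`E_k - E_0 ≤ 2^k k²((k-1)(2d+|λ|) + 8d+2|λ|)/(q^k|Λ|)`**; the particle-number dictionary
  `S³_tot = M ↔ Σn_x = |Λ|/2 + M` (`mem_spinZSector_iff_sum_num`).
* §6 **Theorem 1 at `β = ∞`** (needed by §4 of the source, "Since there is BEC"): the zero-temperature limit of the
  tree's thermal infrared/sum-rule bound gives, on every even torus of side `L ≥ 4`, every `d ≥ 1`, `λ`,
  `Σ_{x,y}⟨Φ,(S¹S¹+S²S²)Φ⟩ ≥ |Λ|²(½ - ½(½[d(d+1)+4λ²]^{1/2}G_Λ(0))^{1/2})` (`hardCoreLatticeGas_groundState_lro_ge`),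
  hence for `d ≥ 3` in the window `[d(d+1)+4λ²]c_d² < 4` a volume-uniform floor `(m/2)|Λ|²`, `m > 0`, on all large
  even tori (`hardCoreLatticeGas_groundState_lro_eventually_ge`).
* §7 **(nogap) as printed** — `hardCoreLatticeGas_noGap`: `d ≥ 3`, `[d(d+1)+4λ²]c_d² < 4`, `k ≥ 1` ⟹
  `∃ c_k, L₀: ∀ even L ≥ L₀`, `E_k(Λ_L) - E_0(Λ_L) ≤ c_k/|Λ_L|`.
* §8 **the symmetries used in (nocusp)**: `ω₀(Y) = 0` whenever a unitary symmetry of `H` flips `Y`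
  (`groundStateFunctional_eq_zero_of_conj_eq_neg`); the `U(1)` quarter turn (`S¹ → -S²`, `S² → S¹`,
  `exists_quarterTurn_hardCoreLatticeGas`) and half turn (`S^{1,2} → -S^{1,2}`, `exists_halfTurn_hardCoreLatticeGas`),
  whence `ω₀(S¹_xS¹_y) = ω₀(S²_xS²_y)` ("rotational symmetry") and `ω₀(S¹_y) = 0`; the operator sum rule
  `Σ_y[S¹_y,[H,S¹_y]] = 2Σ_{x,i}S²_xS²_{x+eᵢ} - λΣ_z(-1)^zS³_z` (`hardCoreLatticeGas_sum_doubleComm_siteSpin_zero`).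
* §9 **(nocusp), grand-canonical form with explicit constants** — the trial-vector norms `⟨ψ_y|ψ_y⟩ = ½`
  (`hardCoreLatticeGas_sum_norm_sq_shiftProj`), the double-commutator bound (fircl)
  `‖[S²_tot,[S²_tot,H - μS³_tot]]‖ ≤ (2d + |λ|/2 + |μ|/2)|Λ|` (`norm_doubleComm_totalSpin_one_chemPot_le`), the zeroth
  order `Σ_y⟨ψ_y|H - μS³_tot|ψ_y⟩ = (|Λ|/2)E₀ + ½(-E₀ + λ|Λ|/2)` (`hardCoreLatticeGas_sum_shiftProj_energy`), the
  first order `Σ_y⟨ψ_y|i[S²_tot,H - μS³_tot]|ψ_y⟩ = (μ/2)Σ_{x,y}⟨S¹S¹+S²S²⟩₀` — the `H`-part vanishing by the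
  half turn (diagonal terms) and by `S^{2,3} → -S^{2,3}` plus a unit translation (off-diagonal terms)
  (`hardCoreLatticeGas_sum_shiftProj_firstOrder`) — and, by the tree's Taylor bound `re_state_conj_exp_le_taylor`
  applied to the density matrix `(2/|Λ|)Σ_y|ψ_y⟩⟨ψ_y|`: for all `μ, ε`,
  **`E_GS(H - μS³_tot) ≤ E₀(1 - |Λ|⁻¹) + λ/2 + εμ|Λ|⁻¹Σ_{x,y}⟨S¹S¹+S²S²⟩₀ + (2d + |λ|/2 + |μ|/2)|Λ|ε²/2`**
  (`hardCoreLatticeGas_groundEnergy_sub_chemPot_le`).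
* §10 **(nocusp) in the BEC phase**: with condensate density `q` (`q|Λ|² ≤ Σ_{x,y}⟨S¹S¹+S²S²⟩₀`) and
  `ε = -μA/(κ|Λ|²)`: `E_GS(H - μS³_tot) ≤ E₀(1 - |Λ|⁻¹) + λ/2 - q²μ²|Λ|/(2(2d + |λ|/2 + |μ|/2))`
  (`hardCoreLatticeGas_noCusp_grandCanonical`); the finite-volume Legendre transform `∃ M, 𝓗_M ≠ 0 ∧
  E_M - μM ≤ E_GS(H - μS³_tot)` for any `[H,S³_tot] = 0` (`exists_sector_lowestEnergy_sub_le_groundEnergy`) and the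
  canonical form (`hardCoreLatticeGas_noCusp_canonical`); ★ in the window `d ≥ 3`, `[d(d+1)+4λ²]c_d² < 4`:
  `∃ c > 0, L₀: ∀ even L ≥ L₀, |μ| ≤ 1`, `E_GS(H - μS³_tot) ≤ E₀(1 - |Λ|⁻¹) + λ/2 - cμ²|Λ|` and a sector `M` with
  `E_M - μM ≤` the same (`hardCoreLatticeGas_noCusp`); ★ **(eq:gap) fails at macroscopic `k`**: for every `c' > 0`
  there are `ρ > 0`, `L₀` with, on every even torus of side `≥ L₀`, a sector `M ≥ ρ|Λ|` having `E_M - E_0 < c'M`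
  (`hardCoreLatticeGas_gap_fails_macroscopic`; uses the a-priori bound (11.24) `hardCoreLatticeGas_groundEnergy_ge`).

WHAT THIS IS NOT: the factor `½` of the source's display (particle–hole symmetry) is not used — the non-symmetrised
variational bound `E_k - E_0 ≤ ⟨[(S⁻)^k,[H,(S⁺)^k]]⟩/⟨(S⁻)^k(S⁺)^k⟩` suffices for (nogap) and is what is proved;
(nocusp) is proved in its finite-volume grand-canonical / canonical forms (the source's bound on `E_GS(H - μS³_tot)`
and its Legendre transform) — the thermodynamic-limit phrasing `0 ≤ e_∞(ρ) - e_∞(½) ≤ const(ρ - ½)²` additionally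
needs the existence of `e_∞(ρ) = lim E_k/|Λ|` (Appendix of the source), not formalised here; the Mott phase
(Theorem 2: a gap for large `λ`) is not in this file; `d = 2` (no reflection-positivity BEC proof at `λ > 0`) is
covered only by the conditional §5/§9/§10 statements. Nothing here is a statement about the Hubbard model: it is a
transfer-model theorem recording that a certified order-parameter floor forces gapless particle-number excitations
(`E_k - E_0 = O(|Λ|⁻¹)`) and a compressible response to a chemical potential (`E_GS(H - μN) ≤ E_GS(H) + O(1) - cμ²|Λ|`),
the finite-size signatures of a superfluid as opposed to a Mott insulator.

## Mathlib / tree search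

`lean search 'cusp|noGap|no_gap|compressib|gapless_of_lro|sectorGap|chargeGap'` (decls): nothing relevant. The tree
has the Koma–Tasaki 1994 tower `E_M - E_0 ≤ c₃M²/|Λ|` for the PURE hopping gas (`hardCoreBoson_andersonTower_holds`,
`AndersonTowerOfStatesUnconditional.lean`) and for nearest-neighbour repulsion
(`HardCoreBosonRepulsionGroundStateUniqueTower.lean`); its hypothesis vi) (the rotation `exp[iπO⁽¹⁾]` commutes with
`H`) fails for the staggered field `λ ≠ 0`, so the source's direct argument is formalised here instead. Reused:
`hc_structureFactor_zero_ge_explicit`, `latticeGreen_zero_nonneg` (`HardCoreBosonOpticalLatticeBEC.lean`),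
`hc_corr_one_eq_zero_holds`, `hcStructureFactor_of_neZero` (`Barriers/AtomisticToContinuum/HalfFilling*`),
`Matrix.tendsto_gibbsState_atTop_holds`, `groundStateFunctional_eq_of_hasUniqueGroundState`,
`HardCoreBoson.hasUniqueGroundState_hardCoreLatticeGas`, `groundState_totalSpin_eq_zero`,
`exists_groundState_totalSpin_eq_zero`, `sum_num_eq_totalSpin_add`, `XXZKT.totalSpin_comm_totalSpin`,
`XXZKT.norm_siteSpin_le_half`, `norm_bondHopping_le`, `xyTorus_eq_bondSum`, `sum_pairs_eq_sum_edgeFinset'`,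
`minEnergyOn_le_rayleigh_of_mem`, `Matrix.minEnergyOn_top_holds`, `torusGreen_tendsto_latticeGreen`,
`commute_of_disjoint_holds`, `isSupportedOn_onSite_holds`, Mathlib `Matrix.l2_opNorm_mulVec`, `noncomm_ring`,
`match_scalars`; for (nocusp): `re_state_conj_exp_le_taylor` (`HardCoreBosonStaggeredDensity.lean`, the source's
(taylor)), `quarterTurn_conj_hardCoreLatticeGas`, `exists_unitary_hardCoreLatticeGas_translate`
(`HardCoreBosonCondensateWaveFunction.lean`), `Matrix.groundStateFunctional_conj_of_commute`,
`Matrix.groundStateFunctional_one`, `exists_unit_eigen_minEnergyOn` (`SectorGroundProjContinuity.lean`),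
`Matrix.groundSpace_ne_bot_holds`, `Matrix.groundEnergy_le_rayleigh_holds`,
`HardCoreBoson.commute_hardCoreLatticeGas_totalSpin`, `hardCoreLatticeGas_groundEnergy_ge` ((11.24)),
`XXZKT.totalSpin_comm_siteSpin`, Mathlib `Matrix.exp_conjTranspose`, `Matrix.exp_add_of_commute`, `module`.

## References

* [AizenmanEtAl2004] M. Aizenman, E. H. Lieb, R. Seiringer, J. P. Solovej, J. Yngvason, *Bose–Einstein quantum
  phase transition in an optical lattice model*, Phys. Rev. A 70 (2004) 023612 = arXiv:cond-mat/0403240, §4 "No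
  cusp, no gap": eqs. (eq:gap), (nogap), (nocusp), (fircl), (taylor) and the proofs of (nocusp) and (nogap) (read:
  pp. 9–10 of the arXiv version); §3 Theorem 1 and the display after Lemma 2 (p. 7).
* [LSSY2005] E. H. Lieb, R. Seiringer, J. P. Solovej, J. Yngvason, *The Mathematics of the Bose Gas and its
  Condensation*, Oberwolfach Seminars 34, Birkhäuser (2005), Ch. 11, (11.24), (11.26)–(11.30) (read: pp. 123–124).
* [Tasaki2020] H. Tasaki, *Physics and Mathematics of Quantum Many-Body Systems*, Springer (2020), §2.1 (2.1.6)
  (variational principle), §2.2 (2.2.11) (total-spin commutators), App. A.3 (`S⁻S⁺ = 𝐒² - (S³)² - S³`).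
-/

noncomputable section

open Filter Topology Matrix Complex Finset WithLp
open Literature.MathematicalPhysics.QuantumLattice Literature.MathematicalPhysics.QuantumLattice.SpinOperators
  Literature.Probability.LatticeModels Literature.Barriers.AtomisticToContinuum.BoseGas
open scoped ComplexOrder ComplexConjugate Matrix.Norms.L2Operator InnerProductSpace

namespace Literature.MathematicalPhysics.QuantumLattice

/-! ### §0 Commutators with powers: "the 2 commutators reduce the power by two" -/

section CommPow

variable {n : Type*} [Fintype n] [DecidableEq n]

/-- `A B^k - B^k A = Σ_{j<k} B^j [A,B] B^{k-1-j}` (the telescoping expansion behind "the 2 commutators reduce the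
power by two"). [cite: AizenmanEtAl2004, §4 (proof of (nogap))] -/
theorem mul_pow_sub_pow_mul_eq_sum (A B : Matrix n n ℂ) (k : ℕ) :
    A * B ^ k - B ^ k * A = ∑ j ∈ Finset.range k, B ^ j * (A * B - B * A) * B ^ (k - 1 - j) := by
  induction k with
  | zero => simp
  | succ k ih =>
    rw [Finset.sum_range_succ, show k + 1 - 1 - k = 0 by omega, pow_zero, Matrix.mul_one]
    have h1 : ∑ j ∈ Finset.range k, B ^ j * (A * B - B * A) * B ^ (k + 1 - 1 - j) =
        (∑ j ∈ Finset.range k, B ^ j * (A * B - B * A) * B ^ (k - 1 - j)) * B := by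
      rw [Finset.sum_mul]
      refine Finset.sum_congr rfl fun j hj => ?_
      rw [Finset.mem_range] at hj
      rw [show k + 1 - 1 - j = k - 1 - j + 1 by omega, pow_succ, ← Matrix.mul_assoc]
    rw [h1, ← ih, pow_succ]
    simp only [Matrix.sub_mul, Matrix.mul_sub, Matrix.mul_assoc]
    abel

/-- `‖B^j‖ ≤ ‖B‖^j` (operator norm). [folklore] -/
private theorem norm_pow_le_pow_norm [Nonempty n] (B : Matrix n n ℂ) (j : ℕ) : ‖B ^ j‖ ≤ ‖B‖ ^ j :=
  norm_pow_le B j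

/-- **One commutator reduces the power by one**: `‖A B^k - B^k A‖ ≤ k a^{k-1} b` for `‖B‖ ≤ a`, `‖[A,B]‖ ≤ b`.
[cite: AizenmanEtAl2004, §4 (proof of (nogap): "the 2 commutators reduce the power by two")] -/
theorem norm_mul_pow_sub_pow_mul_le [Nonempty n] {A B : Matrix n n ℂ} {a b : ℝ} (ha : ‖B‖ ≤ a)
    (hb : ‖A * B - B * A‖ ≤ b) (k : ℕ) :
    ‖A * B ^ k - B ^ k * A‖ ≤ k * a ^ (k - 1) * b := by
  have ha0 : 0 ≤ a := (norm_nonneg _).trans ha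
  have hb0 : 0 ≤ b := (norm_nonneg _).trans hb
  rw [mul_pow_sub_pow_mul_eq_sum]
  refine (norm_sum_le _ _).trans ?_
  have hterm : ∀ j ∈ Finset.range k, ‖B ^ j * (A * B - B * A) * B ^ (k - 1 - j)‖ ≤ a ^ (k - 1) * b := by
    intro j hj
    rw [Finset.mem_range] at hj
    have hBj : ‖B ^ j‖ ≤ a ^ j := (norm_pow_le_pow_norm B j).trans (pow_le_pow_left₀ (norm_nonneg _) ha j)
    have hBi : ‖B ^ (k - 1 - j)‖ ≤ a ^ (k - 1 - j) :=
      (norm_pow_le_pow_norm B _).trans (pow_le_pow_left₀ (norm_nonneg _) ha _)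
    calc ‖B ^ j * (A * B - B * A) * B ^ (k - 1 - j)‖
        ≤ ‖B ^ j‖ * ‖A * B - B * A‖ * ‖B ^ (k - 1 - j)‖ := by
          refine (norm_mul_le _ _).trans ?_
          exact mul_le_mul_of_nonneg_right (norm_mul_le _ _) (norm_nonneg _)
      _ ≤ a ^ j * b * a ^ (k - 1 - j) := by
          refine mul_le_mul (mul_le_mul hBj hb (norm_nonneg _) (pow_nonneg ha0 _)) hBi (norm_nonneg _)
            (mul_nonneg (pow_nonneg ha0 _) hb0)
      _ = a ^ (k - 1) * b := by
          rw [mul_right_comm, ← pow_add, show j + (k - 1 - j) = k - 1 by omega]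
  refine (Finset.sum_le_sum hterm).trans ?_
  rw [Finset.sum_const, Finset.card_range, nsmul_eq_mul, mul_assoc]

/-- `‖X Y Z‖ ≤ ‖X‖‖Y‖‖Z‖`. [folklore] -/
private theorem norm_mul_three_le [Nonempty n] (X Y Z : Matrix n n ℂ) : ‖X * Y * Z‖ ≤ ‖X‖ * ‖Y‖ * ‖Z‖ :=
  (norm_mul_le _ _).trans (mul_le_mul_of_nonneg_right (norm_mul_le _ _) (norm_nonneg _))

/-- **"Altogether there are `|Λ|^{2k+1}` factors, and the 2 commutators reduce the power by two"**, abstractly: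
for `‖P‖, ‖M‖ ≤ a`, `‖[M,P]‖ ≤ b`, `‖[H,P]‖ ≤ c`, `‖[M,[H,P]]‖ ≤ e`,
`‖[M^k, [H, P^k]]‖ ≤ k² a^{k-1} ((k-1) a^{k-2} b c + a^{k-1} e)` (with `a = b = |Λ|`, `c, e = O(|Λ|)` this is
`c″_k|Λ|^{2k-1}`). [cite: AizenmanEtAl2004, §4 (proof of (nogap), last paragraph)] -/
theorem norm_pow_comm_comm_pow_le [Nonempty n] {P M H : Matrix n n ℂ} {a b c e : ℝ}
    (hP : ‖P‖ ≤ a) (hM : ‖M‖ ≤ a) (hMP : ‖M * P - P * M‖ ≤ b) (hHP : ‖H * P - P * H‖ ≤ c)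
    (hMD : ‖M * (H * P - P * H) - (H * P - P * H) * M‖ ≤ e) (k : ℕ) :
    ‖M ^ k * (H * P ^ k - P ^ k * H) - (H * P ^ k - P ^ k * H) * M ^ k‖ ≤
      (k : ℝ) ^ 2 * a ^ (k - 1) * ((k - 1 : ℝ) * a ^ (k - 2) * b * c + a ^ (k - 1) * e) := by
  have ha0 : 0 ≤ a := (norm_nonneg _).trans hP
  have hb0 : 0 ≤ b := (norm_nonneg _).trans hMP
  have hc0 : 0 ≤ c := (norm_nonneg _).trans hHP
  have he0 : 0 ≤ e := (norm_nonneg _).trans hMD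
  rcases Nat.eq_zero_or_pos k with rfl | hk
  · simp
  have hk1 : (1 : ℝ) ≤ k := by exact_mod_cast hk
  set D := H * P - P * H with hD
  -- `[H, P^k] = Σ_j T_j`, `T_j = P^j D P^{k-1-j}`
  set T : ℕ → Matrix n n ℂ := fun j => P ^ j * D * P ^ (k - 1 - j) with hT
  have hHPk : H * P ^ k - P ^ k * H = ∑ j ∈ Finset.range k, T j := mul_pow_sub_pow_mul_eq_sum H P k
  have hPpow : ∀ j : ℕ, ‖P ^ j‖ ≤ a ^ j := fun j =>
    (norm_pow_le_pow_norm P j).trans (pow_le_pow_left₀ (norm_nonneg _) hP j)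
  -- `‖[M, T_j]‖ ≤ (k-1) a^{k-2} b c + a^{k-1} e`
  have hMT : ∀ j ∈ Finset.range k,
      ‖M * T j - T j * M‖ ≤ (k - 1 : ℝ) * a ^ (k - 2) * b * c + a ^ (k - 1) * e := by
    intro j hj
    rw [Finset.mem_range] at hj
    set i := k - 1 - j with hi
    have hji : (j : ℝ) + i = k - 1 := by
      have : j + i = k - 1 := by omega
      have h' : ((j + i : ℕ) : ℝ) = ((k - 1 : ℕ) : ℝ) := by rw [this]
      push_cast [Nat.cast_sub hk] at h'
      linarith
    have hsplit : M * T j - T j * M =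
        (M * P ^ j - P ^ j * M) * D * P ^ i + P ^ j * (M * D - D * M) * P ^ i +
          P ^ j * D * (M * P ^ i - P ^ i * M) := by
      simp only [hT, Matrix.sub_mul, Matrix.mul_sub, Matrix.mul_assoc]
      abel
    rw [hsplit]
    have h1 : ‖(M * P ^ j - P ^ j * M) * D * P ^ i‖ ≤ j * a ^ (k - 2) * b * c := by
      rcases Nat.eq_zero_or_pos j with hj0 | hjpos
      · rw [hj0, pow_zero, Matrix.mul_one, Matrix.one_mul, sub_self, Matrix.zero_mul, Matrix.zero_mul,
          norm_zero, Nat.cast_zero, zero_mul, zero_mul, zero_mul]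
      have hpow : a ^ (j - 1) * a ^ i = a ^ (k - 2) := by rw [← pow_add]; congr 1; omega
      calc ‖(M * P ^ j - P ^ j * M) * D * P ^ i‖ ≤ ‖M * P ^ j - P ^ j * M‖ * ‖D‖ * ‖P ^ i‖ :=
            norm_mul_three_le _ _ _
        _ ≤ (j * a ^ (j - 1) * b) * c * a ^ i :=
            mul_le_mul (mul_le_mul (norm_mul_pow_sub_pow_mul_le hP hMP j) hHP (norm_nonneg _)
              (by positivity)) (hPpow i) (norm_nonneg _) (by positivity)
        _ = j * a ^ (k - 2) * b * c := by rw [← hpow]; ring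
    have h2 : ‖P ^ j * (M * D - D * M) * P ^ i‖ ≤ a ^ (k - 1) * e := by
      have hpow : a ^ j * a ^ i = a ^ (k - 1) := by rw [← pow_add]; congr 1; omega
      calc ‖P ^ j * (M * D - D * M) * P ^ i‖ ≤ ‖P ^ j‖ * ‖M * D - D * M‖ * ‖P ^ i‖ :=
            norm_mul_three_le _ _ _
        _ ≤ a ^ j * e * a ^ i :=
            mul_le_mul (mul_le_mul (hPpow j) hMD (norm_nonneg _) (by positivity)) (hPpow i)
              (norm_nonneg _) (by positivity)
        _ = a ^ (k - 1) * e := by rw [← hpow]; ring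
    have h3 : ‖P ^ j * D * (M * P ^ i - P ^ i * M)‖ ≤ i * a ^ (k - 2) * b * c := by
      rcases Nat.eq_zero_or_pos i with hi0 | hipos
      · rw [hi0, pow_zero, Matrix.mul_one, Matrix.one_mul, sub_self, Matrix.mul_zero, norm_zero,
          Nat.cast_zero, zero_mul, zero_mul, zero_mul]
      have hpow : a ^ j * a ^ (i - 1) = a ^ (k - 2) := by rw [← pow_add]; congr 1; omega
      calc ‖P ^ j * D * (M * P ^ i - P ^ i * M)‖ ≤ ‖P ^ j‖ * ‖D‖ * ‖M * P ^ i - P ^ i * M‖ :=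
            norm_mul_three_le _ _ _
        _ ≤ a ^ j * c * (i * a ^ (i - 1) * b) :=
            mul_le_mul (mul_le_mul (hPpow j) hHP (norm_nonneg _) (by positivity))
              (norm_mul_pow_sub_pow_mul_le hP hMP i) (norm_nonneg _) (by positivity)
        _ = i * a ^ (k - 2) * b * c := by rw [← hpow]; ring
    calc ‖(M * P ^ j - P ^ j * M) * D * P ^ i + P ^ j * (M * D - D * M) * P ^ i +
            P ^ j * D * (M * P ^ i - P ^ i * M)‖
        ≤ j * a ^ (k - 2) * b * c + a ^ (k - 1) * e + i * a ^ (k - 2) * b * c :=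
          (norm_add_le _ _).trans (add_le_add ((norm_add_le _ _).trans (add_le_add h1 h2)) h3)
      _ = (k - 1 : ℝ) * a ^ (k - 2) * b * c + a ^ (k - 1) * e := by rw [← hji]; ring
  -- `[M^k, Σ T_j]`
  have hexp : M ^ k * (H * P ^ k - P ^ k * H) - (H * P ^ k - P ^ k * H) * M ^ k =
      ∑ j ∈ Finset.range k, -(T j * M ^ k - M ^ k * T j) := by
    rw [hHPk, Finset.mul_sum, Finset.sum_mul, ← Finset.sum_sub_distrib]
    refine Finset.sum_congr rfl fun j _ => ?_
    rw [neg_sub]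
  rw [hexp]
  refine (norm_sum_le _ _).trans ?_
  have hterm : ∀ j ∈ Finset.range k, ‖-(T j * M ^ k - M ^ k * T j)‖ ≤
      k * a ^ (k - 1) * ((k - 1 : ℝ) * a ^ (k - 2) * b * c + a ^ (k - 1) * e) := by
    intro j hj
    rw [norm_neg]
    have hc' : ‖T j * M - M * T j‖ ≤ (k - 1 : ℝ) * a ^ (k - 2) * b * c + a ^ (k - 1) * e := by
      rw [← norm_neg, neg_sub]; exact hMT j hj
    exact norm_mul_pow_sub_pow_mul_le hM hc' k
  refine (Finset.sum_le_sum hterm).trans ?_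
  rw [Finset.sum_const, Finset.card_range, nsmul_eq_mul]
  ring_nf
  rfl

end CommPow

/-! ### §1 The Casimir ladder: `‖(S⁺)^kΦ‖² ≥ Π_{j<k}(‖S⁺Φ‖² - j(j+1))` -/

section LadderAbstract

variable {n : Type*} [Fintype n]

/-- `⟪toLp v, toLp w⟫ = star v ⬝ᵥ w`. [folklore] -/
private theorem inner_toLp_eq_star_dotProduct (v w : n → ℂ) :
    ⟪(toLp 2 v : EuclideanSpace ℂ n), toLp 2 w⟫_ℂ = star v ⬝ᵥ w := by
  rw [EuclideanSpace.inner_toLp_toLp, dotProduct_comm]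

/-- `star v ⬝ᵥ v = ‖v‖²`. [folklore] -/
private theorem star_dotProduct_self_eq_norm_sq (v : n → ℂ) :
    star v ⬝ᵥ v = ((‖(toLp 2 v : EuclideanSpace ℂ n)‖ ^ 2 : ℝ) : ℂ) := by
  rw [← inner_toLp_eq_star_dotProduct, inner_self_eq_norm_sq_to_K]; norm_cast

/-- Cauchy–Schwarz for the vector state: `|star v ⬝ᵥ (C v)|² ≤ (star v ⬝ᵥ v)(star (Cv) ⬝ᵥ (Cv))`. [folklore] -/
private theorem normSq_star_dotProduct_mulVec_le (C : Matrix n n ℂ) (v : n → ℂ) :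
    ‖star v ⬝ᵥ (C *ᵥ v)‖ ^ 2 ≤ (star v ⬝ᵥ v).re * (star (C *ᵥ v) ⬝ᵥ (C *ᵥ v)).re := by
  rw [← inner_toLp_eq_star_dotProduct, star_dotProduct_self_eq_norm_sq, star_dotProduct_self_eq_norm_sq,
    Complex.ofReal_re, Complex.ofReal_re, ← mul_pow]
  exact pow_le_pow_left₀ (norm_nonneg _) (norm_inner_le_norm _ _) 2

/-- `star (A v) ⬝ᵥ w = star v ⬝ᵥ (Aᴴ w)`. [folklore] -/
private theorem star_mulVec_dotProduct (A : Matrix n n ℂ) (v w : n → ℂ) :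
    star (A *ᵥ v) ⬝ᵥ w = star v ⬝ᵥ (Aᴴ *ᵥ w) := by
  rw [star_mulVec, ← dotProduct_mulVec]

section Ladder

variable {P Z : Matrix n n ℂ}

/-- `[Z, Pᴴ] = -Pᴴ`: the adjoint of a raising operator lowers (`[S³, S⁻] = -S⁻`). [cite: Tasaki2020, §2.2 eq. (2.2.11)] -/
theorem ladder_Z_conjTranspose (hZ : Z.IsHermitian) (hZP : Z * P - P * Z = P) : Z * Pᴴ - Pᴴ * Z = -Pᴴ := by
  have h := congrArg conjTranspose hZP
  rw [conjTranspose_sub, conjTranspose_mul, conjTranspose_mul, hZ.eq] at h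
  calc Z * Pᴴ - Pᴴ * Z = -(Pᴴ * Z - Z * Pᴴ) := by abel
    _ = -Pᴴ := by rw [h]

/-- **The Casimir `PᴴP + Z² + Z` (`= 𝐒²_tot` for `P = S⁺_tot`, `Z = S³_tot`) commutes with `P`.**
[cite: Tasaki2020, App. A.3 (`𝐒² = S⁻S⁺ + (S³)² + S³` commutes with `S^±`)] -/
theorem ladder_cas_mul_P (hZP : Z * P - P * Z = P) (hPM : P * Pᴴ - Pᴴ * P = (2 : ℂ) • Z) :
    (Pᴴ * P + Z * Z + Z) * P = P * (Pᴴ * P + Z * Z + Z) := by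
  have hPZ : P * Z = Z * P - P :=
    calc P * Z = Z * P - (Z * P - P * Z) := by abel
      _ = Z * P - P := by rw [hZP]
  have key : (Pᴴ * P + Z * Z + Z) * P - P * (Pᴴ * P + Z * Z + Z) =
      -(P * Pᴴ - Pᴴ * P) * P + (Z * (Z * P - P * Z) + (Z * P - P * Z) * Z + (Z * P - P * Z)) := by
    noncomm_ring
  rw [hPM, hZP, hPZ] at key
  rw [← sub_eq_zero, key, Matrix.neg_mul, Matrix.smul_mul, two_smul]
  abel

/-- The Casimir commutes with `Z`. [cite: Tasaki2020, App. A.3] -/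
theorem ladder_Z_mul_cas (hZ : Z.IsHermitian) (hZP : Z * P - P * Z = P) :
    Z * (Pᴴ * P + Z * Z + Z) = (Pᴴ * P + Z * Z + Z) * Z := by
  have key : Z * (Pᴴ * P + Z * Z + Z) - (Pᴴ * P + Z * Z + Z) * Z =
      (Z * Pᴴ - Pᴴ * Z) * P + Pᴴ * (Z * P - P * Z) := by noncomm_ring
  rw [ladder_Z_conjTranspose hZ hZP, hZP, Matrix.neg_mul, neg_add_cancel] at key
  exact sub_eq_zero.1 key

/-- The Casimir is Hermitian. [cite: Tasaki2020, App. A.3] -/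
theorem ladder_cas_isHermitian (P : Matrix n n ℂ) (hZ : Z.IsHermitian) : (Pᴴ * P + Z * Z + Z).IsHermitian := by
  refine Matrix.IsHermitian.add (Matrix.IsHermitian.add ?_ ?_) hZ
  · rw [IsHermitian, conjTranspose_mul, conjTranspose_conjTranspose]
  · rw [IsHermitian, conjTranspose_mul, hZ.eq]

/-- `P` raises the `Z`-charge by one: `Zv = mv ⟹ Z(Pv) = (m+1)Pv` ("the sector of `½|Λ| + k` particles").
[cite: AizenmanEtAl2004, §4 (proof of (nogap))] [cite: Tasaki2020, §2.2 eq. (2.2.12)] -/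
theorem ladder_Z_mulVec_P (hZP : Z * P - P * Z = P) {v : n → ℂ} {m : ℂ} (hv : Z *ᵥ v = m • v) :
    Z *ᵥ (P *ᵥ v) = (m + 1) • (P *ᵥ v) := by
  have h : Z * P = P * Z + P :=
    calc Z * P = P * Z + (Z * P - P * Z) := by abel
      _ = P * Z + P := by rw [hZP]
  rw [mulVec_mulVec, h, Matrix.add_mulVec, ← mulVec_mulVec, hv, mulVec_smul, add_smul, one_smul]

/-- `‖Pv‖² = ⟨v, Cas v⟩ - (m² + m)‖v‖²` on the charge-`m` sector (`S⁻S⁺ = 𝐒² - (S³)² - S³`).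
[cite: Tasaki2020, App. A.3] -/
theorem ladder_norm_sq_P_mulVec (P Z : Matrix n n ℂ) {v : n → ℂ} {m : ℂ} (hv : Z *ᵥ v = m • v) :
    star (P *ᵥ v) ⬝ᵥ (P *ᵥ v) =
      star v ⬝ᵥ ((Pᴴ * P + Z * Z + Z) *ᵥ v) - (m ^ 2 + m) * (star v ⬝ᵥ v) := by
  rw [star_mulVec_dotProduct, mulVec_mulVec, Matrix.add_mulVec, Matrix.add_mulVec, ← mulVec_mulVec v Z Z,
    hv, mulVec_smul, hv, smul_smul, dotProduct_add, dotProduct_add, dotProduct_smul, dotProduct_smul,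
    smul_eq_mul, smul_eq_mul]
  ring

/-- `⟨Pv, Cas(Pv)⟩ = ‖Cas v‖² - (m² + m)⟨v, Cas v⟩` for `Zv = mv` (the Casimir reweighted one rung up).
[cite: Tasaki2020, App. A.3] -/
theorem ladder_cas_P_mulVec (hZ : Z.IsHermitian) (hZP : Z * P - P * Z = P) (hPM : P * Pᴴ - Pᴴ * P = (2 : ℂ) • Z)
    {v : n → ℂ} {m : ℂ} (hv : Z *ᵥ v = m • v) :
    star (P *ᵥ v) ⬝ᵥ ((Pᴴ * P + Z * Z + Z) *ᵥ (P *ᵥ v)) =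
      star ((Pᴴ * P + Z * Z + Z) *ᵥ v) ⬝ᵥ ((Pᴴ * P + Z * Z + Z) *ᵥ v) -
        (m ^ 2 + m) * (star v ⬝ᵥ ((Pᴴ * P + Z * Z + Z) *ᵥ v)) := by
  have hCas := ladder_cas_mul_P hZP hPM
  have hZC := ladder_Z_mul_cas hZ hZP
  have hCh := (ladder_cas_isHermitian P hZ).eq
  set C := Pᴴ * P + Z * Z + Z with hC
  -- `Pᴴ C P = Pᴴ P C = (C - Z² - Z) C`
  have hPP : Pᴴ * P = C - Z * Z - Z := by rw [hC]; abel
  have hZZC : (Z * Z + Z) * C = C * (Z * Z + Z) := by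
    rw [Matrix.add_mul, Matrix.mul_assoc, hZC, ← Matrix.mul_assoc, hZC, Matrix.mul_add, Matrix.mul_assoc]
  calc star (P *ᵥ v) ⬝ᵥ (C *ᵥ (P *ᵥ v))
      = star v ⬝ᵥ ((Pᴴ * P * C) *ᵥ v) := by
        rw [star_mulVec_dotProduct, mulVec_mulVec, mulVec_mulVec, Matrix.mul_assoc Pᴴ C P, hCas,
          ← Matrix.mul_assoc]
    _ = star v ⬝ᵥ ((C * C) *ᵥ v) - star v ⬝ᵥ ((C * (Z * Z + Z)) *ᵥ v) := by
        rw [hPP, ← hZZC, show (C - Z * Z - Z) * C = C * C - (Z * Z + Z) * C by noncomm_ring,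
          Matrix.sub_mulVec, dotProduct_sub]
    _ = star (C *ᵥ v) ⬝ᵥ (C *ᵥ v) - (m ^ 2 + m) * (star v ⬝ᵥ (C *ᵥ v)) := by
        have hZZv : (Z * Z + Z) *ᵥ v = (m ^ 2 + m) • v := by
          rw [Matrix.add_mulVec, ← mulVec_mulVec v Z Z, hv, mulVec_smul, hv, smul_smul, ← add_smul, sq]
        rw [← mulVec_mulVec v C (Z * Z + Z), hZZv, mulVec_smul, dotProduct_smul, smul_eq_mul,
          star_mulVec_dotProduct, hCh, mulVec_mulVec]

/-- **The denominators of (nogap): "Since there is BEC, `⟨(S⁻_tot)^k(S⁺_tot)^k⟩ ≥ c'_k|Λ|^{2k}` modulo lower order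
terms."**  For a unit vector `Φ` with `ZΦ = 0` and `A = ‖PΦ‖²` (`= ⟨S⁻S⁺⟩`, the order parameter): if `j(j+1) ≤ A`
for all `j < k` then `Π_{j<k}(A - j(j+1)) ≤ ‖P^kΦ‖²` — by induction on the rung, the mean of the Casimir being
non-decreasing along the ladder (Cauchy–Schwarz `⟨Cas⟩² ≤ ⟨Cas²⟩`). [cite: AizenmanEtAl2004, §4 (proof of (nogap))] -/
theorem ladder_prod_le_norm_sq [DecidableEq n] (hZ : Z.IsHermitian) (hZP : Z * P - P * Z = P)
    (hPM : P * Pᴴ - Pᴴ * P = (2 : ℂ) • Z) {Φ : n → ℂ} (hΦ : star Φ ⬝ᵥ Φ = 1) (hZΦ : Z *ᵥ Φ = 0) (k : ℕ)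
    (hk : ∀ j : ℕ, j < k → (j : ℝ) ^ 2 + j ≤ (star (P *ᵥ Φ) ⬝ᵥ (P *ᵥ Φ)).re) :
    ∏ j ∈ Finset.range k, ((star (P *ᵥ Φ) ⬝ᵥ (P *ᵥ Φ)).re - ((j : ℝ) ^ 2 + j)) ≤
      (star (P ^ k *ᵥ Φ) ⬝ᵥ (P ^ k *ᵥ Φ)).re := by
  have hnormP := fun (v : n → ℂ) (m : ℂ) (hv : Z *ᵥ v = m • v) => ladder_norm_sq_P_mulVec P Z hv
  have hcasP := fun (v : n → ℂ) (m : ℂ) (hv : Z *ᵥ v = m • v) => ladder_cas_P_mulVec hZ hZP hPM hv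
  set C := Pᴴ * P + Z * Z + Z with hC
  set A := (star (P *ᵥ Φ) ⬝ᵥ (P *ᵥ Φ)).re with hA
  set v : ℕ → (n → ℂ) := fun k => P ^ k *ᵥ Φ with hv
  have hv0 : v 0 = Φ := by simp [hv]
  have hvs : ∀ k, v (k + 1) = P *ᵥ v k := fun k => by simp only [hv]; rw [pow_succ', ← mulVec_mulVec]
  -- charges
  have hZv : ∀ k : ℕ, Z *ᵥ v k = ((k : ℂ)) • v k := by
    intro k
    induction k with
    | zero => rw [hv0, hZΦ, Nat.cast_zero, zero_smul]
    | succ k ih => rw [hvs k, ladder_Z_mulVec_P hZP ih, Nat.cast_succ]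
  -- the three real sequences
  set nn : ℕ → ℝ := fun k => (star (v k) ⬝ᵥ v k).re with hnn
  set C1 : ℕ → ℝ := fun k => (star (v k) ⬝ᵥ (C *ᵥ v k)).re with hC1
  set C2 : ℕ → ℝ := fun k => (star (C *ᵥ v k) ⬝ᵥ (C *ᵥ v k)).re with hC2
  have hc : ∀ k : ℕ, ((k : ℂ) ^ 2 + k) = (((k : ℝ) ^ 2 + k : ℝ) : ℂ) := fun k => by push_cast; ring
  have hnn_succ : ∀ k : ℕ, nn (k + 1) = C1 k - ((k : ℝ) ^ 2 + k) * nn k := by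
    intro k
    simp only [hnn, hC1]
    rw [hvs k, hnormP _ _ (hZv k), hc, Complex.sub_re, Complex.re_ofReal_mul]
  have hC1_succ : ∀ k : ℕ, C1 (k + 1) = C2 k - ((k : ℝ) ^ 2 + k) * C1 k := by
    intro k
    simp only [hC1, hC2]
    rw [hvs k, hcasP _ _ (hZv k), hc, Complex.sub_re, Complex.re_ofReal_mul]
  have hnn_nonneg : ∀ k, 0 ≤ nn k := fun k => by
    simp only [hnn]; rw [star_dotProduct_self_eq_norm_sq, Complex.ofReal_re]; positivity
  have hC2_nonneg : ∀ k, 0 ≤ C2 k := fun k => by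
    simp only [hC2]; rw [star_dotProduct_self_eq_norm_sq, Complex.ofReal_re]; positivity
  have hCS : ∀ k, C1 k ^ 2 ≤ nn k * C2 k := by
    intro k
    have h1 : |C1 k| ^ 2 ≤ ‖star (v k) ⬝ᵥ (C *ᵥ v k)‖ ^ 2 :=
      pow_le_pow_left₀ (abs_nonneg _) (Complex.abs_re_le_norm _) 2
    rw [sq_abs] at h1
    exact h1.trans (normSq_star_dotProduct_mulVec_le C (v k))
  have hnn0 : nn 0 = 1 := by simp only [hnn]; rw [hv0, hΦ, Complex.one_re]
  have hC10 : C1 0 = A := by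
    have h1 : nn 1 = A := by simp only [hnn, hA]; rw [hvs 0, hv0]
    rw [← h1, hnn_succ 0, Nat.cast_zero]; ring
  -- monotonicity of the Casimir along the ladder: `A‖v_k‖² ≤ ⟨v_k, C v_k⟩`
  have hmain : ∀ k : ℕ, A * nn k ≤ C1 k := by
    intro k
    induction k with
    | zero => simp only [hnn0, hC10, mul_one, le_refl]
    | succ k ih =>
      rw [hnn_succ k, hC1_succ k]
      have hnext : 0 ≤ C1 k - ((k : ℝ) ^ 2 + k) * nn k := by rw [← hnn_succ]; exact hnn_nonneg _
      rcases (hnn_nonneg k).eq_or_lt with h0 | hpos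
      · -- `v_k = 0`: everything vanishes
        have hC1z : C1 k = 0 := by
          have := hCS k; rw [← h0, zero_mul] at this; exact pow_eq_zero_iff (n := 2) (by norm_num) |>.1
            (le_antisymm this (sq_nonneg _))
        rw [hC1z, ← h0]; simp only [mul_zero, sub_zero]; exact hC2_nonneg k
      · have hprod : 0 ≤ (C1 k - A * nn k) * (C1 k - ((k : ℝ) ^ 2 + k) * nn k) :=
          mul_nonneg (sub_nonneg.2 ih) hnext
        have hCS' := hCS k
        -- multiply the goal by `nn k > 0`
        rw [← sub_nonneg]
        have : 0 * nn k ≤ (C2 k - ((k : ℝ) ^ 2 + k) * C1 k - A * (C1 k - ((k : ℝ) ^ 2 + k) * nn k)) * nn k := by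
          nlinarith [hCS', hprod]
        exact le_of_mul_le_mul_right this hpos
  -- one rung: `(A - k(k+1))‖v_k‖² ≤ ‖v_{k+1}‖²`
  have hstep : ∀ k : ℕ, (A - ((k : ℝ) ^ 2 + k)) * nn k ≤ nn (k + 1) := fun k => by
    rw [hnn_succ k]; nlinarith [hmain k]
  suffices h : ∀ k : ℕ, (∀ j : ℕ, j < k → (j : ℝ) ^ 2 + j ≤ A) →
      ∏ j ∈ Finset.range k, (A - ((j : ℝ) ^ 2 + j)) ≤ nn k from h k hk
  intro k
  induction k with
  | zero => intro; simp only [Finset.range_zero, Finset.prod_empty, hnn0, le_refl]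
  | succ k ih =>
    intro hk'
    rw [Finset.prod_range_succ]
    have h1 := ih fun j hj => hk' j (by omega)
    have h2 : 0 ≤ A - ((k : ℝ) ^ 2 + k) := sub_nonneg.2 (hk' k (by omega))
    calc (∏ j ∈ Finset.range k, (A - ((j : ℝ) ^ 2 + j))) * (A - ((k : ℝ) ^ 2 + k))
        ≤ nn k * (A - ((k : ℝ) ^ 2 + k)) := mul_le_mul_of_nonneg_right h1 h2
      _ = (A - ((k : ℝ) ^ 2 + k)) * nn k := mul_comm _ _
      _ ≤ nn (k + 1) := hstep k

end Ladder

end LadderAbstract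

/-! ### §2 Locality: commutators of a local term with a sum of one-site operators -/

section Local

variable {Λ : Type*} [Fintype Λ] [DecidableEq Λ]

/-- `[Σ_y o_y, T] = Σ_{y ∈ S} [o_y, T]` for `T` supported on `S` and one-site `o_y` (locality:
the sites off `S` do not contribute). [cite: AizenmanEtAl2004, §4 (proof of (nogap): "the 2 commutators reduce the power by two")] -/
theorem sum_onSite_comm_eq_sum_filter {T : Op Λ 2} {S : Finset Λ} (hT : IsSupportedOn T S)
    (o : Λ → Matrix (Fin 2) (Fin 2) ℂ) :
    (∑ y, onSite y (o y)) * T - T * (∑ y, onSite y (o y)) =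
      ∑ y ∈ S, (onSite y (o y) * T - T * onSite y (o y)) := by
  rw [Finset.sum_mul, Finset.mul_sum, ← Finset.sum_sub_distrib]
  refine (Finset.sum_subset (Finset.subset_univ S) fun y _ hy => ?_).symm
  exact sub_eq_zero.2 (commute_of_disjoint_holds (isSupportedOn_onSite_holds y (o y)) hT
    (Finset.disjoint_singleton_left.2 hy)).eq

/-- **One commutator with a global one-site sum costs a factor `2|S|ō`, not `|Λ|`**:
`‖[Σ_y o_y, T]‖ ≤ 2|S|·ō·‖T‖` for `T` supported on `S`, `‖o_y‖ ≤ ō`. [cite: AizenmanEtAl2004, §4 (proof of (nogap))] -/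
theorem norm_sum_onSite_comm_le {T : Op Λ 2} {S : Finset Λ} (hT : IsSupportedOn T S)
    {o : Λ → Matrix (Fin 2) (Fin 2) ℂ} {obar : ℝ} (ho : ∀ y, ‖(onSite y (o y) : Op Λ 2)‖ ≤ obar) :
    ‖(∑ y, onSite y (o y)) * T - T * (∑ y, onSite y (o y))‖ ≤ 2 * S.card * obar * ‖T‖ := by
  rw [sum_onSite_comm_eq_sum_filter hT]
  refine (norm_sum_le _ _).trans ?_
  have h : ∀ y ∈ S, ‖onSite y (o y) * T - T * onSite y (o y)‖ ≤ 2 * obar * ‖T‖ := by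
    intro y _
    have h1 := norm_mul_le (onSite y (o y) : Op Λ 2) T
    have h2 := norm_mul_le T (onSite y (o y) : Op Λ 2)
    have h3 := norm_sub_le (onSite y (o y) * T) (T * onSite y (o y))
    have h4 := mul_le_mul_of_nonneg_right (ho y) (norm_nonneg T)
    nlinarith
  refine (Finset.sum_le_sum h).trans ?_
  rw [Finset.sum_const, nsmul_eq_mul]; ring_nf; rfl

/-- The commutator `[Σ_y o_y, T]` is again supported on `S`. [cite: AizenmanEtAl2004, §4 (proof of (nogap))] -/
theorem isSupportedOn_sum_onSite_comm {T : Op Λ 2} {S : Finset Λ} (hT : IsSupportedOn T S)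
    (o : Λ → Matrix (Fin 2) (Fin 2) ℂ) :
    IsSupportedOn ((∑ y, onSite y (o y)) * T - T * (∑ y, onSite y (o y))) S := by
  rw [sum_onSite_comm_eq_sum_filter hT]
  refine IsSupportedOn.sum S fun y hy => ?_
  have hoy : IsSupportedOn (onSite y (o y) : Op Λ 2) S :=
    IsSupportedOn.mono_holds (isSupportedOn_onSite_holds y (o y)) (Finset.singleton_subset_iff.2 hy)
  rw [sub_eq_add_neg, ← neg_one_smul ℂ (T * onSite y (o y))]
  exact (IsSupportedOn.mul_holds hoy hT).add ((IsSupportedOn.mul_holds hT hoy).smul _)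

/-- A product of two spin-½ operators is supported on any set containing both sites. [folklore] -/
private theorem isSupportedOn_siteSpin_mul_nogap (x y : Λ) (α β : Fin 3) {S : Finset Λ} (hx : x ∈ S)
    (hy : y ∈ S) : IsSupportedOn (siteSpin 1 x α * siteSpin 1 y β : Op Λ 2) S :=
  IsSupportedOn.mul_holds (IsSupportedOn.mono_holds (isSupportedOn_onSite_holds x _) (by simpa using hx))
    (IsSupportedOn.mono_holds (isSupportedOn_onSite_holds y _) (by simpa using hy))

/-- The hopping term `t_{xy} = S¹_xS¹_y + S²_xS²_y` is supported on `{x, y}`. [folklore] -/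
private theorem isSupportedOn_hop_pair (x y : Λ) :
    IsSupportedOn (siteSpin 1 x 0 * siteSpin 1 y 0 + siteSpin 1 x 1 * siteSpin 1 y 1 : Op Λ 2) {x, y} :=
  (isSupportedOn_siteSpin_mul_nogap x y 0 0 (by simp) (by simp)).add
    (isSupportedOn_siteSpin_mul_nogap x y 1 1 (by simp) (by simp))

end Local

/-! ### §3 The hard-core gas as a sum of local terms; commutator bounds -/

section Model

variable {d : ℕ} (L : ℕ) [NeZero L]

/-- `H_XY = -Σ_x Σᵢ t_{x,x+eᵢ}` on the torus of side `≥ 3` (each bond once). [cite: AizenmanEtAl2004, §2 (2.1)] -/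
private theorem xyTorus_eq_neg_sum_hop_nogap (hL : 3 ≤ L) :
    xyTorus d L 1 = -∑ x : TorusSite d L, ∑ i : Fin d,
      (siteSpin 1 x 0 * siteSpin 1 (x + Pi.single i 1) 0 + siteSpin 1 x 1 * siteSpin 1 (x + Pi.single i 1) 1 :
        Op (TorusSite d L) 2) := by
  have hne : ∀ (x : TorusSite d L) (i : Fin d), x ≠ x + Pi.single i 1 := fun x i h =>
    single_ne_zero_of_two_le L (by omega) i (by simpa using h.symm)
  rw [xyTorus_eq_bondSum, ← sum_pairs_eq_sum_edgeFinset' L hL, ← Finset.sum_neg_distrib]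
  refine Finset.sum_congr rfl fun x _ => ?_
  rw [← Finset.sum_neg_distrib]
  refine Finset.sum_congr rfl fun i _ => ?_
  rw [Sym2.lift_mk]
  dsimp only
  rw [spinBond_eq_mul_of_ne (hne x i) 0, spinBond_eq_mul_of_ne (hne x i) 1]
  simp only [Complex.ofReal_neg, Complex.ofReal_one, neg_smul, one_smul, Complex.ofReal_zero, zero_smul, add_zero,
    neg_add]

/-- **The commutator of the hard-core gas with any operator, term by term**:
`[H, O] = -Σ_xΣᵢ[t_{x,x+eᵢ}, O] + λΣ_z(-1)^z[S³_z, O]` (the constant `½λ|Λ|` drops out).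
[cite: AizenmanEtAl2004, §2 (2.1), §4] -/
theorem hardCoreLatticeGas_comm_eq (hL : 3 ≤ L) (lam : ℝ) (O : Op (TorusSite d L) 2) :
    hardCoreLatticeGas d L lam * O - O * hardCoreLatticeGas d L lam =
      -(∑ x : TorusSite d L, ∑ i : Fin d,
          ((siteSpin 1 x 0 * siteSpin 1 (x + Pi.single i 1) 0 + siteSpin 1 x 1 * siteSpin 1 (x + Pi.single i 1) 1) * O -
            O * (siteSpin 1 x 0 * siteSpin 1 (x + Pi.single i 1) 0 + siteSpin 1 x 1 * siteSpin 1 (x + Pi.single i 1) 1))) +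
        (lam : ℂ) • ∑ z : TorusSite d L, ((-1 : ℂ) ^ (∑ i, (z i).val)) • (siteSpin 1 z 2 * O - O * siteSpin 1 z 2) := by
  rw [hardCoreLatticeGas_eq, xyTorus_eq_neg_sum_hop_nogap L hL]
  simp only [Matrix.add_mul, Matrix.mul_add, Matrix.neg_mul, Matrix.mul_neg, Matrix.smul_mul, Matrix.mul_smul,
    Finset.sum_mul, Finset.mul_sum, Matrix.one_mul, Matrix.mul_one, smul_sub, Finset.sum_sub_distrib,
    Finset.smul_sum, smul_add, Finset.sum_add_distrib]
  abel

/-- **First commutator bound** `‖[H, Σ_y o_y]‖ ≤ (2d + |λ|) ō |Λ|` for one-site `o_y` with `‖o_y‖ ≤ ō`: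
`|Λ|d` hopping terms (norm `≤ ½`, two sites) and `|Λ|` field terms (norm `≤ ½`, one site).
[cite: AizenmanEtAl2004, §4 (proof of (nogap): "altogether there are |Λ|^{2k+1} factors, and the 2 commutators reduce the power by two")] -/
theorem norm_hardCoreLatticeGas_comm_sum_onSite_le (hL : 3 ≤ L) (lam : ℝ)
    {o : TorusSite d L → Matrix (Fin 2) (Fin 2) ℂ} {obar : ℝ}
    (ho : ∀ y, ‖(onSite y (o y) : Op (TorusSite d L) 2)‖ ≤ obar) :
    ‖hardCoreLatticeGas d L lam * (∑ y, onSite y (o y)) - (∑ y, onSite y (o y)) * hardCoreLatticeGas d L lam‖ ≤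
      (2 * d + |lam|) * obar * Fintype.card (TorusSite d L) := by
  have hob : 0 ≤ obar := (norm_nonneg _).trans (ho 0)
  set O : Op (TorusSite d L) 2 := ∑ y, onSite y (o y) with hO
  set T : TorusSite d L → Fin d → Op (TorusSite d L) 2 := fun x i =>
    siteSpin 1 x 0 * siteSpin 1 (x + Pi.single i 1) 0 + siteSpin 1 x 1 * siteSpin 1 (x + Pi.single i 1) 1 with hT
  rw [hardCoreLatticeGas_comm_eq L hL lam O]
  -- hopping terms
  have hhop : ∀ (x : TorusSite d L) (i : Fin d), ‖T x i * O - O * T x i‖ ≤ 2 * obar := by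
    intro x i
    have hsuppT : IsSupportedOn (T x i) {x, x + Pi.single i 1} := isSupportedOn_hop_pair x (x + Pi.single i 1)
    have hc : (({x, x + Pi.single i 1} : Finset (TorusSite d L)).card : ℝ) ≤ 2 := by
      exact_mod_cast Finset.card_le_two
    have hn : ‖T x i‖ ≤ 1 / 2 := norm_bondHopping_le x (x + Pi.single i 1)
    rw [← norm_neg, neg_sub, hO]
    calc ‖(∑ y, onSite y (o y)) * T x i - T x i * ∑ y, onSite y (o y)‖
        ≤ 2 * (({x, x + Pi.single i 1} : Finset (TorusSite d L)).card : ℝ) * obar * ‖T x i‖ :=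
          norm_sum_onSite_comm_le hsuppT ho
      _ ≤ 2 * 2 * obar * (1 / 2) := by gcongr
      _ = 2 * obar := by ring
  -- field terms
  have hfield : ∀ z : TorusSite d L,
      ‖((-1 : ℂ) ^ (∑ i, (z i).val)) • (siteSpin 1 z 2 * O - O * siteSpin 1 z 2)‖ ≤ obar := by
    intro z
    rw [norm_smul, norm_pow, norm_neg, norm_one, one_pow, one_mul, ← norm_neg, neg_sub, hO]
    have hsupp : IsSupportedOn (siteSpin 1 z 2 : Op (TorusSite d L) 2) {z} := isSupportedOn_onSite_holds z _
    have hn : ‖(siteSpin 1 z 2 : Op (TorusSite d L) 2)‖ ≤ 1 / 2 := by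
      have h := XXZKT.norm_siteSpin_le_half (Λ := TorusSite d L) 1 z 2
      norm_num at h
      exact h
    calc ‖(∑ y, onSite y (o y)) * siteSpin 1 z 2 - siteSpin 1 z 2 * ∑ y, onSite y (o y)‖
        ≤ 2 * (({z} : Finset (TorusSite d L)).card : ℝ) * obar * ‖(siteSpin 1 z 2 : Op (TorusSite d L) 2)‖ :=
          norm_sum_onSite_comm_le hsupp ho
      _ ≤ 2 * 1 * obar * (1 / 2) := by rw [Finset.card_singleton, Nat.cast_one]; gcongr
      _ = obar := by ring
  have hN : (Fintype.card (TorusSite d L) : ℝ) = (Finset.univ : Finset (TorusSite d L)).card := by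
    rw [Finset.card_univ]
  calc ‖-(∑ x, ∑ i, (T x i * O - O * T x i)) +
          (lam : ℂ) • ∑ z, ((-1 : ℂ) ^ (∑ i, (z i).val)) • (siteSpin 1 z 2 * O - O * siteSpin 1 z 2)‖
      ≤ ‖∑ x, ∑ i, (T x i * O - O * T x i)‖ +
          ‖(lam : ℂ) • ∑ z, ((-1 : ℂ) ^ (∑ i, (z i).val)) • (siteSpin 1 z 2 * O - O * siteSpin 1 z 2)‖ := by
        rw [← norm_neg (∑ x, ∑ i, (T x i * O - O * T x i))]; exact norm_add_le _ _
    _ ≤ Fintype.card (TorusSite d L) * (d * (2 * obar)) + |lam| * (Fintype.card (TorusSite d L) * obar) := by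
        refine add_le_add ?_ ?_
        · refine (norm_sum_le _ _).trans ?_
          have : ∀ x ∈ (Finset.univ : Finset (TorusSite d L)), ‖∑ i, (T x i * O - O * T x i)‖ ≤ d * (2 * obar) :=
            fun x _ => (norm_sum_le _ _).trans ((Finset.sum_le_sum fun i _ => hhop x i).trans
              (by rw [Finset.sum_const, Finset.card_univ, Fintype.card_fin, nsmul_eq_mul]))
          refine (Finset.sum_le_sum this).trans ?_
          rw [Finset.sum_const, nsmul_eq_mul, hN]
        · rw [norm_smul, Complex.norm_real, Real.norm_eq_abs]
          refine mul_le_mul_of_nonneg_left ((norm_sum_le _ _).trans ?_) (abs_nonneg _)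
          refine (Finset.sum_le_sum fun z _ => hfield z).trans ?_
          rw [Finset.sum_const, nsmul_eq_mul, hN]
    _ = (2 * d + |lam|) * obar * Fintype.card (TorusSite d L) := by ring

/-- **Second commutator bound** `‖[Σ_y o'_y, [H, Σ_y o_y]]‖ ≤ (8d + 2|λ|) ō ō' |Λ|`: each local term
of `[H, Σ o]` stays local (two sites, resp. one site), so the outer commutator again costs `O(1)`
per term. [cite: AizenmanEtAl2004, §4 (proof of (nogap))] -/
theorem norm_sum_onSite_comm_hardCoreLatticeGas_comm_le (hL : 3 ≤ L) (lam : ℝ)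
    {o o' : TorusSite d L → Matrix (Fin 2) (Fin 2) ℂ} {obar obar' : ℝ}
    (ho : ∀ y, ‖(onSite y (o y) : Op (TorusSite d L) 2)‖ ≤ obar)
    (ho' : ∀ y, ‖(onSite y (o' y) : Op (TorusSite d L) 2)‖ ≤ obar') :
    ‖(∑ y, onSite y (o' y)) *
          (hardCoreLatticeGas d L lam * (∑ y, onSite y (o y)) - (∑ y, onSite y (o y)) * hardCoreLatticeGas d L lam) -
        (hardCoreLatticeGas d L lam * (∑ y, onSite y (o y)) - (∑ y, onSite y (o y)) * hardCoreLatticeGas d L lam) *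
          (∑ y, onSite y (o' y))‖ ≤
      (8 * d + 2 * |lam|) * obar * obar' * Fintype.card (TorusSite d L) := by
  have hob : 0 ≤ obar := (norm_nonneg _).trans (ho 0)
  have hob' : 0 ≤ obar' := (norm_nonneg _).trans (ho' 0)
  set O : Op (TorusSite d L) 2 := ∑ y, onSite y (o y) with hO
  set O' : Op (TorusSite d L) 2 := ∑ y, onSite y (o' y) with hO'
  set T : TorusSite d L → Fin d → Op (TorusSite d L) 2 := fun x i =>
    siteSpin 1 x 0 * siteSpin 1 (x + Pi.single i 1) 0 + siteSpin 1 x 1 * siteSpin 1 (x + Pi.single i 1) 1 with hT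
  rw [hardCoreLatticeGas_comm_eq L hL lam O]
  -- distribute the outer commutator
  set X : TorusSite d L → Fin d → Op (TorusSite d L) 2 := fun x i => T x i * O - O * T x i with hX
  set Y : TorusSite d L → Op (TorusSite d L) 2 := fun z => siteSpin 1 z 2 * O - O * siteSpin 1 z 2 with hY
  have hexp : O' * (-(∑ x, ∑ i, X x i) + (lam : ℂ) • ∑ z, ((-1 : ℂ) ^ (∑ i, (z i).val)) • Y z) -
      (-(∑ x, ∑ i, X x i) + (lam : ℂ) • ∑ z, ((-1 : ℂ) ^ (∑ i, (z i).val)) • Y z) * O' =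
      -(∑ x, ∑ i, (O' * X x i - X x i * O')) +
        (lam : ℂ) • ∑ z, ((-1 : ℂ) ^ (∑ i, (z i).val)) • (O' * Y z - Y z * O') := by
    simp only [Matrix.mul_add, Matrix.add_mul, Matrix.mul_neg, Matrix.neg_mul, Matrix.mul_smul, Matrix.smul_mul,
      Finset.mul_sum, Finset.sum_mul, smul_sub, Finset.sum_sub_distrib, Finset.smul_sum]
    abel
  rw [hexp]
  -- hopping terms: `X x i` is supported on the pair, with norm `≤ 2ō`
  have hhop : ∀ (x : TorusSite d L) (i : Fin d), ‖O' * X x i - X x i * O'‖ ≤ 8 * obar * obar' := by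
    intro x i
    have hsuppT : IsSupportedOn (T x i) {x, x + Pi.single i 1} := isSupportedOn_hop_pair x (x + Pi.single i 1)
    have hc : (({x, x + Pi.single i 1} : Finset (TorusSite d L)).card : ℝ) ≤ 2 := by
      exact_mod_cast Finset.card_le_two
    have hn : ‖T x i‖ ≤ 1 / 2 := norm_bondHopping_le x (x + Pi.single i 1)
    have hsupp : IsSupportedOn (X x i) {x, x + Pi.single i 1} := by
      have h := isSupportedOn_sum_onSite_comm hsuppT o
      rw [← hO] at h
      have h' := h.smul (-1)
      rw [neg_one_smul, neg_sub] at h'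
      exact h'
    have hnX : ‖X x i‖ ≤ 2 * obar := by
      have h : ‖O * T x i - T x i * O‖ ≤ 2 * (({x, x + Pi.single i 1} : Finset (TorusSite d L)).card : ℝ) *
          obar * ‖T x i‖ := by rw [hO]; exact norm_sum_onSite_comm_le hsuppT ho
      calc ‖X x i‖ = ‖O * T x i - T x i * O‖ := by rw [hX]; dsimp only; rw [← norm_neg, neg_sub]
        _ ≤ 2 * (({x, x + Pi.single i 1} : Finset (TorusSite d L)).card : ℝ) * obar * ‖T x i‖ := h
        _ ≤ 2 * 2 * obar * (1 / 2) := by gcongr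
        _ = 2 * obar := by ring
    calc ‖O' * X x i - X x i * O'‖
        ≤ 2 * (({x, x + Pi.single i 1} : Finset (TorusSite d L)).card : ℝ) * obar' * ‖X x i‖ := by
          rw [hO']; exact norm_sum_onSite_comm_le hsupp ho'
      _ ≤ 2 * 2 * obar' * (2 * obar) := by gcongr
      _ = 8 * obar * obar' := by ring
  -- field terms: `Y z` is supported on `{z}`, with norm `≤ ō`
  have hfield : ∀ z : TorusSite d L,
      ‖((-1 : ℂ) ^ (∑ i, (z i).val)) • (O' * Y z - Y z * O')‖ ≤ 2 * obar * obar' := by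
    intro z
    rw [norm_smul, norm_pow, norm_neg, norm_one, one_pow, one_mul]
    have hS : IsSupportedOn (siteSpin 1 z 2 : Op (TorusSite d L) 2) {z} := isSupportedOn_onSite_holds z _
    have hn : ‖(siteSpin 1 z 2 : Op (TorusSite d L) 2)‖ ≤ 1 / 2 := by
      have h := XXZKT.norm_siteSpin_le_half (Λ := TorusSite d L) 1 z 2
      norm_num at h
      exact h
    have hsupp : IsSupportedOn (Y z) {z} := by
      have h := isSupportedOn_sum_onSite_comm hS o
      rw [← hO] at h
      have h' := h.smul (-1)
      rw [neg_one_smul, neg_sub] at h'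
      exact h'
    have hnY : ‖Y z‖ ≤ obar := by
      have h : ‖O * siteSpin 1 z 2 - siteSpin 1 z 2 * O‖ ≤ 2 * (({z} : Finset (TorusSite d L)).card : ℝ) *
          obar * ‖(siteSpin 1 z 2 : Op (TorusSite d L) 2)‖ := by rw [hO]; exact norm_sum_onSite_comm_le hS ho
      calc ‖Y z‖ = ‖O * siteSpin 1 z 2 - siteSpin 1 z 2 * O‖ := by rw [hY]; dsimp only; rw [← norm_neg, neg_sub]
        _ ≤ 2 * (({z} : Finset (TorusSite d L)).card : ℝ) * obar * ‖(siteSpin 1 z 2 : Op (TorusSite d L) 2)‖ := h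
        _ ≤ 2 * 1 * obar * (1 / 2) := by rw [Finset.card_singleton, Nat.cast_one]; gcongr
        _ = obar := by ring
    calc ‖O' * Y z - Y z * O'‖ ≤ 2 * (({z} : Finset (TorusSite d L)).card : ℝ) * obar' * ‖Y z‖ := by
          rw [hO']; exact norm_sum_onSite_comm_le hsupp ho'
      _ ≤ 2 * 1 * obar' * obar := by rw [Finset.card_singleton, Nat.cast_one]; gcongr
      _ = 2 * obar * obar' := by ring
  have hN : (Fintype.card (TorusSite d L) : ℝ) = (Finset.univ : Finset (TorusSite d L)).card := by
    rw [Finset.card_univ]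
  calc ‖-(∑ x, ∑ i, (O' * X x i - X x i * O')) +
          (lam : ℂ) • ∑ z, ((-1 : ℂ) ^ (∑ i, (z i).val)) • (O' * Y z - Y z * O')‖
      ≤ ‖∑ x, ∑ i, (O' * X x i - X x i * O')‖ +
          ‖(lam : ℂ) • ∑ z, ((-1 : ℂ) ^ (∑ i, (z i).val)) • (O' * Y z - Y z * O')‖ := by
        rw [← norm_neg (∑ x, ∑ i, (O' * X x i - X x i * O'))]; exact norm_add_le _ _
    _ ≤ Fintype.card (TorusSite d L) * (d * (8 * obar * obar')) +
          |lam| * (Fintype.card (TorusSite d L) * (2 * obar * obar')) := by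
        refine add_le_add ?_ ?_
        · refine (norm_sum_le _ _).trans ?_
          have : ∀ x ∈ (Finset.univ : Finset (TorusSite d L)),
              ‖∑ i, (O' * X x i - X x i * O')‖ ≤ d * (8 * obar * obar') :=
            fun x _ => (norm_sum_le _ _).trans ((Finset.sum_le_sum fun i _ => hhop x i).trans
              (by rw [Finset.sum_const, Finset.card_univ, Fintype.card_fin, nsmul_eq_mul]))
          refine (Finset.sum_le_sum this).trans ?_
          rw [Finset.sum_const, nsmul_eq_mul, hN]
        · rw [norm_smul, Complex.norm_real, Real.norm_eq_abs]
          refine mul_le_mul_of_nonneg_left ((norm_sum_le _ _).trans ?_) (abs_nonneg _)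
          refine (Finset.sum_le_sum fun z _ => hfield z).trans ?_
          rw [Finset.sum_const, nsmul_eq_mul, hN]
    _ = (8 * d + 2 * |lam|) * obar * obar' * Fintype.card (TorusSite d L) := by ring

end Model

/-! ### §4 The ladder `S⁺_tot = Σ_x a†_x`, `S⁻_tot`, `S³_tot` of the hard-core gas -/

section LadderData

variable {Λ : Type*} [Fintype Λ] [DecidableEq Λ]

/-- `Σ_x a†_x = S¹_tot + iS²_tot = S⁺_tot`. [cite: AizenmanEtAl2004, §2 (Matsubara–Matsuda: `a†_x = S⁺_x`)] -/
theorem sum_cre_eq_totalSpin : (∑ x : Λ, HardCoreBoson.cre x : Op Λ 2) = totalSpin 1 0 + I • totalSpin 1 1 := by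
  simp only [HardCoreBoson.cre_eq, Finset.sum_add_distrib, ← Finset.smul_sum]
  rfl

/-- `Σ_x a_x = S¹_tot - iS²_tot = S⁻_tot`. [cite: AizenmanEtAl2004, §2] -/
theorem sum_ann_eq_totalSpin : (∑ x : Λ, HardCoreBoson.ann x : Op Λ 2) = totalSpin 1 0 - I • totalSpin 1 1 := by
  simp only [HardCoreBoson.ann_eq, Finset.sum_sub_distrib, ← Finset.smul_sum]
  rfl

/-- `(Σ_x a†_x)ᴴ = Σ_x a_x`. [cite: AizenmanEtAl2004, §2] -/
theorem conjTranspose_sum_cre : (∑ x : Λ, HardCoreBoson.cre x : Op Λ 2)ᴴ = ∑ x : Λ, HardCoreBoson.ann x := by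
  rw [conjTranspose_sum]
  exact Finset.sum_congr rfl fun x _ => HardCoreBoson.cre_conjTranspose x

/-- `[S³_tot, S¹_tot] = iS²_tot`. [cite: Tasaki2020, §2.2 eq. (2.2.11)] -/
private theorem totalSpin_two_comm_zero :
    (totalSpin 1 2 * totalSpin 1 0 - totalSpin 1 0 * totalSpin 1 2 : Op Λ 2) = I • totalSpin 1 1 := by
  rw [XXZKT.totalSpin_comm_totalSpin 1 2 0, Fin.sum_univ_three]
  simp [show KomaTasaki.leviCivita 2 0 0 = 0 by decide, show KomaTasaki.leviCivita 2 0 1 = 1 by decide,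
    show KomaTasaki.leviCivita 2 0 2 = 0 by decide]

/-- `[S³_tot, S²_tot] = -iS¹_tot`. [cite: Tasaki2020, §2.2 eq. (2.2.11)] -/
private theorem totalSpin_two_comm_one :
    (totalSpin 1 2 * totalSpin 1 1 - totalSpin 1 1 * totalSpin 1 2 : Op Λ 2) = -(I • totalSpin 1 0) := by
  rw [XXZKT.totalSpin_comm_totalSpin 1 2 1, Fin.sum_univ_three]
  simp [show KomaTasaki.leviCivita 2 1 0 = -1 by decide, show KomaTasaki.leviCivita 2 1 1 = 0 by decide,
    show KomaTasaki.leviCivita 2 1 2 = 0 by decide]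

/-- `[S¹_tot, S²_tot] = iS³_tot`. [cite: Tasaki2020, §2.2 eq. (2.2.11)] -/
private theorem totalSpin_zero_comm_one :
    (totalSpin 1 0 * totalSpin 1 1 - totalSpin 1 1 * totalSpin 1 0 : Op Λ 2) = I • totalSpin 1 2 := by
  rw [XXZKT.totalSpin_comm_totalSpin 1 0 1, Fin.sum_univ_three]
  simp [show KomaTasaki.leviCivita 0 1 0 = 0 by decide, show KomaTasaki.leviCivita 0 1 1 = 0 by decide,
    show KomaTasaki.leviCivita 0 1 2 = 1 by decide]

/-- **`S⁺_tot` raises the particle number**: `[S³_tot, Σ_x a†_x] = Σ_x a†_x`. [cite: AizenmanEtAl2004, §4 ("the sector of ½|Λ| + k particles ... `(S⁺_tot)^k|0⟩`")] -/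
theorem totalSpin_two_comm_sum_cre :
    (totalSpin 1 2 * (∑ x : Λ, HardCoreBoson.cre x) - (∑ x : Λ, HardCoreBoson.cre x) * totalSpin 1 2 : Op Λ 2) =
      ∑ x : Λ, HardCoreBoson.cre x := by
  rw [sum_cre_eq_totalSpin]
  have h1 := totalSpin_two_comm_zero (Λ := Λ)
  have h2 := totalSpin_two_comm_one (Λ := Λ)
  calc (totalSpin 1 2 * (totalSpin 1 0 + I • totalSpin 1 1) - (totalSpin 1 0 + I • totalSpin 1 1) * totalSpin 1 2 :
        Op Λ 2)
      = (totalSpin 1 2 * totalSpin 1 0 - totalSpin 1 0 * totalSpin 1 2) +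
          I • (totalSpin 1 2 * totalSpin 1 1 - totalSpin 1 1 * totalSpin 1 2) := by
        rw [Matrix.mul_add, Matrix.add_mul, Matrix.mul_smul, Matrix.smul_mul, smul_sub]; abel
    _ = totalSpin 1 0 + I • totalSpin 1 1 := by
        rw [h1, h2, smul_neg, smul_smul, I_mul_I, neg_smul, neg_neg, one_smul, add_comm]

/-- **`[S⁺_tot, S⁻_tot] = 2S³_tot`**: `(Σa†)(Σa†)ᴴ - (Σa†)ᴴ(Σa†) = 2S³_tot`. [cite: Tasaki2020, §2.2 eq. (2.2.11) and App. A.3] -/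
theorem sum_cre_comm_conjTranspose :
    ((∑ x : Λ, HardCoreBoson.cre x) * (∑ x : Λ, HardCoreBoson.cre x)ᴴ -
        (∑ x : Λ, HardCoreBoson.cre x)ᴴ * (∑ x : Λ, HardCoreBoson.cre x) : Op Λ 2) = (2 : ℂ) • totalSpin 1 2 := by
  rw [conjTranspose_sum_cre, sum_cre_eq_totalSpin, sum_ann_eq_totalSpin]
  have h := totalSpin_zero_comm_one (Λ := Λ)
  calc ((totalSpin 1 0 + I • totalSpin 1 1) * (totalSpin 1 0 - I • totalSpin 1 1) -
        (totalSpin 1 0 - I • totalSpin 1 1) * (totalSpin 1 0 + I • totalSpin 1 1) : Op Λ 2)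
      = (-(2 * I)) • (totalSpin 1 0 * totalSpin 1 1 - totalSpin 1 1 * totalSpin 1 0) := by
        simp only [Matrix.mul_add, Matrix.add_mul, Matrix.mul_sub, Matrix.sub_mul, Matrix.mul_smul, Matrix.smul_mul,
          smul_sub, smul_smul]
        module
    _ = (2 : ℂ) • totalSpin 1 2 := by
        rw [h, smul_smul]; congr 1; rw [neg_mul, mul_assoc, I_mul_I]; ring

/-- `‖a†_x‖ ≤ 1` (spin ½: `‖S¹‖, ‖S²‖ ≤ ½`). [cite: AizenmanEtAl2004, §2] -/
theorem norm_cre_le_one (x : Λ) : ‖(HardCoreBoson.cre x : Op Λ 2)‖ ≤ 1 := by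
  rw [HardCoreBoson.cre_eq]
  have h0 := XXZKT.norm_siteSpin_le_half (Λ := Λ) 1 x 0
  have h1 := XXZKT.norm_siteSpin_le_half (Λ := Λ) 1 x 1
  norm_num at h0 h1
  calc ‖(siteSpin 1 x 0 + I • siteSpin 1 x 1 : Op Λ 2)‖ ≤ ‖(siteSpin 1 x 0 : Op Λ 2)‖ + ‖(I • siteSpin 1 x 1 : Op Λ 2)‖ :=
        norm_add_le _ _
    _ ≤ 1 / 2 + 1 / 2 := by rw [norm_smul, Complex.norm_I, one_mul]; exact add_le_add h0 h1
    _ = 1 := by norm_num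

/-- `‖a_x‖ ≤ 1`. [cite: AizenmanEtAl2004, §2] -/
theorem norm_ann_le_one (x : Λ) : ‖(HardCoreBoson.ann x : Op Λ 2)‖ ≤ 1 := by
  rw [← HardCoreBoson.cre_conjTranspose, Matrix.l2_opNorm_conjTranspose]
  exact norm_cre_le_one x

/-- `‖Σ_x a†_x‖ ≤ |Λ|`. [cite: AizenmanEtAl2004, §4 ("altogether there are |Λ|^{2k+1} factors")] -/
theorem norm_sum_cre_le : ‖(∑ x : Λ, HardCoreBoson.cre x : Op Λ 2)‖ ≤ Fintype.card Λ :=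
  (norm_sum_le _ _).trans (by
    refine (Finset.sum_le_sum fun x _ => norm_cre_le_one x).trans ?_
    rw [Finset.sum_const, Finset.card_univ, nsmul_eq_mul, mul_one])

/-- `‖Σ_x a_x‖ ≤ |Λ|`. [cite: AizenmanEtAl2004, §4] -/
theorem norm_sum_ann_le : ‖(∑ x : Λ, HardCoreBoson.ann x : Op Λ 2)‖ ≤ Fintype.card Λ :=
  (norm_sum_le _ _).trans (by
    refine (Finset.sum_le_sum fun x _ => norm_ann_le_one x).trans ?_
    rw [Finset.sum_const, Finset.card_univ, nsmul_eq_mul, mul_one])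

/-- `‖S³_tot‖ ≤ |Λ|/2` for spin ½. [cite: Tasaki2020, §2.2] -/
theorem norm_totalSpin_two_le_half_card : ‖(totalSpin 1 2 : Op Λ 2)‖ ≤ Fintype.card Λ / 2 := by
  have h : ∀ x : Λ, ‖(siteSpin 1 x 2 : Op Λ 2)‖ ≤ 1 / 2 := fun x => by
    have h := XXZKT.norm_siteSpin_le_half (Λ := Λ) 1 x 2
    norm_num at h
    exact h
  calc ‖(totalSpin 1 2 : Op Λ 2)‖ ≤ ∑ x : Λ, ‖(siteSpin 1 x 2 : Op Λ 2)‖ := norm_sum_le _ _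
    _ ≤ ∑ _x : Λ, (1 / 2 : ℝ) := Finset.sum_le_sum fun x _ => h x
    _ = Fintype.card Λ / 2 := by rw [Finset.sum_const, Finset.card_univ, nsmul_eq_mul]; ring

/-- **The order parameter behind the denominators**: for `S³_totΦ = 0`,
`‖(Σ_x a†_x)Φ‖² = Σ_{x,y}⟨Φ, (S¹_xS¹_y + S²_xS²_y)Φ⟩` (`S⁻_totS⁺_tot = (S¹_tot)² + (S²_tot)² - S³_tot`).
[cite: AizenmanEtAl2004, §4 ("Since there is BEC, ⟨(S⁻_tot)^k(S⁺_tot)^k⟩ ≥ c'_k|Λ|^{2k}")] -/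
theorem star_sum_cre_mulVec_dotProduct_self {Φ : TensorIndex Λ 2 → ℂ} (hZ : totalSpin 1 2 *ᵥ Φ = 0) :
    star ((∑ x : Λ, HardCoreBoson.cre x) *ᵥ Φ) ⬝ᵥ ((∑ x : Λ, HardCoreBoson.cre x) *ᵥ Φ) =
      ∑ x : Λ, ∑ y : Λ, star Φ ⬝ᵥ ((siteSpin 1 x 0 * siteSpin 1 y 0 + siteSpin 1 x 1 * siteSpin 1 y 1) *ᵥ Φ) := by
  rw [star_mulVec, ← dotProduct_mulVec, mulVec_mulVec, conjTranspose_sum_cre, sum_ann_eq_totalSpin,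
    sum_cre_eq_totalSpin]
  have h := totalSpin_zero_comm_one (Λ := Λ)
  have hprod : ((totalSpin 1 0 - I • totalSpin 1 1) * (totalSpin 1 0 + I • totalSpin 1 1) : Op Λ 2) =
      totalSpin 1 0 * totalSpin 1 0 + totalSpin 1 1 * totalSpin 1 1 +
        I • (totalSpin 1 0 * totalSpin 1 1 - totalSpin 1 1 * totalSpin 1 0) := by
    simp only [Matrix.mul_add, Matrix.sub_mul, Matrix.mul_smul, Matrix.smul_mul]
    match_scalars <;> simp
  rw [hprod, h, smul_smul, I_mul_I, Matrix.add_mulVec, Matrix.smul_mulVec, hZ, smul_zero, add_zero]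
  simp only [totalSpin, Finset.sum_mul, Finset.mul_sum, Matrix.add_mulVec, Matrix.sum_mulVec, dotProduct_add,
    dotProduct_sum, ← Finset.sum_add_distrib]
  exact Finset.sum_comm

end LadderData


/-! ### §5 (nogap): `E_k - E_0 ≤ c_k/|Λ|` in the BEC phase, from a ground-state LRO floor -/

section NoGap

variable {n : Type*} [Fintype n] [DecidableEq n]

/-- The variational principle in a sector with an unnormalised trial vector:
`E(K) ≤ Re⟨v, Hv⟩/‖v‖²` for `0 ≠ v ∈ K`. [cite: Tasaki2020, §2.1 (2.1.6)] -/
private theorem minEnergyOn_le_rayleigh_div_nogap {H : Matrix n n ℂ} (hH : H.IsHermitian) (K : Submodule ℂ (n → ℂ))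
    {v : n → ℂ} (hv : v ∈ K) (hv0 : 0 < (star v ⬝ᵥ v).re) :
    H.minEnergyOn K ≤ (star v ⬝ᵥ (H *ᵥ v)).re / (star v ⬝ᵥ v).re := by
  set r : ℝ := (star v ⬝ᵥ v).re with hr
  have hvv : star v ⬝ᵥ v = (r : ℂ) := by
    rw [hr, star_dotProduct_self_eq_norm_sq, Complex.ofReal_re]
  set c : ℝ := (Real.sqrt r)⁻¹ with hc
  have hc2 : c ^ 2 * r = 1 := by
    rw [hc, inv_pow, Real.sq_sqrt hv0.le, inv_mul_cancel₀ hv0.ne']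
  set ψ : n → ℂ := (c : ℂ) • v with hψ
  have hψK : ψ ∈ K := K.smul_mem _ hv
  have hψ1 : star ψ ⬝ᵥ ψ = 1 := by
    rw [hψ, star_smul, smul_dotProduct, dotProduct_smul, hvv, Complex.star_def, Complex.conj_ofReal, smul_eq_mul,
      smul_eq_mul]
    exact_mod_cast (by rw [← hc2]; ring : (c : ℝ) * (c * r) = 1)
  have h := minEnergyOn_le_rayleigh_of_mem hH K hψK hψ1
  rw [hψ, mulVec_smul, star_smul, smul_dotProduct, dotProduct_smul, Complex.star_def, Complex.conj_ofReal,
    smul_eq_mul, smul_eq_mul, ← mul_assoc, ← Complex.ofReal_mul, Complex.re_ofReal_mul] at h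
  rw [le_div_iff₀ hv0]
  calc H.minEnergyOn K * r ≤ c * c * (star v ⬝ᵥ H *ᵥ v).re * r := mul_le_mul_of_nonneg_right h hv0.le
    _ = (star v ⬝ᵥ H *ᵥ v).re * (c ^ 2 * r) := by ring
    _ = (star v ⬝ᵥ H *ᵥ v).re := by rw [hc2, mul_one]

omit [DecidableEq n] in
/-- `⟨x, Ay⟩ = ⟨Ax, y⟩` for Hermitian `A`. [cite: Tasaki2020, §2.1] -/
private theorem star_dotProduct_mulVec_of_isHermitian_nogap {A : Matrix n n ℂ} (hA : A.IsHermitian) (x y : n → ℂ) :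
    star x ⬝ᵥ (A *ᵥ y) = star (A *ᵥ x) ⬝ᵥ y := by
  rw [star_mulVec, hA.eq, ← dotProduct_mulVec]

/-- `|⟨Φ, XΦ⟩| ≤ ‖X‖` for a unit vector. [cite: Tasaki2020, §2.1] -/
private theorem norm_star_dotProduct_mulVec_le_opNorm_nogap (X : Matrix n n ℂ) {Φ : n → ℂ} (hΦ : star Φ ⬝ᵥ Φ = 1) :
    ‖star Φ ⬝ᵥ (X *ᵥ Φ)‖ ≤ ‖X‖ := by
  have h1 : ‖(toLp 2 Φ : EuclideanSpace ℂ n)‖ = 1 := by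
    have h := star_dotProduct_self_eq_norm_sq Φ
    rw [hΦ] at h
    have h' : ‖(toLp 2 Φ : EuclideanSpace ℂ n)‖ ^ 2 = 1 := by exact_mod_cast h.symm
    nlinarith [norm_nonneg (toLp 2 Φ : EuclideanSpace ℂ n)]
  have hmv : ‖(toLp 2 (X *ᵥ Φ) : EuclideanSpace ℂ n)‖ ≤ ‖X‖ * ‖(toLp 2 Φ : EuclideanSpace ℂ n)‖ :=
    Matrix.l2_opNorm_mulVec X (toLp 2 Φ)
  rw [← inner_toLp_eq_star_dotProduct]
  calc ‖⟪(toLp 2 Φ : EuclideanSpace ℂ n), toLp 2 (X *ᵥ Φ)⟫_ℂ‖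
      ≤ ‖(toLp 2 Φ : EuclideanSpace ℂ n)‖ * ‖(toLp 2 (X *ᵥ Φ) : EuclideanSpace ℂ n)‖ := norm_inner_le_norm _ _
    _ ≤ 1 * (‖X‖ * 1) := by
        rw [h1] at hmv ⊢; exact mul_le_mul_of_nonneg_left hmv zero_le_one
    _ = ‖X‖ := by ring

variable {d : ℕ} (L : ℕ) [NeZero L]

/-- **The particle-number dictionary**: the magnetisation sector `S³_tot = M` is the sector of
`N = |Λ|/2 + M` hard-core bosons (`Σ_x n_x = S³_tot + |Λ|/2`). [cite: AizenmanEtAl2004, §4 ("the sector of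
`½|Λ| + k` particles (which corresponds to `S³_tot = k` in the spin language)")] -/
theorem mem_spinZSector_iff_sum_num (M : ℝ) (v : TensorIndex (TorusSite d L) 2 → ℂ) :
    v ∈ spinZSector (Λ := TorusSite d L) 1 M ↔
      (∑ x : TorusSite d L, HardCoreBoson.num x) *ᵥ v = ((Fintype.card (TorusSite d L) : ℂ) / 2 + M) • v := by
  rw [spinZSector, Module.End.mem_eigenspace_iff, Matrix.toLin'_apply, HardCoreBoson.sum_num_eq_totalSpin_add,
    Matrix.add_mulVec, Matrix.smul_mulVec, Matrix.one_mulVec, add_smul]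
  constructor
  · intro h; rw [h, add_comm]
  · intro h
    have := congrArg (fun w => w - (((Fintype.card (TorusSite d L) : ℂ) / 2) • v)) h
    simpa [add_sub_cancel_right, add_sub_cancel_left] using this

/-- `S³_tot (S⁺_tot)^k Φ = k (S⁺_tot)^k Φ` for `S³_totΦ = 0`: the trial state `(S⁺_tot)^k|0⟩` has `|Λ|/2 + k`
particles. [cite: AizenmanEtAl2004, §4 (proof of (nogap))] -/
theorem totalSpin_two_mulVec_sum_cre_pow {Φ : TensorIndex (TorusSite d L) 2 → ℂ} (hZ : totalSpin 1 2 *ᵥ Φ = 0)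
    (k : ℕ) :
    totalSpin 1 2 *ᵥ ((∑ x : TorusSite d L, HardCoreBoson.cre x) ^ k *ᵥ Φ) =
      (k : ℂ) • ((∑ x : TorusSite d L, HardCoreBoson.cre x) ^ k *ᵥ Φ) := by
  induction k with
  | zero => rw [pow_zero, Matrix.one_mulVec, hZ, Nat.cast_zero, zero_smul]
  | succ k ih =>
    rw [pow_succ', ← mulVec_mulVec, ladder_Z_mulVec_P (totalSpin_two_comm_sum_cre (Λ := TorusSite d L)) ih,
      Nat.cast_succ]

/-- **ALSSY's variational bound for the sector `|Λ|/2 + k`, with the commutator counting done**: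
for the unique (half-filled, `S³_tot = 0`) ground state `Φ` of the hard-core lattice gas on an even torus and
`A = ‖S⁺_totΦ‖² = Σ_{x,y}⟨Φ,(S¹_xS¹_y + S²_xS²_y)Φ⟩`, if `2(k-1)k ≤ A` then the sector `S³_tot = k`
(`|Λ|/2 + k` bosons) is nonempty and
`E_k ≤ E_0 + k²((k-1)(2d+|λ|) + 8d + 2|λ|)|Λ|^{2k-1}/(A/2)^k`
(trial state `(S⁺_tot)^kΦ`; numerator `⟨(S⁺)^kΦ,(H-E_0)(S⁺)^kΦ⟩ ≤ ‖[(S⁻_tot)^k,[H,(S⁺_tot)^k]]‖ ≤ c″_k|Λ|^{2k-1}`,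
denominator `‖(S⁺)^kΦ‖² ≥ Π_{j<k}(A - j(j+1)) ≥ (A/2)^k`).
[cite: AizenmanEtAl2004, §4 eq. (nogap) and its proof (last display of §4)] -/
theorem hardCoreLatticeGas_lowestEnergyInSector_le (hd : 0 < d) (hL : Even L) (h3 : 3 ≤ L) (lam : ℝ)
    {Φ : TensorIndex (TorusSite d L) 2 → ℂ} (hΦ : Φ ∈ (hardCoreLatticeGas d L lam).groundSpace)
    (hΦ1 : star Φ ⬝ᵥ Φ = 1) {k : ℕ} (hk : 1 ≤ k)
    (hA : 2 * (((k : ℝ) - 1) * k) ≤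
      (star ((∑ x : TorusSite d L, HardCoreBoson.cre x) *ᵥ Φ) ⬝ᵥ ((∑ x : TorusSite d L, HardCoreBoson.cre x) *ᵥ Φ)).re)
    (hA0 : 0 < (star ((∑ x : TorusSite d L, HardCoreBoson.cre x) *ᵥ Φ) ⬝ᵥ
      ((∑ x : TorusSite d L, HardCoreBoson.cre x) *ᵥ Φ)).re) :
    spinZSector (Λ := TorusSite d L) 1 (k : ℝ) ≠ ⊥ ∧
      lowestEnergyInSector 1 (hardCoreLatticeGas d L lam) k ≤ (hardCoreLatticeGas d L lam).groundEnergy +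
        (k : ℝ) ^ 2 * (((k : ℝ) - 1) * (2 * d + |lam|) + (8 * d + 2 * |lam|)) *
          (Fintype.card (TorusSite d L) : ℝ) ^ (2 * k - 1) /
          ((star ((∑ x : TorusSite d L, HardCoreBoson.cre x) *ᵥ Φ) ⬝ᵥ
            ((∑ x : TorusSite d L, HardCoreBoson.cre x) *ᵥ Φ)).re / 2) ^ k := by
  set H : Op (TorusSite d L) 2 := hardCoreLatticeGas d L lam with hHdef
  set P : Op (TorusSite d L) 2 := ∑ x : TorusSite d L, HardCoreBoson.cre x with hPdef
  set N : ℝ := ((Fintype.card (TorusSite d L) : ℕ) : ℝ) with hNdef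
  set A : ℝ := (star (P *ᵥ Φ) ⬝ᵥ (P *ᵥ Φ)).re with hAdef
  set E₀ : ℝ := H.groundEnergy with hE₀
  have hHh : H.IsHermitian := hardCoreLatticeGas_isHermitian d L lam
  have hHΦ : H *ᵥ Φ = (E₀ : ℂ) • Φ := by
    have h := Module.End.mem_eigenspace_iff.1 hΦ
    rwa [Matrix.toLin'_apply] at h
  have hZΦ : totalSpin 1 2 *ᵥ Φ = 0 := HardCoreBoson.groundState_totalSpin_eq_zero hd hL lam hΦ
  have hZ : (totalSpin 1 2 : Op (TorusSite d L) 2).IsHermitian := totalSpin_isHermitian 1 2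
  have hZP : totalSpin 1 2 * P - P * totalSpin 1 2 = P := totalSpin_two_comm_sum_cre
  have hPM : P * Pᴴ - Pᴴ * P = (2 : ℂ) • totalSpin 1 2 := sum_cre_comm_conjTranspose
  -- the trial vector and its norm
  set v : TensorIndex (TorusSite d L) 2 → ℂ := P ^ k *ᵥ Φ with hvdef
  have hA2 : 0 < A / 2 := by positivity
  have hprod : (A / 2) ^ k ≤ (star v ⬝ᵥ v).re := by
    have hjk : ∀ j : ℕ, j < k → (j : ℝ) ^ 2 + j ≤ A := by
      intro j hj
      have hj' : (j : ℝ) ≤ k - 1 := by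
        have : j ≤ k - 1 := by omega
        have h := (Nat.cast_le (α := ℝ)).2 this
        rw [Nat.cast_sub hk, Nat.cast_one] at h; exact h
      have hj0 : (0 : ℝ) ≤ j := Nat.cast_nonneg j
      nlinarith
    have hlad := ladder_prod_le_norm_sq hZ hZP hPM hΦ1 hZΦ k hjk
    refine le_trans ?_ hlad
    calc (A / 2) ^ k = ∏ _j ∈ Finset.range k, (A / 2) := by rw [Finset.prod_const, Finset.card_range]
      _ ≤ ∏ j ∈ Finset.range k, (A - ((j : ℝ) ^ 2 + j)) := by
          refine Finset.prod_le_prod (fun _ _ => hA2.le) fun j hj => ?_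
          rw [Finset.mem_range] at hj
          have hj' : (j : ℝ) ≤ k - 1 := by
            have : j ≤ k - 1 := by omega
            have h := (Nat.cast_le (α := ℝ)).2 this
            rw [Nat.cast_sub hk, Nat.cast_one] at h; exact h
          have hj0 : (0 : ℝ) ≤ j := Nat.cast_nonneg j
          nlinarith
  have hv0 : 0 < (star v ⬝ᵥ v).re := lt_of_lt_of_le (pow_pos hA2 k) hprod
  have hvne : v ≠ 0 := by
    intro h; rw [h, dotProduct_zero, Complex.zero_re] at hv0; exact lt_irrefl _ hv0
  -- the sector
  have hZv : totalSpin 1 2 *ᵥ v = (k : ℂ) • v := totalSpin_two_mulVec_sum_cre_pow L hZΦ k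
  have hmem : v ∈ spinZSector (Λ := TorusSite d L) 1 (k : ℝ) := by
    rw [spinZSector, Module.End.mem_eigenspace_iff, Matrix.toLin'_apply, hZv, Complex.ofReal_natCast]
  refine ⟨fun hbot => hvne ((Submodule.eq_bot_iff _).1 hbot v hmem), ?_⟩
  -- the numerator: `Re⟨v, Hv⟩ ≤ E₀‖v‖² + ‖[M^k, [H, P^k]]‖`
  set D : Op (TorusSite d L) 2 := H * P ^ k - P ^ k * H with hDdef
  have hPkH : (P ^ k * H) *ᵥ Φ = (E₀ : ℂ) • (P ^ k *ᵥ Φ) := by rw [← mulVec_mulVec, hHΦ, mulVec_smul]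
  have hHv : H *ᵥ v = D *ᵥ Φ + (E₀ : ℂ) • v := by
    rw [hvdef, hDdef, Matrix.sub_mulVec, mulVec_mulVec, hPkH]
    abel
  have hMk : (P ^ k)ᴴ = Pᴴ ^ k := conjTranspose_pow P k
  -- `⟨v, DΦ⟩ = ⟨Φ, [M^k, D]Φ⟩ + (E₀‖M^kΦ‖² - ⟨M^kΦ, H M^kΦ⟩)`
  set w : TensorIndex (TorusSite d L) 2 → ℂ := Pᴴ ^ k *ᵥ Φ with hwdef
  have hsplit : star v ⬝ᵥ (D *ᵥ Φ) =
      star Φ ⬝ᵥ ((Pᴴ ^ k * D - D * Pᴴ ^ k) *ᵥ Φ) + ((E₀ : ℂ) * (star w ⬝ᵥ w) - star w ⬝ᵥ (H *ᵥ w)) := by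
    have h1 : star v ⬝ᵥ (D *ᵥ Φ) = star Φ ⬝ᵥ ((Pᴴ ^ k * D) *ᵥ Φ) := by
      rw [hvdef, star_mulVec, ← dotProduct_mulVec, mulVec_mulVec, hMk]
    have h2 : star Φ ⬝ᵥ ((D * Pᴴ ^ k) *ᵥ Φ) = (E₀ : ℂ) * (star w ⬝ᵥ w) - star w ⬝ᵥ (H *ᵥ w) := by
      rw [hDdef, Matrix.sub_mul, Matrix.sub_mulVec, dotProduct_sub]
      congr 1
      · -- `⟨Φ, H P^k M^k Φ⟩ = E₀ ⟨M^kΦ, M^kΦ⟩`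
        have hw : star Φ ⬝ᵥ (P ^ k *ᵥ w) = star w ⬝ᵥ w := by
          rw [hwdef, ← hMk, star_mulVec_dotProduct, conjTranspose_conjTranspose]
        rw [Matrix.mul_assoc, ← mulVec_mulVec, ← mulVec_mulVec, star_dotProduct_mulVec_of_isHermitian_nogap hHh,
          hHΦ, star_smul, smul_dotProduct, Complex.star_def, Complex.conj_ofReal, smul_eq_mul, hw]
      · -- `⟨Φ, P^k H M^k Φ⟩ = ⟨M^kΦ, H M^kΦ⟩`
        rw [Matrix.mul_assoc, ← mulVec_mulVec, ← mulVec_mulVec, hwdef, ← hMk, star_mulVec_dotProduct,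
          conjTranspose_conjTranspose]
    rw [h1, Matrix.sub_mulVec, dotProduct_sub, h2]
    ring
  -- the variational principle for `w = M^kΦ`
  have hvarw : ((E₀ : ℂ) * (star w ⬝ᵥ w) - star w ⬝ᵥ (H *ᵥ w)).re ≤ 0 := by
    rw [Complex.sub_re, sub_nonpos, star_dotProduct_self_eq_norm_sq, ← Complex.ofReal_mul, Complex.ofReal_re]
    rcases eq_or_ne w 0 with hw0 | hw0
    · rw [hw0, mulVec_zero, dotProduct_zero, Complex.zero_re]
      simp
    · have hww : 0 < (star w ⬝ᵥ w).re := by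
        rw [star_dotProduct_self_eq_norm_sq, Complex.ofReal_re]
        have : (toLp 2 w : EuclideanSpace ℂ (TensorIndex (TorusSite d L) 2)) ≠ 0 := by
          intro h; exact hw0 (by simpa using congrArg ofLp h)
        positivity
      have h := minEnergyOn_le_rayleigh_div_nogap hHh ⊤ (Submodule.mem_top : w ∈ ⊤) hww
      rw [Matrix.minEnergyOn_top_holds hHh, le_div_iff₀ hww, star_dotProduct_self_eq_norm_sq, Complex.ofReal_re] at h
      exact h
  -- the commutator norm
  have hP1 : ∀ y : TorusSite d L, ‖(onSite y HardCoreBoson.creMat : Op (TorusSite d L) 2)‖ ≤ 1 :=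
    fun y => norm_cre_le_one y
  have hM1 : ∀ y : TorusSite d L, ‖(onSite y HardCoreBoson.annMat : Op (TorusSite d L) 2)‖ ≤ 1 :=
    fun y => norm_ann_le_one y
  have hPsum : P = ∑ y : TorusSite d L, onSite y HardCoreBoson.creMat := rfl
  have hMsum : Pᴴ = ∑ y : TorusSite d L, onSite y HardCoreBoson.annMat := by rw [hPdef, conjTranspose_sum_cre]; rfl
  have hPn : ‖P‖ ≤ N := norm_sum_cre_le
  have hMn : ‖Pᴴ‖ ≤ N := by rw [Matrix.l2_opNorm_conjTranspose]; exact norm_sum_cre_le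
  have hMP : ‖Pᴴ * P - P * Pᴴ‖ ≤ N := by
    rw [← norm_neg, neg_sub, hPM, norm_smul, RCLike.norm_ofNat]
    have := norm_totalSpin_two_le_half_card (Λ := TorusSite d L)
    linarith
  have hc : ‖H * P - P * H‖ ≤ (2 * d + |lam|) * 1 * N := by
    rw [hPsum]; exact norm_hardCoreLatticeGas_comm_sum_onSite_le L h3 lam hP1
  have he : ‖Pᴴ * (H * P - P * H) - (H * P - P * H) * Pᴴ‖ ≤ (8 * d + 2 * |lam|) * 1 * 1 * N := by
    rw [hMsum, hPsum]; exact norm_sum_onSite_comm_hardCoreLatticeGas_comm_le L h3 lam hP1 hM1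
  have hcomm := norm_pow_comm_comm_pow_le hPn hMn hMP hc he k
  -- simplify the bound to `k²((k-1)(2d+|λ|) + 8d+2|λ|) N^{2k-1}`
  have hN0 : 0 ≤ N := by positivity
  have hbound : ‖Pᴴ ^ k * (H * P ^ k - P ^ k * H) - (H * P ^ k - P ^ k * H) * Pᴴ ^ k‖ ≤
      (k : ℝ) ^ 2 * (((k : ℝ) - 1) * (2 * d + |lam|) + (8 * d + 2 * |lam|)) * N ^ (2 * k - 1) := by
    refine hcomm.trans (le_of_eq ?_)
    rcases Nat.lt_or_ge k 2 with hk1 | hk2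
    · have hk' : k = 1 := by omega
      subst hk'
      simp
    · obtain ⟨j, rfl⟩ : ∃ j, k = j + 2 := ⟨k - 2, by omega⟩
      simp only [show j + 2 - 1 = j + 1 by omega, show j + 2 - 2 = j by omega, show 2 * (j + 2) - 1 = j + 1 + (j + 2) by omega,
        pow_add, pow_succ]
      push_cast
      ring
  -- assemble
  have hnum : (star v ⬝ᵥ (H *ᵥ v)).re ≤ E₀ * (star v ⬝ᵥ v).re +
      (k : ℝ) ^ 2 * (((k : ℝ) - 1) * (2 * d + |lam|) + (8 * d + 2 * |lam|)) * N ^ (2 * k - 1) := by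
    rw [hHv, dotProduct_add, dotProduct_smul, smul_eq_mul, Complex.add_re, hsplit, Complex.add_re,
      Complex.re_ofReal_mul]
    have h1 : (star Φ ⬝ᵥ ((Pᴴ ^ k * D - D * Pᴴ ^ k) *ᵥ Φ)).re ≤
        (k : ℝ) ^ 2 * (((k : ℝ) - 1) * (2 * d + |lam|) + (8 * d + 2 * |lam|)) * N ^ (2 * k - 1) :=
      ((Complex.re_le_norm _).trans (norm_star_dotProduct_mulVec_le_opNorm_nogap _ hΦ1)).trans hbound
    linarith
  have hray := minEnergyOn_le_rayleigh_div_nogap hHh (spinZSector (Λ := TorusSite d L) 1 (k : ℝ)) hmem hv0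
  rw [lowestEnergyInSector]
  refine hray.trans ?_
  rw [div_le_iff₀ hv0]
  have hfrac : (k : ℝ) ^ 2 * (((k : ℝ) - 1) * (2 * d + |lam|) + (8 * d + 2 * |lam|)) * N ^ (2 * k - 1) ≤
      (k : ℝ) ^ 2 * (((k : ℝ) - 1) * (2 * d + |lam|) + (8 * d + 2 * |lam|)) * N ^ (2 * k - 1) / (A / 2) ^ k *
        (star v ⬝ᵥ v).re := by
    rw [div_mul_eq_mul_div, le_div_iff₀ (pow_pos hA2 k)]
    have hC : 0 ≤ (k : ℝ) ^ 2 * (((k : ℝ) - 1) * (2 * d + |lam|) + (8 * d + 2 * |lam|)) * N ^ (2 * k - 1) := by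
      have : (1 : ℝ) ≤ k := by exact_mod_cast hk
      have : (0:ℝ) ≤ (k:ℝ) - 1 := by linarith
      positivity
    exact mul_le_mul_of_nonneg_left hprod hC
  nlinarith [hnum, hfrac, hv0]

/-- **(nogap) with the long-range order made quantitative**: if the ground state has off-diagonal long-range
order `Σ_{x,y}⟨Φ,(S¹_xS¹_y + S²_xS²_y)Φ⟩ ≥ q|Λ|²` (`q > 0`; this is `|Λ|²` times the source's BEC order
parameter `lim |Λ|⁻²Σγ`) and the torus is so large that `2(k-1)k ≤ q|Λ|²`, then
`E_k - E_0 ≤ 2^k k²((k-1)(2d+|λ|) + 8d + 2|λ|)/(q^k |Λ|)` — the printed `E_k - E_0 ≤ c_k/|Λ|` with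
`c_k = 2^k k²((k-1)(2d+|λ|) + 8d + 2|λ|)/q^k` independent of `Λ`. [cite: AizenmanEtAl2004, §4 eq. (nogap)]
[cite: LSSY2005, Ch. 11 (11.28)] -/
theorem hardCoreLatticeGas_lowestEnergyInSector_sub_groundEnergy_le (hd : 0 < d) (hL : Even L) (h3 : 3 ≤ L)
    (lam : ℝ) {Φ : TensorIndex (TorusSite d L) 2 → ℂ} (hΦ : Φ ∈ (hardCoreLatticeGas d L lam).groundSpace)
    (hΦ1 : star Φ ⬝ᵥ Φ = 1) {q : ℝ} (hq : 0 < q)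
    (hlro : q * (Fintype.card (TorusSite d L) : ℝ) ^ 2 ≤
      ∑ x : TorusSite d L, ∑ y : TorusSite d L,
        (star Φ ⬝ᵥ ((siteSpin 1 x 0 * siteSpin 1 y 0 + siteSpin 1 x 1 * siteSpin 1 y 1) *ᵥ Φ)).re)
    {k : ℕ} (hk : 1 ≤ k) (hbig : 2 * (((k : ℝ) - 1) * k) ≤ q * (Fintype.card (TorusSite d L) : ℝ) ^ 2) :
    spinZSector (Λ := TorusSite d L) 1 (k : ℝ) ≠ ⊥ ∧
      lowestEnergyInSector 1 (hardCoreLatticeGas d L lam) k - (hardCoreLatticeGas d L lam).groundEnergy ≤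
        (2 : ℝ) ^ k * (k : ℝ) ^ 2 * (((k : ℝ) - 1) * (2 * d + |lam|) + (8 * d + 2 * |lam|)) /
          (q ^ k * Fintype.card (TorusSite d L)) := by
  set N : ℝ := ((Fintype.card (TorusSite d L) : ℕ) : ℝ) with hNdef
  set A : ℝ := (star ((∑ x : TorusSite d L, HardCoreBoson.cre x) *ᵥ Φ) ⬝ᵥ
    ((∑ x : TorusSite d L, HardCoreBoson.cre x) *ᵥ Φ)).re with hAdef
  have hZΦ : totalSpin 1 2 *ᵥ Φ = 0 := HardCoreBoson.groundState_totalSpin_eq_zero hd hL lam hΦ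
  have hAeq : A = ∑ x : TorusSite d L, ∑ y : TorusSite d L,
      (star Φ ⬝ᵥ ((siteSpin 1 x 0 * siteSpin 1 y 0 + siteSpin 1 x 1 * siteSpin 1 y 1) *ᵥ Φ)).re := by
    rw [hAdef, star_sum_cre_mulVec_dotProduct_self hZΦ, Complex.re_sum]
    exact Finset.sum_congr rfl fun x _ => Complex.re_sum _ _
  have hN1 : 1 ≤ N := by
    have : 1 ≤ Fintype.card (TorusSite d L) := Fintype.card_pos
    rw [hNdef]; exact_mod_cast this
  have hqN : 0 < q * N ^ 2 := by positivity
  have hA : q * N ^ 2 ≤ A := hAeq ▸ hlro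
  have hA0 : 0 < A := lt_of_lt_of_le hqN hA
  obtain ⟨hne, hE⟩ := hardCoreLatticeGas_lowestEnergyInSector_le L hd hL h3 lam hΦ hΦ1 hk (hbig.trans hA) hA0
  refine ⟨hne, ?_⟩
  set C : ℝ := (k : ℝ) ^ 2 * (((k : ℝ) - 1) * (2 * d + |lam|) + (8 * d + 2 * |lam|)) with hCdef
  have hC : 0 ≤ C := by
    have : (1 : ℝ) ≤ k := by exact_mod_cast hk
    have : (0 : ℝ) ≤ (k : ℝ) - 1 := by linarith
    positivity
  have hk1 : 2 * k - 1 + 1 = 2 * k := by omega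
  -- `C N^{2k-1}/(A/2)^k ≤ C N^{2k-1} / (qN²/2)^k = 2^k C /(q^k N)`
  have h1 : C * N ^ (2 * k - 1) / (A / 2) ^ k ≤ C * N ^ (2 * k - 1) / (q * N ^ 2 / 2) ^ k := by
    refine div_le_div_of_nonneg_left (by positivity) (by positivity) ?_
    exact pow_le_pow_left₀ (by positivity) (by linarith) k
  have h2 : C * N ^ (2 * k - 1) / (q * N ^ 2 / 2) ^ k = 2 ^ k * C / (q ^ k * N) := by
    rw [div_pow, mul_pow, ← pow_mul, div_div_eq_mul_div]
    have hN0 : N ≠ 0 := by positivity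
    have hNpow : N ^ (2 * k) = N ^ (2 * k - 1) * N := by rw [← pow_succ, hk1]
    rw [hNpow]
    field_simp
  calc lowestEnergyInSector 1 (hardCoreLatticeGas d L lam) k - (hardCoreLatticeGas d L lam).groundEnergy
      ≤ C * N ^ (2 * k - 1) / (A / 2) ^ k := by rw [hCdef]; linarith
    _ ≤ 2 ^ k * C / (q ^ k * N) := by rw [← h2]; exact h1
    _ = (2 : ℝ) ^ k * (k : ℝ) ^ 2 * (((k : ℝ) - 1) * (2 * d + |lam|) + (8 * d + 2 * |lam|)) / (q ^ k * N) := by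
        rw [hCdef, ← mul_assoc]

end NoGap

/-! ### §6 Theorem 1 at `β = ∞`: ground-state Bose–Einstein condensation of the staggered gas -/

section GroundStateBEC

variable {d : ℕ}

/-- `√(x + y) ≤ √x + √y` for `y ≥ 0`. [folklore] -/
private theorem sqrt_add_le_nogap {x y : ℝ} (hy : 0 ≤ y) : Real.sqrt (x + y) ≤ Real.sqrt x + Real.sqrt y := by
  rcases le_or_gt 0 x with hx | hx
  · rw [Real.sqrt_le_left (by positivity), add_sq, Real.sq_sqrt hx, Real.sq_sqrt hy]
    nlinarith [Real.sqrt_nonneg x, Real.sqrt_nonneg y]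
  · calc Real.sqrt (x + y) ≤ Real.sqrt y := Real.sqrt_le_sqrt (by linarith)
      _ ≤ Real.sqrt x + Real.sqrt y := le_add_of_nonneg_left (Real.sqrt_nonneg x)

/-- **ALSSY Theorem 1 in the ground state, finite volume** (`β = ∞` in (beccurve)/(11.26), no `c_d/β` term):
on the even torus `(ℤ/Lℤ)^d`, `L ≥ 4`, every `d ≥ 1` and every `λ`, the (unique, half-filled) ground state `Φ` of
the hard-core lattice gas has
`Σ_{x,y}⟨Φ,(S¹_xS¹_y + S²_xS²_y)Φ⟩ ≥ |Λ|²(½ - ½(½[d(d+1)+4λ²]^{1/2} G_Λ(0))^{1/2})`, `G_Λ(0) = |Λ|⁻¹Σ_{p≠0}E_p⁻¹`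
— the zero-temperature limit (`Matrix.tendsto_gibbsState_atTop`) of the tree's thermal bound
`hc_structureFactor_zero_ge_explicit`, which holds for every `β > 0`. [cite: AizenmanEtAl2004, Theorem 1 (beccurve) and §4 ("Since there is BEC")]
[cite: LSSY2005, Ch. 11 (11.26)] -/
theorem hardCoreLatticeGas_groundState_lro_ge (hd : 0 < d) (L : ℕ) [NeZero L] (hL : Even L) (h4 : 4 ≤ L)
    (lam : ℝ) {Φ : TensorIndex (TorusSite d L) 2 → ℂ} (hΦ : Φ ∈ (hardCoreLatticeGas d L lam).groundSpace)
    (hΦ1 : star Φ ⬝ᵥ Φ = 1) :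
    ((L : ℝ) ^ d) ^ 2 * (1 / 2 - 1 / 2 * Real.sqrt (1 / 2 * Real.sqrt ((d : ℝ) * (d + 1) + 4 * lam ^ 2) *
        torusGreen (0 : TorusSite d L))) ≤
      ∑ x : TorusSite d L, ∑ y : TorusSite d L,
        (star Φ ⬝ᵥ ((siteSpin 1 x 0 * siteSpin 1 y 0 + siteSpin 1 x 1 * siteSpin 1 y 1) *ᵥ Φ)).re := by
  set H : Op (TorusSite d L) 2 := hardCoreLatticeGas d L lam with hHdef
  have hHh : H.IsHermitian := hardCoreLatticeGas_isHermitian d L lam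
  have hU : H.HasUniqueGroundState := HardCoreBoson.hasUniqueGroundState_hardCoreLatticeGas hd hL lam
  have hΦ0 : Φ ≠ 0 := by intro h; rw [h, dotProduct_zero] at hΦ1; exact zero_ne_one hΦ1
  have hω : ∀ X : Op (TorusSite d L) 2, H.groundStateFunctional X = star Φ ⬝ᵥ (X *ᵥ Φ) := fun X => by
    rw [groundStateFunctional_eq_of_hasUniqueGroundState hU hΦ hΦ0 X, hΦ1, div_one]
  set a : ℝ := 1 / 2 * Real.sqrt ((d : ℝ) * (d + 1) + 4 * lam ^ 2) with ha
  set G : ℝ := torusGreen (0 : TorusSite d L) with hG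
  set N : ℝ := (L : ℝ) ^ d with hN
  -- the thermal bound, for every `β > 0`, rewritten as a bound on `Σ_{x,y} Re(⟨S¹S¹⟩ + ⟨S²S²⟩)`
  set f : ℝ → ℝ := fun β => ∑ x : TorusSite d L, ∑ y : TorusSite d L,
    ((gibbsState β H (siteSpin 1 x 0 * siteSpin 1 y 0)).re + (gibbsState β H (siteSpin 1 x 1 * siteSpin 1 y 1)).re)
    with hf
  have hfβ : ∀ β : ℝ, 0 < β → N ^ 2 * (1 / 2 - G / β - 1 / 2 * Real.sqrt (a * G)) ≤ f β := by
    intro β hβ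
    have h := hc_structureFactor_zero_ge_explicit (d := d) L hL h4 hβ lam
    rw [hcStructureFactor_of_neZero] at h
    simp only [torusPhase_zero_left, Real.cos_zero, one_mul] at h
    have hN0 : (0 : ℝ) < (L : ℝ) ^ d := by
      have : (0 : ℝ) < L := by exact_mod_cast Nat.pos_of_ne_zero (NeZero.ne L)
      positivity
    rw [le_div_iff₀ hN0] at h
    have hcorr : ∀ x y : TorusSite d L, hcCorr 0 β L lam x y + hcCorr 1 β L lam x y =
        (gibbsState β H (siteSpin 1 x 0 * siteSpin 1 y 0)).re + (gibbsState β H (siteSpin 1 x 1 * siteSpin 1 y 1)).re := by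
      intro x y; rw [hcCorr_of_neZero, hcCorr_of_neZero, thermalCorr, thermalCorr]
    have hsum : f β = 2 * ∑ x : TorusSite d L, ∑ y : TorusSite d L, hcCorr 0 β L lam x y := by
      rw [hf]; dsimp only
      rw [Finset.mul_sum]
      refine Finset.sum_congr rfl fun x _ => ?_
      rw [Finset.mul_sum]
      refine Finset.sum_congr rfl fun y _ => ?_
      rw [← hcorr, hc_corr_one_eq_zero_holds d L β lam x y, two_mul]
    have h' : N * (1 / 4 - G / (2 * β) - 1 / 4 * Real.sqrt (a * G)) * N ≤
        ∑ x : TorusSite d L, ∑ y : TorusSite d L, hcCorr 0 β L lam x y := h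
    have h'' : N ^ 2 * (1 / 2 - G / β - 1 / 2 * Real.sqrt (a * G)) =
        2 * (N * (1 / 4 - G / (2 * β) - 1 / 4 * Real.sqrt (a * G)) * N) := by ring
    rw [hsum, h'']
    linarith [h']
  -- both sides converge as `β → ∞`
  have hf_lim : Tendsto f atTop (nhds (∑ x : TorusSite d L, ∑ y : TorusSite d L,
      (star Φ ⬝ᵥ ((siteSpin 1 x 0 * siteSpin 1 y 0 + siteSpin 1 x 1 * siteSpin 1 y 1) *ᵥ Φ)).re)) := by
    refine tendsto_finsetSum _ fun x _ => tendsto_finsetSum _ fun y _ => ?_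
    rw [Matrix.add_mulVec, dotProduct_add, Complex.add_re, ← hω, ← hω]
    exact ((Complex.continuous_re.tendsto _).comp (Matrix.tendsto_gibbsState_atTop_holds hHh _)).add
      ((Complex.continuous_re.tendsto _).comp (Matrix.tendsto_gibbsState_atTop_holds hHh _))
  have hg_lim : Tendsto (fun β : ℝ => N ^ 2 * (1 / 2 - G / β - 1 / 2 * Real.sqrt (a * G))) atTop
      (nhds (N ^ 2 * (1 / 2 - 0 - 1 / 2 * Real.sqrt (a * G)))) := by
    refine tendsto_const_nhds.mul ((tendsto_const_nhds.sub ?_).sub tendsto_const_nhds)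
    exact tendsto_const_nhds.div_atTop tendsto_id
  rw [sub_zero] at hg_lim
  exact le_of_tendsto_of_tendsto hg_lim hf_lim (Filter.eventually_atTop.2 ⟨1, fun β hβ => hfβ β (by linarith)⟩)

/-- **Ground-state BEC in the window, uniformly on large tori**: for `d ≥ 3` and `[d(d+1)+4λ²]c_d² < 4`
(`c_d = latticeGreen 0`, the printed `λ² < c_d⁻² - d(d+1)/4`), with `m = ½ - ½(½[d(d+1)+4λ²]^{1/2}c_d)^{1/2} > 0`,
there is `L₀` such that on every even torus of side `L ≥ L₀` the ground state has
`Σ_{x,y}⟨Φ,(S¹_xS¹_y + S²_xS²_y)Φ⟩ ≥ (m/2)|Λ|²` ("Since there is BEC, `⟨S⁻_totS⁺_tot⟩ ≥ c'|Λ|²`").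
[cite: AizenmanEtAl2004, Theorem 1 and eq. (region); §4] [cite: LSSY2005, Ch. 11 (11.26)–(11.27)] -/
theorem hardCoreLatticeGas_groundState_lro_eventually_ge (hd : 3 ≤ d) {lam : ℝ}
    (hwin : ((d : ℝ) * (d + 1) + 4 * lam ^ 2) * latticeGreen (0 : Site d) ^ 2 < 4) :
    0 < 1 / 2 - 1 / 2 * Real.sqrt (1 / 2 * Real.sqrt ((d : ℝ) * (d + 1) + 4 * lam ^ 2) * latticeGreen (0 : Site d)) ∧
    ∃ L₀ : ℕ, ∀ (L : ℕ) [NeZero L], Even L → L₀ ≤ L →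
      ∀ Φ : TensorIndex (TorusSite d L) 2 → ℂ, Φ ∈ (hardCoreLatticeGas d L lam).groundSpace → star Φ ⬝ᵥ Φ = 1 →
        (1 / 2 - 1 / 2 * Real.sqrt (1 / 2 * Real.sqrt ((d : ℝ) * (d + 1) + 4 * lam ^ 2) * latticeGreen (0 : Site d))) / 2 *
            ((Fintype.card (TorusSite d L) : ℝ)) ^ 2 ≤
          ∑ x : TorusSite d L, ∑ y : TorusSite d L,
            (star Φ ⬝ᵥ ((siteSpin 1 x 0 * siteSpin 1 y 0 + siteSpin 1 x 1 * siteSpin 1 y 1) *ᵥ Φ)).re := by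
  set cd : ℝ := latticeGreen (0 : Site d) with hcd
  have hcd0 : 0 ≤ cd := latticeGreen_zero_nonneg hd
  set D : ℝ := (d : ℝ) * (d + 1) + 4 * lam ^ 2 with hD
  have hD0 : 0 ≤ D := by positivity
  set a : ℝ := 1 / 2 * Real.sqrt D with ha
  have ha0 : 0 ≤ a := by positivity
  -- `m > 0`
  have hDc : Real.sqrt D * cd < 2 := by
    have h1 : (Real.sqrt D * cd) ^ 2 < 2 ^ 2 := by rw [mul_pow, Real.sq_sqrt hD0]; linarith
    exact (pow_lt_pow_iff_left₀ (by positivity) (by norm_num) two_ne_zero).1 h1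
  have hm : 0 < 1 / 2 - 1 / 2 * Real.sqrt (a * cd) := by
    have h1 : a * cd < 1 := by rw [ha]; nlinarith
    have h2 : Real.sqrt (a * cd) < 1 := by
      rw [show (1 : ℝ) = Real.sqrt 1 by rw [Real.sqrt_one]]
      exact Real.sqrt_lt_sqrt (by positivity) h1
    linarith
  refine ⟨hm, ?_⟩
  set m : ℝ := 1 / 2 - 1 / 2 * Real.sqrt (a * cd) with hmdef
  -- tolerance `δ` with `√(aδ) ≤ m`
  set δ : ℝ := m ^ 2 / (a + 1) with hδ
  have hδ0 : 0 < δ := by positivity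
  have hsq : Real.sqrt (a * δ) ≤ m := by
    rw [Real.sqrt_le_left hm.le]
    have : a * δ ≤ m ^ 2 := by
      rw [hδ, mul_div_assoc']
      rw [div_le_iff₀ (by positivity)]
      nlinarith [sq_nonneg m]
    exact this
  obtain ⟨L₁, hL₁⟩ := torusGreen_tendsto_latticeGreen (d := d) hd 0 hδ0
  refine ⟨max L₁ 4, fun L _ hLe hLge Φ hΦ hΦ1 => ?_⟩
  have hL₁L : L₁ ≤ L := le_trans (le_max_left _ _) hLge
  have h4 : 4 ≤ L := le_trans (le_max_right _ _) hLge
  have hT := hL₁ L hLe hL₁L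
  have h0 : Torus.proj L (0 : Site d) = 0 := by funext i; simp
  rw [h0] at hT
  have hG0 := torusGreen_zero_nonneg (d := d) L
  have hGle : torusGreen (0 : TorusSite d L) ≤ cd + δ := by linarith [(abs_le.1 hT).2]
  have hfin := hardCoreLatticeGas_groundState_lro_ge (by omega) L hLe h4 lam hΦ hΦ1
  have hcard : (Fintype.card (TorusSite d L) : ℝ) = (L : ℝ) ^ d := by
    rw [Fintype.card_pi, Finset.prod_const, ZMod.card, Finset.card_univ, Fintype.card_fin]; push_cast; rfl
  rw [hcard]
  refine le_trans ?_ hfin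
  -- `½ - ½√(a G_Λ) ≥ m/2`
  have hroot : Real.sqrt (a * torusGreen (0 : TorusSite d L)) ≤ Real.sqrt (a * cd) + m :=
    calc Real.sqrt (a * torusGreen (0 : TorusSite d L)) ≤ Real.sqrt (a * cd + a * δ) :=
          Real.sqrt_le_sqrt (by nlinarith)
      _ ≤ Real.sqrt (a * cd) + Real.sqrt (a * δ) := sqrt_add_le_nogap (by positivity)
      _ ≤ Real.sqrt (a * cd) + m := by linarith
  have hN2 : (0 : ℝ) ≤ ((L : ℝ) ^ d) ^ 2 := by positivity
  have : m / 2 ≤ 1 / 2 - 1 / 2 * Real.sqrt (a * torusGreen (0 : TorusSite d L)) := by rw [hmdef] at hroot ⊢; linarith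
  calc m / 2 * ((L : ℝ) ^ d) ^ 2 ≤ (1 / 2 - 1 / 2 * Real.sqrt (a * torusGreen (0 : TorusSite d L))) * ((L : ℝ) ^ d) ^ 2 :=
        mul_le_mul_of_nonneg_right this hN2
    _ = ((L : ℝ) ^ d) ^ 2 * (1 / 2 - 1 / 2 * Real.sqrt (1 / 2 * Real.sqrt ((d : ℝ) * (d + 1) + 4 * lam ^ 2) *
        torusGreen (0 : TorusSite d L))) := by rw [ha, hD, mul_comm, mul_assoc]

end GroundStateBEC

/-! ### §7 (nogap) as printed: `E_k - E_0 ≤ c_k/|Λ|` in the BEC window, for every `k` -/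

section NoGapWindow

variable {d : ℕ}

/-- A nonzero vector can be normalised by a real scalar. [folklore] -/
private theorem exists_real_smul_unit_nogap {m : Type*} [Fintype m] {v : m → ℂ} (hv : v ≠ 0) :
    ∃ c : ℝ, star ((c : ℂ) • v) ⬝ᵥ ((c : ℂ) • v) = 1 := by
  set r : ℝ := (star v ⬝ᵥ v).re with hr
  have hvv : star v ⬝ᵥ v = (r : ℂ) := by rw [hr, star_dotProduct_self_eq_norm_sq, Complex.ofReal_re]
  have hr0 : 0 < r := by
    rw [hr, star_dotProduct_self_eq_norm_sq, Complex.ofReal_re]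
    have : (toLp 2 v : EuclideanSpace ℂ m) ≠ 0 := fun h => hv (by simpa using congrArg ofLp h)
    positivity
  refine ⟨(Real.sqrt r)⁻¹, ?_⟩
  have h1 : (Real.sqrt r)⁻¹ * (Real.sqrt r)⁻¹ * r = 1 := by
    rw [← mul_inv, Real.mul_self_sqrt hr0.le, inv_mul_cancel₀ hr0.ne']
  rw [star_smul, smul_dotProduct, dotProduct_smul, hvv, Complex.star_def, Complex.conj_ofReal, smul_eq_mul,
    smul_eq_mul, ← mul_assoc, ← Complex.ofReal_mul, ← Complex.ofReal_mul, h1, Complex.ofReal_one]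

/-- **ALSSY (nogap), as printed: in the BEC phase there is no gap for adding particles beyond half filling.**
For `d ≥ 3` and `λ` in the BEC window `[d(d+1)+4λ²]c_d² < 4` (`c_d = (2π)^{-d}∫E_p⁻¹ = latticeGreen 0`; the
printed `λ² < c_d⁻² - d(d+1)/4`, `λ ≲ 0.96` in `d = 3`), for every `k ≥ 1` there are a constant `c_k` (depending
on `k, d, λ` but not on `Λ`) and `L₀` such that on every even torus `Λ = (ℤ/Lℤ)^d`, `L ≥ L₀`, the lowest energy
`E_k` of the hard-core lattice gas with `|Λ|/2 + k` particles (sector `S³_tot = k`, nonempty) satisfies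
`E_k - E_0 ≤ c_k/|Λ|`, `E_0` the (half-filled) ground-state energy — so the Mott-insulator gap inequality (eq:gap)
`E_{-k} + E_k - 2E_0 ≥ c|k|` fails for every finite `k`. [cite: AizenmanEtAl2004, §4 eq. (nogap)]
[cite: LSSY2005, Ch. 11 (11.28)] -/
theorem hardCoreLatticeGas_noGap (hd : 3 ≤ d) {lam : ℝ}
    (hwin : ((d : ℝ) * (d + 1) + 4 * lam ^ 2) * latticeGreen (0 : Site d) ^ 2 < 4) {k : ℕ} (hk : 1 ≤ k) :
    ∃ c : ℝ, ∃ L₀ : ℕ, ∀ (L : ℕ) [NeZero L], Even L → L₀ ≤ L →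
      spinZSector (Λ := TorusSite d L) 1 (k : ℝ) ≠ ⊥ ∧
        lowestEnergyInSector 1 (hardCoreLatticeGas d L lam) k - (hardCoreLatticeGas d L lam).groundEnergy ≤
          c / Fintype.card (TorusSite d L) := by
  obtain ⟨hm, L₀, hL₀⟩ := hardCoreLatticeGas_groundState_lro_eventually_ge hd hwin
  set m : ℝ := 1 / 2 - 1 / 2 * Real.sqrt (1 / 2 * Real.sqrt ((d : ℝ) * (d + 1) + 4 * lam ^ 2) *
    latticeGreen (0 : Site d)) with hmdef
  set q : ℝ := m / 2 with hq
  have hq0 : 0 < q := by positivity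
  obtain ⟨M, hM⟩ := exists_nat_gt (2 * (((k : ℝ) - 1) * k) / q)
  refine ⟨(2 : ℝ) ^ k * (k : ℝ) ^ 2 * (((k : ℝ) - 1) * (2 * d + |lam|) + (8 * d + 2 * |lam|)) / q ^ k,
    max L₀ (max M 3), fun L _ hLe hLge => ?_⟩
  have hL₀L : L₀ ≤ L := le_trans (le_max_left _ _) hLge
  have hML : M ≤ L := le_trans (le_max_left _ _) (le_trans (le_max_right _ _) hLge)
  have h3 : 3 ≤ L := le_trans (le_max_right _ _) (le_trans (le_max_right _ _) hLge)
  have hd0 : 0 < d := by omega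
  -- a unit ground-state vector
  obtain ⟨ψ, hψ0, hψ, -⟩ := HardCoreBoson.exists_groundState_totalSpin_eq_zero (d := d) (L := L) hd0 hLe lam
  obtain ⟨c, hc⟩ := exists_real_smul_unit_nogap hψ0
  have hΦ : (c : ℂ) • ψ ∈ (hardCoreLatticeGas d L lam).groundSpace := Submodule.smul_mem _ _ hψ
  have hlro := hL₀ L hLe hL₀L ((c : ℂ) • ψ) hΦ hc
  -- the size condition `2(k-1)k ≤ q|Λ|²`
  set N : ℝ := ((Fintype.card (TorusSite d L) : ℕ) : ℝ) with hN
  have hN1 : 1 ≤ N := by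
    have : 1 ≤ Fintype.card (TorusSite d L) := Fintype.card_pos
    rw [hN]; exact_mod_cast this
  have hNL : (L : ℝ) ≤ N := by
    have h : L ≤ Fintype.card (TorusSite d L) := by
      rw [Fintype.card_pi, Finset.prod_const, ZMod.card, Finset.card_univ, Fintype.card_fin]
      exact Nat.le_self_pow (by omega) L
    rw [hN]; exact_mod_cast h
  have hbig : 2 * (((k : ℝ) - 1) * k) ≤ q * N ^ 2 := by
    have h1 : 2 * (((k : ℝ) - 1) * k) / q < M := hM
    rw [div_lt_iff₀ hq0] at h1
    have h2 : (M : ℝ) ≤ N := le_trans (by exact_mod_cast hML) hNL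
    have h3 : (M : ℝ) * q ≤ N * q := mul_le_mul_of_nonneg_right h2 hq0.le
    have h4 : 0 ≤ q * N * (N - 1) := mul_nonneg (mul_nonneg hq0.le (by linarith)) (by linarith)
    nlinarith
  obtain ⟨hne, hE⟩ := hardCoreLatticeGas_lowestEnergyInSector_sub_groundEnergy_le L hd0 hLe h3 lam hΦ hc hq0 hlro
    hk hbig
  refine ⟨hne, hE.trans (le_of_eq ?_)⟩
  rw [div_div]

end NoGapWindow

/-! ### §8 (nocusp), grand-canonical form: ground-state symmetries and the sum rule `Σ_y⟨[S¹_y,[H,S¹_y]]⟩₀ = -E₀ + λ|Λ|/2` -/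

section NoCuspSymmetry

variable {n : Type*} [Fintype n] [DecidableEq n]

/-- **Odd observables have zero ground-state expectation**: if a unitary `U` commutes with the Hermitian `A` and
`U Y Uᴴ = -Y`, then `ω₀(Y) = 0` in the tracial ground state `ω₀` of `A` (the source's "zero by the symmetry
`S^{1,2} → -S^{1,2}`", "zero by the symmetry `S^{1,3} → -S^{1,3}` … followed by a unit-vector translation").
[cite: AizenmanEtAl2004, §4 (proof of (nocusp))] -/
theorem groundStateFunctional_eq_zero_of_conj_eq_neg {A U Y : Matrix n n ℂ} (hA : A.IsHermitian)
    (hU : U * A = A * U) (hUU : Uᴴ * U = 1) (hY : U * Y * Uᴴ = -Y) : A.groundStateFunctional Y = 0 := by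
  have h := Matrix.groundStateFunctional_conj_of_commute hA hU hUU Y
  rw [hY, map_neg] at h
  have h2 : (2 : ℂ) * A.groundStateFunctional Y = 0 := by rw [two_mul]; nth_rewrite 1 [← h]; ring
  simpa using h2

/-- Conjugating a product: `U(XY)Uᴴ = (UXUᴴ)(UYUᴴ)` for `UᴴU = 1`. [folklore] -/
private theorem unitary_conj_mul_nogap {U X Y : Matrix n n ℂ} (hUU : Uᴴ * U = 1) :
    U * (X * Y) * Uᴴ = U * X * Uᴴ * (U * Y * Uᴴ) := by
  calc U * (X * Y) * Uᴴ = U * X * (Uᴴ * U) * Y * Uᴴ := by rw [hUU]; simp only [Matrix.mul_assoc, Matrix.one_mul]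
    _ = U * X * Uᴴ * (U * Y * Uᴴ) := by simp only [Matrix.mul_assoc]

/-- Conjugating a commutator. [folklore] -/
private theorem unitary_conj_comm_nogap {U X Y : Matrix n n ℂ} (hUU : Uᴴ * U = 1) :
    U * (X * Y - Y * X) * Uᴴ = U * X * Uᴴ * (U * Y * Uᴴ) - U * Y * Uᴴ * (U * X * Uᴴ) := by
  rw [Matrix.mul_sub, Matrix.sub_mul, unitary_conj_mul_nogap hUU, unitary_conj_mul_nogap hUU]

omit [DecidableEq n] in
/-- Conjugating a sum. [folklore] -/
private theorem unitary_conj_sum_nogap {ι : Type*} (s : Finset ι) (U : Matrix n n ℂ) (X : ι → Matrix n n ℂ) :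
    U * (∑ i ∈ s, X i) * Uᴴ = ∑ i ∈ s, U * X i * Uᴴ := by
  rw [Finset.mul_sum, Finset.sum_mul]

variable {d : ℕ} (L : ℕ) [NeZero L]

/-- **The `U(1)` quarter turn** of the hard-core gas packaged: a unitary `U` commuting with `hardCoreLatticeGas` with
`U S¹_x Uᴴ = -S²_x`, `U S²_x Uᴴ = S¹_x`, `U S³_x Uᴴ = S³_x`. [cite: LSSY2005, Ch. 11 §11.1]
[cite: AizenmanEtAl2004, §4 ("where we used rotational symmetry")] -/
theorem exists_quarterTurn_hardCoreLatticeGas (lam : ℝ) :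
    ∃ U : Op (TorusSite d L) 2, U * hardCoreLatticeGas d L lam = hardCoreLatticeGas d L lam * U ∧ Uᴴ * U = 1 ∧
      U * Uᴴ = 1 ∧ (∀ x : TorusSite d L, U * siteSpin 1 x 0 * Uᴴ = -siteSpin 1 x 1) ∧
      (∀ x : TorusSite d L, U * siteSpin 1 x 1 * Uᴴ = siteSpin 1 x 0) ∧
      (∀ x : TorusSite d L, U * siteSpin 1 x 2 * Uᴴ = siteSpin 1 x 2) := by
  set U : Op (TorusSite d L) 2 :=
    productOp (fun _ : TorusSite d L => diagonal fun k : Fin 2 => (-Complex.I) ^ (k : ℕ)) with hU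
  have hUU' : U * Uᴴ = 1 := productOp_mul_conjTranspose fun _ => spinPhase_mul_conjTranspose 1
  have hUU : Uᴴ * U = 1 := mul_eq_one_comm.1 hUU'
  have hH : U * hardCoreLatticeGas d L lam * Uᴴ = hardCoreLatticeGas d L lam := quarterTurn_conj_hardCoreLatticeGas d L lam
  refine ⟨U, ?_, hUU, hUU', fun x => quarterTurn_conj_siteSpin_zero 1 x, fun x => quarterTurn_conj_siteSpin_one 1 x,
    fun x => quarterTurn_conj_siteSpin_two 1 x⟩
  calc U * hardCoreLatticeGas d L lam = U * hardCoreLatticeGas d L lam * (Uᴴ * U) := by rw [hUU, Matrix.mul_one]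
    _ = hardCoreLatticeGas d L lam * U := by rw [← Matrix.mul_assoc, hH]

/-- **The `ℤ₂` half turn `S^{1,2} → -S^{1,2}`** (the quarter turn squared): a unitary `R` commuting with
`hardCoreLatticeGas` with `R S¹_x Rᴴ = -S¹_x`, `R S²_x Rᴴ = -S²_x`. [cite: AizenmanEtAl2004, §4 ("the symmetry
`S^{1,2} → -S^{1,2}`")] -/
theorem exists_halfTurn_hardCoreLatticeGas (lam : ℝ) :
    ∃ R : Op (TorusSite d L) 2, R * hardCoreLatticeGas d L lam = hardCoreLatticeGas d L lam * R ∧ Rᴴ * R = 1 ∧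
      (∀ x : TorusSite d L, R * siteSpin 1 x 0 * Rᴴ = -siteSpin 1 x 0) ∧
      (∀ x : TorusSite d L, R * siteSpin 1 x 1 * Rᴴ = -siteSpin 1 x 1) := by
  obtain ⟨U, hUH, hUU, -, h0, h1, -⟩ := exists_quarterTurn_hardCoreLatticeGas (d := d) L lam
  refine ⟨U * U, ?_, ?_, fun x => ?_, fun x => ?_⟩
  · rw [Matrix.mul_assoc, hUH, ← Matrix.mul_assoc, hUH, Matrix.mul_assoc]
  · rw [conjTranspose_mul, Matrix.mul_assoc, ← Matrix.mul_assoc Uᴴ U, hUU, Matrix.one_mul, hUU]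
  · rw [conjTranspose_mul, show U * U * siteSpin 1 x 0 * (Uᴴ * Uᴴ) = U * (U * siteSpin 1 x 0 * Uᴴ) * Uᴴ by
      simp only [Matrix.mul_assoc], h0, Matrix.mul_neg, Matrix.neg_mul, h1]
  · rw [conjTranspose_mul, show U * U * siteSpin 1 x 1 * (Uᴴ * Uᴴ) = U * (U * siteSpin 1 x 1 * Uᴴ) * Uᴴ by
      simp only [Matrix.mul_assoc], h1, h0]

/-- **Rotational symmetry of the ground state**: `ω₀(S¹_xS¹_y) = ω₀(S²_xS²_y)` (unique ground state, quarter turn).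
[cite: AizenmanEtAl2004, §4 ("where we used rotational symmetry in the last step")] -/
theorem groundStateFunctional_siteSpin_zero_mul_eq_one_mul (lam : ℝ) (x y : TorusSite d L) :
    (hardCoreLatticeGas d L lam).groundStateFunctional (siteSpin 1 x 0 * siteSpin 1 y 0) =
      (hardCoreLatticeGas d L lam).groundStateFunctional (siteSpin 1 x 1 * siteSpin 1 y 1) := by
  obtain ⟨U, hUH, hUU, -, -, h1, -⟩ := exists_quarterTurn_hardCoreLatticeGas (d := d) L lam
  have h := Matrix.groundStateFunctional_conj_of_commute (hardCoreLatticeGas_isHermitian d L lam) hUH hUU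
    (siteSpin 1 x 1 * siteSpin 1 y 1)
  rw [unitary_conj_mul_nogap hUU, h1, h1] at h
  exact h

/-- `ω₀(S¹_x) = 0` (odd under the half turn). [cite: AizenmanEtAl2004, §4 (proof of (nocusp), "the symmetry `S^{1,2} → -S^{1,2}`")] -/
theorem groundStateFunctional_siteSpin_zero_eq_zero (lam : ℝ) (x : TorusSite d L) :
    (hardCoreLatticeGas d L lam).groundStateFunctional (siteSpin 1 x 0) = 0 := by
  obtain ⟨R, hRH, hRR, h0, -⟩ := exists_halfTurn_hardCoreLatticeGas (d := d) L lam
  exact groundStateFunctional_eq_zero_of_conj_eq_neg (hardCoreLatticeGas_isHermitian d L lam) hRH hRR (h0 x)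

/-- **The sum rule behind `ΔE`**: `Σ_y⟨[S¹_y,[H,S¹_y]]⟩₀`, i.e. the operator identity
`Σ_y[S¹_y,[H,S¹_y]] = 2Σ_{x,i}S²_xS²_{x+eᵢ} - λΣ_z(-1)^zS³_z` (only the two sites of a bond, resp. the site of a
field term, contribute). [cite: AizenmanEtAl2004, §4 (proof of (nocusp), the display
"`½Σ_y⟨0|[S¹_y,[H,S¹_y]]|0⟩ = ½⟨0|Σ_⟨xy⟩2S²_xS²_y - λΣ_y(-1)^yS³_y|0⟩`")] -/
theorem hardCoreLatticeGas_sum_doubleComm_siteSpin_zero (hL : 3 ≤ L) (lam : ℝ) :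
    ∑ y : TorusSite d L, (siteSpin 1 y 0 * (hardCoreLatticeGas d L lam * siteSpin 1 y 0 - siteSpin 1 y 0 * hardCoreLatticeGas d L lam) -
        (hardCoreLatticeGas d L lam * siteSpin 1 y 0 - siteSpin 1 y 0 * hardCoreLatticeGas d L lam) * siteSpin 1 y 0) =
      (2 : ℂ) • (∑ x : TorusSite d L, ∑ i : Fin d, siteSpin 1 x 1 * siteSpin 1 (x + Pi.single i 1) 1) -
        (lam : ℂ) • ∑ z : TorusSite d L, ((-1 : ℂ) ^ (∑ i, (z i).val)) • siteSpin 1 z 2 := by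
  have hne : ∀ (x : TorusSite d L) (i : Fin d), x ≠ x + Pi.single i 1 := fun x i h =>
    single_ne_zero_of_two_le L (by omega) i (by simpa using h.symm)
  set H := hardCoreLatticeGas d L lam with hH
  set T : TorusSite d L → Fin d → Op (TorusSite d L) 2 := fun x i =>
    siteSpin 1 x 0 * siteSpin 1 (x + Pi.single i 1) 0 + siteSpin 1 x 1 * siteSpin 1 (x + Pi.single i 1) 1 with hT
  -- `[S¹_y,[X,S¹_y]] = 2S¹_yXS¹_y - ½X` (spin ½), a linear map in `X`
  set F : TorusSite d L → (Op (TorusSite d L) 2 →ₗ[ℂ] Op (TorusSite d L) 2) := fun y =>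
    (2 : ℂ) • ((LinearMap.mulLeft ℂ (siteSpin 1 y 0 : Op (TorusSite d L) 2)) ∘ₗ
      (LinearMap.mulRight ℂ (siteSpin 1 y 0 : Op (TorusSite d L) 2))) - (1 / 2 : ℂ) • LinearMap.id with hF
  have hFapply : ∀ (y : TorusSite d L) (X : Op (TorusSite d L) 2),
      F y X = (2 : ℂ) • (siteSpin 1 y 0 * X * siteSpin 1 y 0) - (1 / 2 : ℂ) • X := by
    intro y X
    simp only [hF, LinearMap.sub_apply, LinearMap.smul_apply, LinearMap.coe_comp, Function.comp_apply,
      LinearMap.mulLeft_apply, LinearMap.mulRight_apply, LinearMap.id_apply, Matrix.mul_assoc]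
  have hFcomm : ∀ (y : TorusSite d L) (X : Op (TorusSite d L) 2),
      siteSpin 1 y 0 * (X * siteSpin 1 y 0 - siteSpin 1 y 0 * X) - (X * siteSpin 1 y 0 - siteSpin 1 y 0 * X) * siteSpin 1 y 0 =
        F y X := by
    intro y X
    rw [hFapply, Matrix.mul_sub, Matrix.sub_mul, ← Matrix.mul_assoc (siteSpin 1 y 0) (siteSpin 1 y 0) X,
      Matrix.mul_assoc X, siteSpin_one_mul_self, Matrix.smul_mul, Matrix.mul_smul, Matrix.one_mul, Matrix.mul_one,
      ← Matrix.mul_assoc, two_smul]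
    module
  have hF1 : ∀ y : TorusSite d L, F y 1 = 0 := by
    intro y
    rw [hFapply, Matrix.mul_one, siteSpin_one_mul_self, smul_smul]
    norm_num
  -- expand `H`
  have hHsum : H = -(∑ x, ∑ i, T x i) + (lam : ℂ) • ∑ z : TorusSite d L,
      ((1 / 2 : ℂ) • (1 : Op (TorusSite d L) 2) + ((-1 : ℂ) ^ (∑ i, (z i).val)) • siteSpin 1 z 2) := by
    rw [hH, hardCoreLatticeGas_eq, xyTorus_eq_neg_sum_hop_nogap L hL]
  have hFH : ∀ y : TorusSite d L, F y H = -(∑ x, ∑ i, F y (T x i)) +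
      (lam : ℂ) • ∑ z, ((-1 : ℂ) ^ (∑ i, (z i).val)) • F y (siteSpin 1 z 2) := by
    intro y
    rw [hHsum, map_add, map_neg, map_sum, map_smul]
    simp only [map_sum, map_add, map_smul, hF1, smul_zero, zero_add]
  -- a local term commuting with `S¹_y` contributes nothing at `y`
  have hF_zero : ∀ (X : Op (TorusSite d L) 2) (y : TorusSite d L), X * siteSpin 1 y 0 = siteSpin 1 y 0 * X → F y X = 0 := by
    intro X y h
    rw [← hFcomm, h, sub_self, Matrix.mul_zero, Matrix.zero_mul, sub_self]
  -- on-site Pauli products used below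
  have p11 : ∀ x : TorusSite d L, (siteSpin 1 x 0 * siteSpin 1 x 0 : Op (TorusSite d L) 2) = (1 / 4 : ℂ) • 1 :=
    fun x => siteSpin_one_mul_self x 0
  -- the bond `(x, w)`: `S¹_x t S¹_x = ¼(S¹_xS¹_w - S²_xS²_w)`
  have hpair : ∀ (x w : TorusSite d L), x ≠ w →
      F x (siteSpin 1 x 0 * siteSpin 1 w 0 + siteSpin 1 x 1 * siteSpin 1 w 1) = -(siteSpin 1 x 1 * siteSpin 1 w 1) := by
    intro x w hxw
    have cw0 : (siteSpin 1 w 0 * siteSpin 1 x 0 : Op (TorusSite d L) 2) = siteSpin 1 x 0 * siteSpin 1 w 0 :=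
      (siteSpin_commute_of_ne_holds (Λ := TorusSite d L) 1 hxw 0 0).eq.symm
    have cw1 : (siteSpin 1 w 1 * siteSpin 1 x 0 : Op (TorusSite d L) 2) = siteSpin 1 x 0 * siteSpin 1 w 1 :=
      (siteSpin_commute_of_ne_holds (Λ := TorusSite d L) 1 hxw 0 1).eq.symm
    have hA : (siteSpin 1 x 0 * (siteSpin 1 x 0 * siteSpin 1 w 0) * siteSpin 1 x 0 : Op (TorusSite d L) 2) =
        (1 / 4 : ℂ) • (siteSpin 1 x 0 * siteSpin 1 w 0) := by
      rw [Matrix.mul_assoc, Matrix.mul_assoc, cw0, ← Matrix.mul_assoc, ← Matrix.mul_assoc, p11, Matrix.smul_mul,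
        Matrix.one_mul, Matrix.smul_mul]
    have hB : (siteSpin 1 x 0 * (siteSpin 1 x 1 * siteSpin 1 w 1) * siteSpin 1 x 0 : Op (TorusSite d L) 2) =
        -((1 / 4 : ℂ) • (siteSpin 1 x 1 * siteSpin 1 w 1)) := by
      rw [Matrix.mul_assoc, Matrix.mul_assoc, cw1, ← Matrix.mul_assoc, ← Matrix.mul_assoc, siteSpin_one_x_mul_y,
        Matrix.smul_mul, siteSpin_one_z_mul_x, smul_smul, Matrix.smul_mul]
      rw [show I / 2 * (I / 2) = -(1 / 4 : ℂ) by rw [div_mul_div_comm, I_mul_I]; ring, neg_smul]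
    rw [hFapply, Matrix.mul_add, Matrix.add_mul, hA, hB]
    module
  have hbond : ∀ (x : TorusSite d L) (i : Fin d), ∑ y, F y (T x i) = -((2 : ℂ) • (siteSpin 1 x 1 * siteSpin 1 (x + Pi.single i 1) 1)) := by
    intro x i
    set w := x + Pi.single i 1 with hw
    have hxw : x ≠ w := hne x i
    rw [← Finset.sum_subset (Finset.subset_univ ({x, w} : Finset (TorusSite d L)))]
    · rw [Finset.sum_pair hxw]
      have hTx : F x (T x i) = -(siteSpin 1 x 1 * siteSpin 1 w 1) := hpair x w hxw
      have hTw : F w (T x i) = -(siteSpin 1 x 1 * siteSpin 1 w 1) := by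
        have hsym : T x i = siteSpin 1 w 0 * siteSpin 1 x 0 + siteSpin 1 w 1 * siteSpin 1 x 1 := by
          simp only [hT]
          rw [(siteSpin_commute_of_ne_holds (Λ := TorusSite d L) 1 hxw 0 0).eq,
            (siteSpin_commute_of_ne_holds (Λ := TorusSite d L) 1 hxw 1 1).eq]
        rw [hsym, hpair w x hxw.symm, (siteSpin_commute_of_ne_holds (Λ := TorusSite d L) 1 hxw 1 1).eq]
      rw [hTx, hTw, two_smul, neg_add]
    · intro y _ hy
      refine hF_zero _ _ ?_
      have hsupp : IsSupportedOn (T x i) {x, w} := isSupportedOn_hop_pair x w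
      exact (commute_of_disjoint_holds hsupp (isSupportedOn_onSite_holds y _)
        (Finset.disjoint_singleton_right.2 hy)).eq
  -- the field term at `z`: only `y = z` contributes, `[S¹_z,[S³_z,S¹_z]] = -S³_z`
  have hfield : ∀ z : TorusSite d L, ∑ y, F y (siteSpin 1 z 2) = -siteSpin 1 z 2 := by
    intro z
    rw [← Finset.sum_subset (Finset.subset_univ ({z} : Finset (TorusSite d L)))]
    · rw [Finset.sum_singleton, hFapply, siteSpin_one_x_mul_z, Matrix.neg_mul, Matrix.smul_mul, siteSpin_one_y_mul_x,
        smul_neg, smul_smul, smul_neg, smul_smul]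
      rw [show (2 : ℂ) * (I / 2) * (I / 2) = -(1 / 2 : ℂ) by rw [mul_assoc, div_mul_div_comm, I_mul_I]; ring]
      module
    · intro y _ hy
      rw [Finset.mem_singleton] at hy
      exact hF_zero _ _ (siteSpin_commute_of_ne_holds (Λ := TorusSite d L) 1 (Ne.symm hy) 2 0).eq
  -- sum over `y`
  calc ∑ y, (siteSpin 1 y 0 * (H * siteSpin 1 y 0 - siteSpin 1 y 0 * H) - (H * siteSpin 1 y 0 - siteSpin 1 y 0 * H) * siteSpin 1 y 0)
      = ∑ y, F y H := Finset.sum_congr rfl fun y _ => hFcomm y H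
    _ = ∑ y, (-(∑ x, ∑ i, F y (T x i)) + (lam : ℂ) • ∑ z, ((-1 : ℂ) ^ (∑ i, (z i).val)) • F y (siteSpin 1 z 2)) :=
        Finset.sum_congr rfl fun y _ => hFH y
    _ = -(∑ x, ∑ i, ∑ y, F y (T x i)) + (lam : ℂ) • ∑ z, ((-1 : ℂ) ^ (∑ i, (z i).val)) • ∑ y, F y (siteSpin 1 z 2) := by
        rw [Finset.sum_add_distrib, Finset.sum_neg_distrib, ← Finset.smul_sum, Finset.sum_comm]
        congr 2
        · exact Finset.sum_congr rfl fun x _ => Finset.sum_comm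
        · rw [Finset.sum_comm]; exact Finset.sum_congr rfl fun z _ => Finset.smul_sum.symm
    _ = (2 : ℂ) • (∑ x, ∑ i, siteSpin 1 x 1 * siteSpin 1 (x + Pi.single i 1) 1) -
        (lam : ℂ) • ∑ z, ((-1 : ℂ) ^ (∑ i, (z i).val)) • siteSpin 1 z 2 := by
        simp only [hbond, hfield, Finset.sum_neg_distrib, neg_neg, smul_neg, Finset.smul_sum]
        rw [sub_eq_add_neg]

end NoCuspSymmetry

/-! ### §9 (nocusp), grand-canonical form: `E_GS(H - μS³_tot) ≤ E₀(1 - |Λ|⁻¹) + λ/2 - cμ²|Λ|` -/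

section NoCusp

variable {n : Type*} [Fintype n] [DecidableEq n]

/-- `(e^{iεC})ᴴ = e^{-iεC}` for Hermitian `C`. [folklore] -/
private theorem exp_conjTranspose_nogap {C : Matrix n n ℂ} (hC : C.IsHermitian) (ε : ℝ) :
    (NormedSpace.exp (ε • (I • C)))ᴴ = NormedSpace.exp (ε • -(I • C)) := by
  rw [← Matrix.exp_conjTranspose, conjTranspose_smul, conjTranspose_smul, hC.eq, Complex.star_def, Complex.conj_I,
    neg_smul]
  simp

/-- `e^{iεC}e^{-iεC} = 1`. [folklore] -/
private theorem exp_mul_exp_neg_nogap (C : Matrix n n ℂ) (ε : ℝ) :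
    NormedSpace.exp (ε • (I • C)) * NormedSpace.exp (ε • -(I • C)) = 1 := by
  rw [← Matrix.exp_add_of_commute _ _ ((((Commute.refl (I • C)).neg_right.smul_right ε).smul_left ε)),
    smul_neg, add_neg_cancel, NormedSpace.exp_zero]

/-- The variational principle with an unnormalised vector: `E₀‖w‖² ≤ Re⟨w, Aw⟩`. [cite: Tasaki2020, §2.1 (2.1.6)] -/
private theorem groundEnergy_mul_le_re_nogap {A : Matrix n n ℂ} (hA : A.IsHermitian) (w : n → ℂ) :
    A.groundEnergy * (star w ⬝ᵥ w).re ≤ (star w ⬝ᵥ (A *ᵥ w)).re := by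
  rcases eq_or_ne w 0 with hw | hw
  · rw [hw, mulVec_zero, dotProduct_zero, Complex.zero_re, mul_zero]
  · have hpos : 0 < (star w ⬝ᵥ w).re := by
      rw [star_dotProduct_self_eq_norm_sq, Complex.ofReal_re]
      have : (toLp 2 w : EuclideanSpace ℂ n) ≠ 0 := fun h => hw (by simpa using congrArg ofLp h)
      positivity
    haveI : Nonempty n := by
      by_contra h; rw [not_nonempty_iff] at h; exact hw (Subsingleton.elim _ _)
    have h := minEnergyOn_le_rayleigh_div_nogap hA ⊤ (Submodule.mem_top : w ∈ ⊤) hpos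
    rw [Matrix.minEnergyOn_top_holds hA, le_div_iff₀ hpos] at h
    exact h

/-- `B X B = ½(B²X + XB²) + ½[S,[X,S]]` for `B = S + ½`. [folklore] -/
private theorem shiftProj_mul_mul_shiftProj_nogap (S Y : Matrix n n ℂ) :
    (S + (1 / 2 : ℂ) • 1) * Y * (S + (1 / 2 : ℂ) • 1) =
      (1 / 2 : ℂ) • ((S + (1 / 2 : ℂ) • 1) * (S + (1 / 2 : ℂ) • 1) * Y + Y * ((S + (1 / 2 : ℂ) • 1) * (S + (1 / 2 : ℂ) • 1))) +
        (1 / 2 : ℂ) • (S * (Y * S - S * Y) - (Y * S - S * Y) * S) := by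
  simp only [Matrix.add_mul, Matrix.mul_add, Matrix.mul_sub, Matrix.sub_mul, Matrix.smul_mul, Matrix.mul_smul,
    Matrix.one_mul, Matrix.mul_one, smul_add, smul_sub, smul_smul, Matrix.mul_assoc]
  module

variable {d : ℕ} (L : ℕ) [NeZero L]

/-- `(S¹_y + ½)² = S¹_y + ½` (spin ½: `(S¹)² = ¼`) — the trial vector `(S¹_y + ½)Φ` has the norm
`⟨Φ,(S¹_y+½)Φ⟩ = ½`. [cite: AizenmanEtAl2004, §4 (proof of (nocusp): "`⟨ψ_y|ψ_y⟩ = ⟨0|S¹_y + ½|0⟩ = ½`")] -/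
theorem shiftProj_mul_self (y : TorusSite d L) :
    (siteSpin 1 y 0 + (1 / 2 : ℂ) • 1 : Op (TorusSite d L) 2) * (siteSpin 1 y 0 + (1 / 2 : ℂ) • 1) =
      siteSpin 1 y 0 + (1 / 2 : ℂ) • (1 : Op (TorusSite d L) 2) := by
  simp only [Matrix.mul_add, Matrix.add_mul, Matrix.mul_smul, Matrix.smul_mul, Matrix.mul_one, Matrix.one_mul,
    siteSpin_one_mul_self]
  module

/-- The trial vectors' norms: `Σ_y‖(S¹_y + ½)Φ‖² = |Λ|/2` in the ground state (`⟨S¹_y⟩₀ = 0`).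
[cite: AizenmanEtAl2004, §4 (proof of (nocusp): "`⟨ψ_y|ψ_y⟩ = ½`, where we used the symmetry `S^{1,2} → -S^{1,2}`")] -/
theorem hardCoreLatticeGas_sum_norm_sq_shiftProj (hd : 0 < d) (hL : Even L) (lam : ℝ)
    {Φ : TensorIndex (TorusSite d L) 2 → ℂ} (hΦ : Φ ∈ (hardCoreLatticeGas d L lam).groundSpace)
    (hΦ1 : star Φ ⬝ᵥ Φ = 1) (y : TorusSite d L) :
    star ((siteSpin 1 y 0 + (1 / 2 : ℂ) • 1 : Op (TorusSite d L) 2) *ᵥ Φ) ⬝ᵥ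
        ((siteSpin 1 y 0 + (1 / 2 : ℂ) • 1 : Op (TorusSite d L) 2) *ᵥ Φ) = 1 / 2 := by
  set H : Op (TorusSite d L) 2 := hardCoreLatticeGas d L lam with hHdef
  have hU : H.HasUniqueGroundState := HardCoreBoson.hasUniqueGroundState_hardCoreLatticeGas hd hL lam
  have hΦ0 : Φ ≠ 0 := by intro h; rw [h, dotProduct_zero] at hΦ1; exact zero_ne_one hΦ1
  have hBh : (siteSpin 1 y 0 + (1 / 2 : ℂ) • 1 : Op (TorusSite d L) 2).IsHermitian := by
    refine (siteSpin_isHermitian 1 y 0).add (IsHermitian.smul isHermitian_one ?_)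
    rw [isSelfAdjoint_iff]; norm_num [Complex.ext_iff]
  rw [star_mulVec_dotProduct, hBh.eq, mulVec_mulVec, shiftProj_mul_self, Matrix.add_mulVec, Matrix.smul_mulVec,
    Matrix.one_mulVec, dotProduct_add, dotProduct_smul, hΦ1, smul_eq_mul, mul_one]
  have h0 : star Φ ⬝ᵥ (siteSpin 1 y 0 *ᵥ Φ) = 0 := by
    have h := groundStateFunctional_siteSpin_zero_eq_zero L lam y
    rwa [groundStateFunctional_eq_of_hasUniqueGroundState hU hΦ hΦ0, hΦ1, div_one] at h
  rw [h0, zero_add]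

/-- **`[S²_tot, [S²_tot, H - μS³_tot]]` is of order `|Λ|`**: `‖[C,[C,K]]‖ ≤ (2d + |λ|/2 + |μ|/2)|Λ|` for `C = S²_tot`,
`K = H - μS³_tot` (the constant in (fircl): "After evaluating the double commutator for the case in question, a
simple bound gives (fircl)"). [cite: AizenmanEtAl2004, §4 (proof of (nocusp), (fircl)–(taylor))] -/
theorem norm_doubleComm_totalSpin_one_chemPot_le (h3 : 3 ≤ L) (lam μ : ℝ) :
    ‖totalSpin 1 1 * (totalSpin 1 1 * (hardCoreLatticeGas d L lam - (μ : ℂ) • totalSpin 1 2) -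
          (hardCoreLatticeGas d L lam - (μ : ℂ) • totalSpin 1 2) * totalSpin 1 1) -
        (totalSpin 1 1 * (hardCoreLatticeGas d L lam - (μ : ℂ) • totalSpin 1 2) -
          (hardCoreLatticeGas d L lam - (μ : ℂ) • totalSpin 1 2) * totalSpin 1 1) * (totalSpin 1 1 : Op (TorusSite d L) 2)‖ ≤
      (2 * d + |lam| / 2 + |μ| / 2) * Fintype.card (TorusSite d L) := by
  set H : Op (TorusSite d L) 2 := hardCoreLatticeGas d L lam with hHdef
  set N : ℝ := ((Fintype.card (TorusSite d L) : ℕ) : ℝ) with hNdef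
  set Z : Op (TorusSite d L) 2 := totalSpin 1 2 with hZdef
  set C : Op (TorusSite d L) 2 := totalSpin 1 1 with hCdef
  set S1 : Op (TorusSite d L) 2 := totalSpin 1 0 with hS1def
  have hCsum : C = ∑ y : TorusSite d L, onSite y (spinVec 1 1) := rfl
  have hC1 : ∀ y : TorusSite d L, ‖(onSite y (spinVec 1 1) : Op (TorusSite d L) 2)‖ ≤ 1 / 2 := fun y => by
    have h := XXZKT.norm_siteSpin_le_half (Λ := TorusSite d L) 1 y 1
    norm_num at h; exact h
  have hCZ : C * Z - Z * C = I • S1 := by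
    rw [hCdef, hZdef, hS1def, XXZKT.totalSpin_comm_totalSpin 1 1 2, Fin.sum_univ_three]
    simp [show KomaTasaki.leviCivita 1 2 0 = 1 by decide, show KomaTasaki.leviCivita 1 2 1 = 0 by decide,
      show KomaTasaki.leviCivita 1 2 2 = 0 by decide]
  have hCS1 : C * S1 - S1 * C = -(I • Z) := by
    rw [hCdef, hZdef, hS1def, XXZKT.totalSpin_comm_totalSpin 1 1 0, Fin.sum_univ_three]
    simp [show KomaTasaki.leviCivita 1 0 0 = 0 by decide, show KomaTasaki.leviCivita 1 0 1 = 0 by decide,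
      show KomaTasaki.leviCivita 1 0 2 = -1 by decide]
  set X : Op (TorusSite d L) 2 := C * H - H * C with hXdef
  have hCK : C * (H - (μ : ℂ) • Z) - (H - (μ : ℂ) • Z) * C = X - ((μ : ℂ) * I) • S1 := by
    calc C * (H - (μ : ℂ) • Z) - (H - (μ : ℂ) • Z) * C = (C * H - H * C) - (μ : ℂ) • (C * Z - Z * C) := by
          rw [Matrix.mul_sub, Matrix.sub_mul, Matrix.mul_smul, Matrix.smul_mul, smul_sub]; abel
      _ = X - ((μ : ℂ) * I) • S1 := by rw [hCZ, smul_smul, hXdef]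
  have hCCK : C * (C * (H - (μ : ℂ) • Z) - (H - (μ : ℂ) • Z) * C) - (C * (H - (μ : ℂ) • Z) - (H - (μ : ℂ) • Z) * C) * C =
      (C * X - X * C) - (μ : ℂ) • Z := by
    rw [hCK]
    calc C * (X - ((μ : ℂ) * I) • S1) - (X - ((μ : ℂ) * I) • S1) * C =
        (C * X - X * C) - ((μ : ℂ) * I) • (C * S1 - S1 * C) := by
          rw [Matrix.mul_sub, Matrix.sub_mul, Matrix.mul_smul, Matrix.smul_mul, smul_sub]; abel
      _ = (C * X - X * C) - (μ : ℂ) • Z := by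
          rw [hCS1, smul_neg, smul_smul, mul_assoc, I_mul_I, mul_neg, mul_one, neg_smul, neg_neg]
  have hCX : ‖C * X - X * C‖ ≤ (2 * d + |lam| / 2) * N := by
    have h := norm_sum_onSite_comm_hardCoreLatticeGas_comm_le L h3 lam hC1 hC1
    rw [← hCsum, ← hHdef] at h
    rw [hXdef, show C * (C * H - H * C) - (C * H - H * C) * C = -(C * (H * C - C * H) - (H * C - C * H) * C) by
      noncomm_ring, norm_neg]
    refine h.trans (le_of_eq ?_); rw [hNdef]; ring
  rw [hCCK]
  refine (norm_sub_le _ _).trans ?_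
  rw [norm_smul, Complex.norm_real, Real.norm_eq_abs]
  have hZn : ‖Z‖ ≤ N / 2 := by rw [hZdef, hNdef]; exact norm_totalSpin_two_le_half_card
  have := mul_le_mul_of_nonneg_left hZn (abs_nonneg μ)
  nlinarith [hCX, this]

/-- **The zeroth order of (nocusp)**: `Σ_y⟨ψ_y|H - μS³_tot|ψ_y⟩ = (|Λ|/2)E₀ + ½(-E₀ + λ|Λ|/2)`, `ψ_y = (S¹_y+½)Φ`
(the displays "`Σ_y⟨0|(S¹_y+½)(H-E_0)(S¹_y+½)|0⟩ = ½Σ_y⟨0|[S¹_y,[H,S¹_y]]|0⟩ = ... = -½(E_0 - ½λ|Λ|)`" and, for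
the `S³_tot` part, "Using that `S³_tot|0⟩ = 0`"). [cite: AizenmanEtAl2004, §4 (proof of (nocusp))] -/
theorem hardCoreLatticeGas_sum_shiftProj_energy (hd : 0 < d) (hL : Even L) (h3 : 3 ≤ L) (lam μ : ℝ)
    {Φ : TensorIndex (TorusSite d L) 2 → ℂ} (hΦ : Φ ∈ (hardCoreLatticeGas d L lam).groundSpace)
    (hΦ1 : star Φ ⬝ᵥ Φ = 1) :
    ∑ y : TorusSite d L, star ((siteSpin 1 y 0 + (1 / 2 : ℂ) • 1 : Op (TorusSite d L) 2) *ᵥ Φ) ⬝ᵥ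
        ((hardCoreLatticeGas d L lam - (μ : ℂ) • totalSpin 1 2) *ᵥ
          ((siteSpin 1 y 0 + (1 / 2 : ℂ) • 1 : Op (TorusSite d L) 2) *ᵥ Φ)) =
      (((Fintype.card (TorusSite d L) : ℝ) / 2 * (hardCoreLatticeGas d L lam).groundEnergy +
        (1 / 2) * (-(hardCoreLatticeGas d L lam).groundEnergy + lam * Fintype.card (TorusSite d L) / 2) : ℝ) : ℂ) := by
  set H : Op (TorusSite d L) 2 := hardCoreLatticeGas d L lam with hHdef
  set N : ℝ := ((Fintype.card (TorusSite d L) : ℕ) : ℝ) with hNdef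
  set E₀ : ℝ := H.groundEnergy with hE₀
  set Z : Op (TorusSite d L) 2 := totalSpin 1 2 with hZdef
  set B : TorusSite d L → Op (TorusSite d L) 2 := fun y => siteSpin 1 y 0 + (1 / 2 : ℂ) • 1 with hBdef
  have hHh : H.IsHermitian := hardCoreLatticeGas_isHermitian d L lam
  have hZh : Z.IsHermitian := totalSpin_isHermitian 1 2
  have hU : H.HasUniqueGroundState := HardCoreBoson.hasUniqueGroundState_hardCoreLatticeGas hd hL lam
  have hΦ0 : Φ ≠ 0 := by intro h; rw [h, dotProduct_zero] at hΦ1; exact zero_ne_one hΦ1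
  have hω : ∀ X : Op (TorusSite d L) 2, H.groundStateFunctional X = star Φ ⬝ᵥ (X *ᵥ Φ) := fun X => by
    rw [groundStateFunctional_eq_of_hasUniqueGroundState hU hΦ hΦ0 X, hΦ1, div_one]
  have hHΦ : H *ᵥ Φ = (E₀ : ℂ) • Φ := by
    have h := Module.End.mem_eigenspace_iff.1 hΦ; rwa [Matrix.toLin'_apply] at h
  have hZΦ : Z *ᵥ Φ = 0 := HardCoreBoson.groundState_totalSpin_eq_zero hd hL lam hΦ
  have hNC : (N : ℂ) = (Fintype.card (TorusSite d L) : ℂ) := by rw [hNdef]; push_cast; rfl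
  have hBh : ∀ y, (B y).IsHermitian := fun y => by
    simp only [hBdef]
    refine (siteSpin_isHermitian 1 y 0).add (IsHermitian.smul isHermitian_one ?_)
    rw [isSelfAdjoint_iff]; norm_num [Complex.ext_iff]
  have hω1 : ∀ y : TorusSite d L, H.groundStateFunctional (siteSpin 1 y 0) = 0 :=
    fun y => groundStateFunctional_siteSpin_zero_eq_zero L lam y
  have hωB2 : ∀ y : TorusSite d L, H.groundStateFunctional (B y * B y) = 1 / 2 := by
    intro y
    simp only [hBdef]
    rw [shiftProj_mul_self, map_add, map_smul, hω1, Matrix.groundStateFunctional_one hHh, smul_eq_mul, mul_one, zero_add]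
  -- `⟨ψ_y, Y ψ_y⟩ = ω(B Y B) = ½ω(B²Y + YB²) + ½ω([S,[Y,S]])`, and `ω(B²Y + YB²) = 2e·ω(B²) = e` for `YΦ = eΦ`
  have hvX : ∀ (y : TorusSite d L) (Y : Op (TorusSite d L) 2),
      star (B y *ᵥ Φ) ⬝ᵥ (Y *ᵥ (B y *ᵥ Φ)) = H.groundStateFunctional (B y * Y * B y) := by
    intro y Y
    rw [hω, star_mulVec, ← dotProduct_mulVec, (hBh y).eq, mulVec_mulVec, mulVec_mulVec]
  have hzero : ∀ (y : TorusSite d L) {Y : Op (TorusSite d L) 2} (hY : Y.IsHermitian) {e : ℝ} (he : Y *ᵥ Φ = (e : ℂ) • Φ),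
      H.groundStateFunctional (B y * B y * Y + Y * (B y * B y)) = (e : ℂ) := by
    intro y Y hY e he
    have h1 : H.groundStateFunctional (B y * B y * Y) = (e : ℂ) * (1 / 2) := by
      rw [hω, ← mulVec_mulVec, he, mulVec_smul, dotProduct_smul, ← hω, hωB2, smul_eq_mul]
    have h2 : H.groundStateFunctional (Y * (B y * B y)) = (e : ℂ) * (1 / 2) := by
      rw [hω, ← mulVec_mulVec, star_dotProduct_mulVec_of_isHermitian_nogap hY, he, star_smul, smul_dotProduct,
        Complex.star_def, Complex.conj_ofReal, ← hω, hωB2, smul_eq_mul]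
    rw [map_add, h1, h2]; ring
  have hy : ∀ y : TorusSite d L, star (B y *ᵥ Φ) ⬝ᵥ ((H - (μ : ℂ) • Z) *ᵥ (B y *ᵥ Φ)) =
      (1 / 2 : ℂ) * E₀ + (1 / 2 : ℂ) * H.groundStateFunctional (siteSpin 1 y 0 * (H * siteSpin 1 y 0 - siteSpin 1 y 0 * H) -
        (H * siteSpin 1 y 0 - siteSpin 1 y 0 * H) * siteSpin 1 y 0) -
        (μ : ℂ) * ((1 / 2 : ℂ) * H.groundStateFunctional (siteSpin 1 y 0 * (Z * siteSpin 1 y 0 - siteSpin 1 y 0 * Z) -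
          (Z * siteSpin 1 y 0 - siteSpin 1 y 0 * Z) * siteSpin 1 y 0)) := by
    intro y
    rw [hvX, Matrix.mul_sub, Matrix.sub_mul, Matrix.mul_smul, Matrix.smul_mul, map_sub, map_smul]
    simp only [hBdef]
    rw [shiftProj_mul_mul_shiftProj_nogap, shiftProj_mul_mul_shiftProj_nogap, map_add, map_add, map_smul, map_smul,
      map_smul, map_smul]
    have hzH := hzero y hHh hHΦ
    have hzZ := hzero y hZh (e := 0) (by rw [hZΦ, Complex.ofReal_zero, zero_smul])
    simp only [hBdef] at hzH hzZ
    rw [hzH, hzZ, smul_eq_mul, smul_eq_mul, smul_eq_mul, smul_eq_mul, smul_eq_mul, Complex.ofReal_zero, mul_zero, zero_add]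
  -- the `S³_tot` double commutator: `[S¹_y,[S³_tot,S¹_y]] = -S³_y`
  have hZS : ∀ y : TorusSite d L, Z * siteSpin 1 y 0 - siteSpin 1 y 0 * Z = I • siteSpin 1 y 1 := by
    intro y
    rw [hZdef, XXZKT.totalSpin_comm_siteSpin 1 y 2 0, Fin.sum_univ_three]
    simp [show KomaTasaki.leviCivita 2 0 0 = 0 by decide, show KomaTasaki.leviCivita 2 0 1 = 1 by decide,
      show KomaTasaki.leviCivita 2 0 2 = 0 by decide]
  have hZdc : ∀ y : TorusSite d L, siteSpin 1 y 0 * (Z * siteSpin 1 y 0 - siteSpin 1 y 0 * Z) -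
      (Z * siteSpin 1 y 0 - siteSpin 1 y 0 * Z) * siteSpin 1 y 0 = -siteSpin 1 y 2 := by
    intro y
    rw [hZS, Matrix.mul_smul, Matrix.smul_mul, siteSpin_one_x_mul_y, siteSpin_one_y_mul_x, smul_neg, sub_neg_eq_add,
      smul_smul, ← add_smul, ← neg_one_smul ℂ (siteSpin 1 y 2 : Op (TorusSite d L) 2)]
    congr 1
    rw [← mul_add, add_halves, I_mul_I]
  -- the two sums over `y`
  have hsumZ : ∑ y : TorusSite d L, H.groundStateFunctional (siteSpin 1 y 0 * (Z * siteSpin 1 y 0 - siteSpin 1 y 0 * Z) -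
      (Z * siteSpin 1 y 0 - siteSpin 1 y 0 * Z) * siteSpin 1 y 0) = 0 := by
    simp only [hZdc, map_neg, Finset.sum_neg_distrib, ← map_sum]
    rw [show (∑ y : TorusSite d L, siteSpin 1 y 2 : Op (TorusSite d L) 2) = Z from rfl, hω, hZΦ, dotProduct_zero, neg_zero]
  have hT_def : ∀ (x : TorusSite d L) (i : Fin d),
      H.groundStateFunctional (siteSpin 1 x 0 * siteSpin 1 (x + Pi.single i 1) 0 +
        siteSpin 1 x 1 * siteSpin 1 (x + Pi.single i 1) 1) =
        2 * H.groundStateFunctional (siteSpin 1 x 1 * siteSpin 1 (x + Pi.single i 1) 1) := by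
    intro x i
    rw [map_add, groundStateFunctional_siteSpin_zero_mul_eq_one_mul L lam, two_mul]
  have hHexp : H = -(∑ x : TorusSite d L, ∑ i : Fin d,
      (siteSpin 1 x 0 * siteSpin 1 (x + Pi.single i 1) 0 + siteSpin 1 x 1 * siteSpin 1 (x + Pi.single i 1) 1)) +
      (lam : ℂ) • ∑ z : TorusSite d L, ((1 / 2 : ℂ) • (1 : Op (TorusSite d L) 2) + ((-1 : ℂ) ^ (∑ i, (z i).val)) • siteSpin 1 z 2) := by
    rw [hHdef, hardCoreLatticeGas_eq, xyTorus_eq_neg_sum_hop_nogap L h3]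
  have hE0 : (E₀ : ℂ) = -(2 * ∑ x : TorusSite d L, ∑ i : Fin d,
      H.groundStateFunctional (siteSpin 1 x 1 * siteSpin 1 (x + Pi.single i 1) 1)) +
        (lam : ℂ) * ((N : ℂ) / 2 + ∑ z : TorusSite d L, ((-1 : ℂ) ^ (∑ i, (z i).val)) *
          H.groundStateFunctional (siteSpin 1 z 2)) := by
    have h : H.groundStateFunctional H = (E₀ : ℂ) := by rw [hω, hHΦ, dotProduct_smul, hΦ1, smul_eq_mul, mul_one]
    calc (E₀ : ℂ) = H.groundStateFunctional H := h.symm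
      _ = H.groundStateFunctional (-(∑ x : TorusSite d L, ∑ i : Fin d,
            (siteSpin 1 x 0 * siteSpin 1 (x + Pi.single i 1) 0 + siteSpin 1 x 1 * siteSpin 1 (x + Pi.single i 1) 1)) +
            (lam : ℂ) • ∑ z : TorusSite d L,
              ((1 / 2 : ℂ) • (1 : Op (TorusSite d L) 2) + ((-1 : ℂ) ^ (∑ i, (z i).val)) • siteSpin 1 z 2)) := by
          rw [← hHexp]
      _ = _ := by
          rw [map_add, map_neg, map_smul, map_sum, map_sum, smul_eq_mul]
          simp only [map_sum]
          simp only [hT_def, map_add, map_smul, Matrix.groundStateFunctional_one hHh, smul_eq_mul,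
            Finset.sum_add_distrib, Finset.sum_const, Finset.card_univ, nsmul_eq_mul, mul_one, ← hNC, ← Finset.mul_sum]
          ring
  have hsumH : ∑ y : TorusSite d L, H.groundStateFunctional (siteSpin 1 y 0 * (H * siteSpin 1 y 0 - siteSpin 1 y 0 * H) -
      (H * siteSpin 1 y 0 - siteSpin 1 y 0 * H) * siteSpin 1 y 0) = -(E₀ : ℂ) + (lam : ℂ) * N / 2 := by
    rw [← map_sum, hardCoreLatticeGas_sum_doubleComm_siteSpin_zero L h3 lam, map_sub, map_smul, map_smul, map_sum, map_sum]
    simp only [map_sum, map_smul, smul_eq_mul]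
    rw [hE0]
    ring
  simp only [hBdef] at hy
  simp only [hy, Finset.sum_add_distrib, Finset.sum_sub_distrib, Finset.sum_const, Finset.card_univ, nsmul_eq_mul,
    ← Finset.mul_sum, hsumH, hsumZ, mul_zero, sub_zero]
  rw [← hNC]; push_cast; ring


/-- The `S^{1,2} → -S^{1,2}` symmetry kills `⟨S¹_tot⟩₀` and the "diagonal terms" `⟨S¹_y[S²_tot,H]S¹_y⟩₀`.
[cite: AizenmanEtAl2004, §4 (proof of (nocusp): "The diagonal terms are zero by the symmetry
`S^{1,2}_x → -S^{1,2}_x` at all sites")] -/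
private theorem gsf_halfTurn_odd_nogap (lam : ℝ) :
    (hardCoreLatticeGas d L lam).groundStateFunctional (totalSpin 1 0) = 0 ∧
      ∀ y : TorusSite d L, (hardCoreLatticeGas d L lam).groundStateFunctional
        (siteSpin 1 y 0 * (totalSpin 1 1 * hardCoreLatticeGas d L lam - hardCoreLatticeGas d L lam * totalSpin 1 1) *
          siteSpin 1 y 0) = 0 := by
  obtain ⟨R, hRH, hRR, h0, h1⟩ := exists_halfTurn_hardCoreLatticeGas (d := d) L lam
  have hHh := hardCoreLatticeGas_isHermitian d L lam
  set H : Op (TorusSite d L) 2 := hardCoreLatticeGas d L lam with hH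
  have hRR' : R * Rᴴ = 1 := mul_eq_one_comm.1 hRR
  have hRHR : R * H * Rᴴ = H := by rw [hRH, Matrix.mul_assoc, hRR', Matrix.mul_one]
  have hRS1 : R * totalSpin 1 0 * Rᴴ = -(totalSpin 1 0 : Op (TorusSite d L) 2) := by
    rw [show (totalSpin 1 0 : Op (TorusSite d L) 2) = ∑ x, siteSpin 1 x 0 from rfl, unitary_conj_sum_nogap,
      ← Finset.sum_neg_distrib]
    exact Finset.sum_congr rfl fun x _ => h0 x
  have hRC : R * totalSpin 1 1 * Rᴴ = -(totalSpin 1 1 : Op (TorusSite d L) 2) := by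
    rw [show (totalSpin 1 1 : Op (TorusSite d L) 2) = ∑ x, siteSpin 1 x 1 from rfl, unitary_conj_sum_nogap,
      ← Finset.sum_neg_distrib]
    exact Finset.sum_congr rfl fun x _ => h1 x
  have hRX : R * (totalSpin 1 1 * H - H * totalSpin 1 1) * Rᴴ = -(totalSpin 1 1 * H - H * totalSpin 1 1) := by
    rw [unitary_conj_comm_nogap hRR, hRHR, hRC]; noncomm_ring
  refine ⟨groundStateFunctional_eq_zero_of_conj_eq_neg hHh hRH hRR hRS1, fun y =>
    groundStateFunctional_eq_zero_of_conj_eq_neg hHh hRH hRR ?_⟩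
  rw [unitary_conj_mul_nogap hRR, unitary_conj_mul_nogap hRR, hRX, h0]
  simp only [Matrix.neg_mul, Matrix.mul_neg, neg_neg]

/-- The `S^{2,3} → -S^{2,3}` symmetry followed by a unit translation kills `⟨[S²_tot,H]⟩₀` and the
"off-diagonal terms" `⟨S¹_tot[S²_tot,H] + [S²_tot,H]S¹_tot⟩₀`. [cite: AizenmanEtAl2004, §4 (proof of (nocusp):
"zero by the symmetry `S^{1,3}_x → -S^{1,3}_x` at all sites, followed by a unit-vector translation")] -/
private theorem gsf_translate_odd_nogap (hd : 0 < d) (hL : Even L) (h3 : 3 ≤ L) (lam : ℝ) :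
    (hardCoreLatticeGas d L lam).groundStateFunctional
        (totalSpin 1 1 * hardCoreLatticeGas d L lam - hardCoreLatticeGas d L lam * totalSpin 1 1) = 0 ∧
      (hardCoreLatticeGas d L lam).groundStateFunctional
        (totalSpin 1 0 * (totalSpin 1 1 * hardCoreLatticeGas d L lam - hardCoreLatticeGas d L lam * totalSpin 1 1) +
          (totalSpin 1 1 * hardCoreLatticeGas d L lam - hardCoreLatticeGas d L lam * totalSpin 1 1) * totalSpin 1 0) = 0 := by
  set v : TorusSite d L := Pi.single (⟨0, hd⟩ : Fin d) (1 : ZMod L) with hv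
  have hv1 : ((-1 : ℂ) ^ (∑ i, (v i).val)) = -1 := by
    have : (∑ i : Fin d, (v i).val) = 1 := by
      rw [Finset.sum_eq_single (⟨0, hd⟩ : Fin d) (fun j _ hj => by rw [hv, Pi.single_eq_of_ne hj, ZMod.val_zero])
        (fun h => absurd (Finset.mem_univ _) h), hv, Pi.single_eq_same]
      haveI : Fact (1 < L) := ⟨by omega⟩
      exact ZMod.val_one L
    rw [this, pow_one]
  obtain ⟨W, hWH, hWW, hWS⟩ := exists_unitary_hardCoreLatticeGas_translate (d := d) L hL lam v
  have hHh := hardCoreLatticeGas_isHermitian d L lam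
  set H : Op (TorusSite d L) 2 := hardCoreLatticeGas d L lam with hH
  have hWW' : W * Wᴴ = 1 := mul_eq_one_comm.1 hWW
  have hWHW : W * H * Wᴴ = H := by rw [hWH, Matrix.mul_assoc, hWW', Matrix.mul_one]
  have hW0 : ∀ x : TorusSite d L, W * siteSpin 1 x 0 * Wᴴ = siteSpin 1 (x + v) 0 := fun x => by
    rw [hWS, if_pos rfl, one_smul]
  have hW1 : ∀ x : TorusSite d L, W * siteSpin 1 x 1 * Wᴴ = -siteSpin 1 (x + v) 1 := fun x => by
    rw [hWS, if_neg (show (1 : Fin 3) ≠ 0 by decide), hv1, neg_one_smul]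
  have hWS1 : W * totalSpin 1 0 * Wᴴ = (totalSpin 1 0 : Op (TorusSite d L) 2) := by
    rw [show (totalSpin 1 0 : Op (TorusSite d L) 2) = ∑ x, siteSpin 1 x 0 from rfl, unitary_conj_sum_nogap]
    simp only [hW0]
    exact Fintype.sum_equiv (Equiv.addRight v) _ _ fun x => rfl
  have hWC : W * totalSpin 1 1 * Wᴴ = -(totalSpin 1 1 : Op (TorusSite d L) 2) := by
    rw [show (totalSpin 1 1 : Op (TorusSite d L) 2) = ∑ x, siteSpin 1 x 1 from rfl, unitary_conj_sum_nogap,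
      ← Finset.sum_neg_distrib]
    simp only [hW1]
    exact Fintype.sum_equiv (Equiv.addRight v) _ _ fun x => rfl
  have hWX : W * (totalSpin 1 1 * H - H * totalSpin 1 1) * Wᴴ = -(totalSpin 1 1 * H - H * totalSpin 1 1) := by
    rw [unitary_conj_comm_nogap hWW, hWHW, hWC]; noncomm_ring
  refine ⟨groundStateFunctional_eq_zero_of_conj_eq_neg hHh hWH hWW hWX,
    groundStateFunctional_eq_zero_of_conj_eq_neg hHh hWH hWW ?_⟩
  rw [Matrix.mul_add, Matrix.add_mul, unitary_conj_mul_nogap hWW, unitary_conj_mul_nogap hWW, hWX, hWS1]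
  simp only [Matrix.neg_mul, Matrix.mul_neg, neg_add]

/-- **The first order of (nocusp) is the condensate**: for the trial vectors `ψ_y = (S¹_y+½)Φ`,
`Σ_y⟨ψ_y| i[S²_tot, H - μS³_tot] |ψ_y⟩ = μ⟨(S¹_tot)²⟩₀ = (μ/2)Σ_{x,y}⟨S¹_xS¹_y + S²_xS²_y⟩₀`: the `H`-part
vanishes by symmetry (diagonal terms by `S^{1,2} → -S^{1,2}`, off-diagonal ones by `S^{2,3} → -S^{2,3}` plus a unit
translation) and `i[S²_tot,S³_tot] = -S¹_tot`. [cite: AizenmanEtAl2004, §4 (proof of (nocusp): "The second term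
... is zero by symmetry" and "`= (2/|Λ|) sin ε ⟨0|(S¹_tot)²|0⟩`")] [cite: LSSY2005, Ch. 11 (11.28)–(11.30)] -/
theorem hardCoreLatticeGas_sum_shiftProj_firstOrder (hd : 0 < d) (hL : Even L) (h3 : 3 ≤ L) (lam μ : ℝ)
    {Φ : TensorIndex (TorusSite d L) 2 → ℂ} (hΦ : Φ ∈ (hardCoreLatticeGas d L lam).groundSpace)
    (hΦ1 : star Φ ⬝ᵥ Φ = 1) :
    ∑ y : TorusSite d L, star ((siteSpin 1 y 0 + (1 / 2 : ℂ) • 1 : Op (TorusSite d L) 2) *ᵥ Φ) ⬝ᵥ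
        ((I • (totalSpin 1 1 * (hardCoreLatticeGas d L lam - (μ : ℂ) • totalSpin 1 2) -
            (hardCoreLatticeGas d L lam - (μ : ℂ) • totalSpin 1 2) * totalSpin 1 1)) *ᵥ
          ((siteSpin 1 y 0 + (1 / 2 : ℂ) • 1 : Op (TorusSite d L) 2) *ᵥ Φ)) =
      ((μ / 2 : ℝ) : ℂ) * ∑ x : TorusSite d L, ∑ y : TorusSite d L,
        star Φ ⬝ᵥ ((siteSpin 1 x 0 * siteSpin 1 y 0 + siteSpin 1 x 1 * siteSpin 1 y 1) *ᵥ Φ) := by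
  set H : Op (TorusSite d L) 2 := hardCoreLatticeGas d L lam with hHdef
  set Z : Op (TorusSite d L) 2 := totalSpin 1 2 with hZdef
  set C : Op (TorusSite d L) 2 := totalSpin 1 1 with hCdef
  set S1 : Op (TorusSite d L) 2 := totalSpin 1 0 with hS1def
  set X : Op (TorusSite d L) 2 := C * H - H * C with hXdef
  set B : TorusSite d L → Op (TorusSite d L) 2 := fun y => siteSpin 1 y 0 + (1 / 2 : ℂ) • 1 with hBdef
  show ∑ y, star (B y *ᵥ Φ) ⬝ᵥ ((I • (C * (H - (μ : ℂ) • Z) - (H - (μ : ℂ) • Z) * C)) *ᵥ (B y *ᵥ Φ)) = _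
  have hHh : H.IsHermitian := hardCoreLatticeGas_isHermitian d L lam
  have hU : H.HasUniqueGroundState := HardCoreBoson.hasUniqueGroundState_hardCoreLatticeGas hd hL lam
  have hΦ0 : Φ ≠ 0 := by intro h; rw [h, dotProduct_zero] at hΦ1; exact zero_ne_one hΦ1
  have hω : ∀ Y : Op (TorusSite d L) 2, H.groundStateFunctional Y = star Φ ⬝ᵥ (Y *ᵥ Φ) := fun Y => by
    rw [groundStateFunctional_eq_of_hasUniqueGroundState hU hΦ hΦ0 Y, hΦ1, div_one]
  have hBh : ∀ y, (B y).IsHermitian := fun y => by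
    simp only [hBdef]
    refine (siteSpin_isHermitian 1 y 0).add (IsHermitian.smul isHermitian_one ?_)
    rw [isSelfAdjoint_iff]; norm_num [Complex.ext_iff]
  have hvX : ∀ (y : TorusSite d L) (Y : Op (TorusSite d L) 2),
      star (B y *ᵥ Φ) ⬝ᵥ (Y *ᵥ (B y *ᵥ Φ)) = H.groundStateFunctional (B y * Y * B y) := by
    intro y Y
    rw [hω, star_mulVec, ← dotProduct_mulVec, (hBh y).eq, mulVec_mulVec, mulVec_mulVec]
  -- `i[C, H - μZ] = iX + μS¹_tot`
  have hCZ : C * Z - Z * C = I • S1 := by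
    rw [hCdef, hZdef, hS1def, XXZKT.totalSpin_comm_totalSpin 1 1 2, Fin.sum_univ_three]
    simp [show KomaTasaki.leviCivita 1 2 0 = 1 by decide, show KomaTasaki.leviCivita 1 2 1 = 0 by decide,
      show KomaTasaki.leviCivita 1 2 2 = 0 by decide]
  have hI : I • (C * (H - (μ : ℂ) • Z) - (H - (μ : ℂ) • Z) * C) = I • X + (μ : ℂ) • S1 := by
    have h : C * (H - (μ : ℂ) • Z) - (H - (μ : ℂ) • Z) * C = X - (μ : ℂ) • (C * Z - Z * C) := by
      rw [hXdef, Matrix.mul_sub, Matrix.sub_mul, Matrix.mul_smul, Matrix.smul_mul, smul_sub]; abel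
    rw [h, hCZ, smul_sub, smul_smul, smul_smul, show I * (μ : ℂ) * I = -(μ : ℂ) by
      rw [mul_right_comm, I_mul_I, neg_one_mul], neg_smul, sub_neg_eq_add]
  -- `B Y B = S Y S + ½(S Y + Y S) + ¼Y` (`B² = B`)
  have hBYB : ∀ (y : TorusSite d L) (Y : Op (TorusSite d L) 2), B y * Y * B y =
      siteSpin 1 y 0 * Y * siteSpin 1 y 0 + (1 / 2 : ℂ) • (siteSpin 1 y 0 * Y + Y * siteSpin 1 y 0) + (1 / 4 : ℂ) • Y := by
    intro y Y
    simp only [hBdef, Matrix.add_mul, Matrix.mul_add, Matrix.smul_mul, Matrix.mul_smul, Matrix.one_mul, Matrix.mul_one,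
      smul_add, smul_smul]
    module
  obtain ⟨hS1ω, hSXS⟩ := gsf_halfTurn_odd_nogap (d := d) L lam
  obtain ⟨hXω, hS1X⟩ := gsf_translate_odd_nogap (d := d) L hd hL h3 lam
  rw [← hHdef] at hS1ω hSXS hXω hS1X
  -- the `H`-part vanishes
  have hsumX : ∑ y : TorusSite d L, H.groundStateFunctional (B y * X * B y) = 0 := by
    have h : ∀ y : TorusSite d L, H.groundStateFunctional (B y * X * B y) = (1 / 2 : ℂ) •
        H.groundStateFunctional (siteSpin 1 y 0 * (totalSpin 1 1 * H - H * totalSpin 1 1) +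
          (totalSpin 1 1 * H - H * totalSpin 1 1) * siteSpin 1 y 0) := by
      intro y
      rw [hBYB, hXdef, hCdef, map_add, map_add, map_smul, map_smul, hSXS, hXω, smul_zero, zero_add, add_zero]
    simp only [h, ← Finset.smul_sum, ← map_sum]
    rw [Finset.sum_add_distrib, ← Finset.sum_mul, ← Finset.mul_sum,
      show (∑ y : TorusSite d L, siteSpin 1 y 0 : Op (TorusSite d L) 2) = totalSpin 1 0 from rfl, hS1X, smul_zero]
  -- the `S¹_tot`-part is `⟨(S¹_tot)²⟩`
  have hSS1 : ∀ y : TorusSite d L, siteSpin 1 y 0 * S1 = S1 * siteSpin 1 y 0 := by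
    intro y
    have h := XXZKT.totalSpin_comm_siteSpin (Λ := TorusSite d L) 1 y 0 0
    rw [Fin.sum_univ_three] at h
    simp only [show KomaTasaki.leviCivita 0 0 0 = 0 by decide, show KomaTasaki.leviCivita 0 0 1 = 0 by decide,
      show KomaTasaki.leviCivita 0 0 2 = 0 by decide, Int.cast_zero, zero_smul, add_zero, smul_zero, sub_eq_zero] at h
    exact h.symm
  have hBS1B : ∀ y : TorusSite d L, B y * S1 * B y = (1 / 2 : ℂ) • S1 + siteSpin 1 y 0 * S1 := by
    intro y
    rw [hBYB, ← hSS1 y, Matrix.mul_assoc (siteSpin 1 y 0) S1 (siteSpin 1 y 0), ← hSS1 y, ← Matrix.mul_assoc,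
      siteSpin_one_mul_self, Matrix.smul_mul, Matrix.one_mul]
    module
  have hS1ω' : H.groundStateFunctional S1 = 0 := hS1ω
  have hsumS1 : ∑ y : TorusSite d L, H.groundStateFunctional (B y * S1 * B y) = H.groundStateFunctional (S1 * S1) := by
    simp only [hBS1B, map_add, map_smul, hS1ω', smul_zero, zero_add, ← map_sum, ← Finset.sum_mul]
    rfl
  have hxy : ∀ x y : TorusSite d L, H.groundStateFunctional (siteSpin 1 x 0 * siteSpin 1 y 0) =
      (1 / 2 : ℂ) * star Φ ⬝ᵥ ((siteSpin 1 x 0 * siteSpin 1 y 0 + siteSpin 1 x 1 * siteSpin 1 y 1) *ᵥ Φ) := by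
    intro x y
    rw [← hω, map_add, ← groundStateFunctional_siteSpin_zero_mul_eq_one_mul L lam x y]
    ring
  have hS1S1 : H.groundStateFunctional (S1 * S1) = (1 / 2 : ℂ) * ∑ x : TorusSite d L, ∑ y : TorusSite d L,
      star Φ ⬝ᵥ ((siteSpin 1 x 0 * siteSpin 1 y 0 + siteSpin 1 x 1 * siteSpin 1 y 1) *ᵥ Φ) := by
    rw [show S1 = ∑ x : TorusSite d L, siteSpin 1 x 0 from rfl, Finset.sum_mul_sum]
    simp only [map_sum, hxy, Finset.mul_sum]
  -- assemble
  calc ∑ y, star (B y *ᵥ Φ) ⬝ᵥ ((I • (C * (H - (μ : ℂ) • Z) - (H - (μ : ℂ) • Z) * C)) *ᵥ (B y *ᵥ Φ))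
      = I * ∑ y, H.groundStateFunctional (B y * X * B y) + (μ : ℂ) * ∑ y, H.groundStateFunctional (B y * S1 * B y) := by
        simp only [hvX, hI, Matrix.mul_add, Matrix.add_mul, Matrix.mul_smul, Matrix.smul_mul, map_add, map_smul,
          smul_eq_mul, Finset.sum_add_distrib, Finset.mul_sum]
    _ = _ := by rw [hsumX, hsumS1, hS1S1, mul_zero, zero_add, ← mul_assoc]; push_cast; ring

/-- **(nocusp), grand-canonical form, with explicit constants.** For the half-filled hard-core lattice gas
`H = hardCoreLatticeGas d L λ` on the even torus (`L ≥ 3` even, `d ≥ 1`) with normalised ground state `Φ`, ground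
state energy `E₀`, and every `μ, ε ∈ ℝ`,
`E_GS(H - μS³_tot) ≤ E₀(1 - |Λ|⁻¹) + λ/2 + εμ·|Λ|⁻¹Σ_{x,y}⟨S¹_xS¹_y + S²_xS²_y⟩₀ + (2d + |λ|/2 + |μ|/2)|Λ|ε²/2`,
from the trial states `|ψ_y⟩ = e^{iεS²_tot}(S¹_y+½)|0⟩` averaged over `y` (a density matrix), Taylor's formula
(taylor)/(fircl) for `ε ↦ e^{iεC}Ke^{-iεC}`, the zeroth order `ΔE = (|E₀| + ½λ|Λ|)/|Λ|`-computation and the first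
order `(2/|Λ|)⟨(S¹_tot)²⟩₀`. Choosing `ε ∝ -μ` gives the printed `E₀(1-|Λ|⁻¹) + ½λ - cμ²|Λ|` in the presence of
BEC (next declaration). [cite: AizenmanEtAl2004, §4 (proof of (nocusp), from "consider the states `|ψ_y⟩`" to "we
obtain as an upper bound for the ground state energy of `H - μS³_tot` `E_0(1-|Λ|^{-1}) + ½λ - cμ²|Λ|`")]
[cite: LSSY2005, Ch. 11 (11.28)–(11.30)] -/
theorem hardCoreLatticeGas_groundEnergy_sub_chemPot_le (hd : 0 < d) (hL : Even L) (h3 : 3 ≤ L) (lam μ ε : ℝ)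
    {Φ : TensorIndex (TorusSite d L) 2 → ℂ} (hΦ : Φ ∈ (hardCoreLatticeGas d L lam).groundSpace)
    (hΦ1 : star Φ ⬝ᵥ Φ = 1) :
    (hardCoreLatticeGas d L lam - (μ : ℂ) • totalSpin 1 2).groundEnergy ≤
      (hardCoreLatticeGas d L lam).groundEnergy - (hardCoreLatticeGas d L lam).groundEnergy / Fintype.card (TorusSite d L) +
        lam / 2 + ε * μ * ((∑ x : TorusSite d L, ∑ y : TorusSite d L,
          (star Φ ⬝ᵥ ((siteSpin 1 x 0 * siteSpin 1 y 0 + siteSpin 1 x 1 * siteSpin 1 y 1) *ᵥ Φ)).re) /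
            Fintype.card (TorusSite d L)) +
        (2 * d + |lam| / 2 + |μ| / 2) * Fintype.card (TorusSite d L) * ε ^ 2 / 2 := by
  set N : ℝ := ((Fintype.card (TorusSite d L) : ℕ) : ℝ) with hNdef
  have hN : 0 < N := by rw [hNdef]; exact_mod_cast Fintype.card_pos
  have hHh : (hardCoreLatticeGas d L lam).IsHermitian := hardCoreLatticeGas_isHermitian d L lam
  have hCh : (totalSpin 1 1 : Op (TorusSite d L) 2).IsHermitian := totalSpin_isHermitian 1 1
  have hμZ : ((μ : ℂ) • (totalSpin 1 2 : Op (TorusSite d L) 2)).IsHermitian := by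
    unfold Matrix.IsHermitian
    rw [conjTranspose_smul, (totalSpin_isHermitian 1 2 : (totalSpin 1 2 : Op (TorusSite d L) 2).IsHermitian).eq,
      Complex.star_def, Complex.conj_ofReal]
  have hKh : (hardCoreLatticeGas d L lam - (μ : ℂ) • totalSpin 1 2).IsHermitian := hHh.sub hμZ
  obtain ⟨B, hB⟩ : ∃ B : TorusSite d L → Op (TorusSite d L) 2, ∀ y, B y = siteSpin 1 y 0 + (1 / 2 : ℂ) • 1 :=
    ⟨_, fun _ => rfl⟩
  -- the averaged trial state `φ(Y) = (2/|Λ|)Σ_y⟨ψ_y,Yψ_y⟩` (before the rotation)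
  obtain ⟨φ, hφ⟩ : ∃ φ : Op (TorusSite d L) 2 →ₗ[ℂ] ℂ, ∀ Y, φ Y =
      ((2 / N : ℝ) : ℂ) * ∑ y : TorusSite d L, star (B y *ᵥ Φ) ⬝ᵥ (Y *ᵥ (B y *ᵥ Φ)) :=
    ⟨{ toFun := fun Y => ((2 / N : ℝ) : ℂ) * ∑ y : TorusSite d L, star (B y *ᵥ Φ) ⬝ᵥ (Y *ᵥ (B y *ᵥ Φ))
       map_add' := fun Y Y' => by
         simp only [Matrix.add_mulVec, dotProduct_add, Finset.sum_add_distrib, mul_add]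
       map_smul' := fun c Y => by
         simp only [Matrix.smul_mulVec, dotProduct_smul, smul_eq_mul, RingHom.id_apply, ← Finset.mul_sum]
         ring }, fun _ => rfl⟩
  have hφP : ∀ Y : Op (TorusSite d L) 2, Y.PosSemidef → 0 ≤ (φ Y).re := by
    intro Y hY
    rw [hφ, Complex.re_ofReal_mul, Complex.re_sum]
    exact mul_nonneg (by positivity) (Finset.sum_nonneg fun y _ => hY.re_dotProduct_nonneg _)
  have hn : ∀ y, star (B y *ᵥ Φ) ⬝ᵥ (B y *ᵥ Φ) = 1 / 2 := fun y => by
    rw [hB]; exact hardCoreLatticeGas_sum_norm_sq_shiftProj L hd hL lam hΦ hΦ1 y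
  have hφ1 : φ 1 = 1 := by
    rw [hφ]
    simp only [Matrix.one_mulVec, hn, Finset.sum_const, Finset.card_univ, nsmul_eq_mul]
    rw [show ((Fintype.card (TorusSite d L) : ℕ) : ℂ) = (N : ℂ) by rw [hNdef]; push_cast; rfl]
    have hN' : (N : ℂ) ≠ 0 := by exact_mod_cast hN.ne'
    push_cast
    field_simp
  -- Taylor (taylor)/(fircl)
  have hT := re_state_conj_exp_le_taylor φ hφP hφ1 hCh hKh (norm_doubleComm_totalSpin_one_chemPot_le L h3 lam μ) ε
  -- the variational principle for the rotated trial states `e^{-iεC}ψ_y`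
  have hV'h : (NormedSpace.exp (ε • -(I • (totalSpin 1 1 : Op (TorusSite d L) 2))))ᴴ =
      NormedSpace.exp (ε • (I • (totalSpin 1 1 : Op (TorusSite d L) 2))) := by
    rw [← exp_conjTranspose_nogap hCh ε, conjTranspose_conjTranspose]
  have hVV' := exp_mul_exp_neg_nogap (totalSpin 1 1 : Op (TorusSite d L) 2) ε
  have hgen : ∀ w : TensorIndex (TorusSite d L) 2 → ℂ,
      (hardCoreLatticeGas d L lam - (μ : ℂ) • totalSpin 1 2).groundEnergy * (star w ⬝ᵥ w).re ≤
        (star w ⬝ᵥ ((NormedSpace.exp (ε • (I • (totalSpin 1 1 : Op (TorusSite d L) 2))) *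
          (hardCoreLatticeGas d L lam - (μ : ℂ) • totalSpin 1 2) *
            NormedSpace.exp (ε • -(I • (totalSpin 1 1 : Op (TorusSite d L) 2)))) *ᵥ w)).re := by
    intro w
    have h := groundEnergy_mul_le_re_nogap hKh (NormedSpace.exp (ε • -(I • (totalSpin 1 1 : Op (TorusSite d L) 2))) *ᵥ w)
    rw [star_mulVec, ← dotProduct_mulVec, ← dotProduct_mulVec, hV'h] at h
    simpa only [mulVec_mulVec, hVV', Matrix.one_mulVec, Matrix.mul_assoc] using h
  have hvar : (hardCoreLatticeGas d L lam - (μ : ℂ) • totalSpin 1 2).groundEnergy ≤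
      (φ (NormedSpace.exp (ε • (I • (totalSpin 1 1 : Op (TorusSite d L) 2))) *
        (hardCoreLatticeGas d L lam - (μ : ℂ) • totalSpin 1 2) *
          NormedSpace.exp (ε • -(I • (totalSpin 1 1 : Op (TorusSite d L) 2))))).re := by
    rw [hφ, Complex.re_ofReal_mul, Complex.re_sum]
    have hs := Finset.sum_le_sum fun y (_ : y ∈ (Finset.univ : Finset (TorusSite d L))) => hgen (B y *ᵥ Φ)
    rw [← Finset.mul_sum] at hs
    have hre : ∑ y : TorusSite d L, (star (B y *ᵥ Φ) ⬝ᵥ (B y *ᵥ Φ)).re = N / 2 := by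
      simp only [hn, Finset.sum_const, Finset.card_univ, nsmul_eq_mul, ← hNdef]
      norm_num [div_eq_mul_inv]
    rw [hre] at hs
    calc (hardCoreLatticeGas d L lam - (μ : ℂ) • totalSpin 1 2).groundEnergy
        = 2 / N * ((hardCoreLatticeGas d L lam - (μ : ℂ) • totalSpin 1 2).groundEnergy * (N / 2)) := by
          field_simp
      _ ≤ _ := mul_le_mul_of_nonneg_left hs (by positivity)
  -- zeroth and first order
  have h0 : (φ (hardCoreLatticeGas d L lam - (μ : ℂ) • totalSpin 1 2)).re =
      (hardCoreLatticeGas d L lam).groundEnergy - (hardCoreLatticeGas d L lam).groundEnergy / N + lam / 2 := by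
    rw [hφ]
    simp only [hB]
    rw [hardCoreLatticeGas_sum_shiftProj_energy L hd hL h3 lam μ hΦ hΦ1, ← Complex.ofReal_mul, Complex.ofReal_re, ← hNdef]
    field_simp
    ring
  have h1 : (φ (I • (totalSpin 1 1 * (hardCoreLatticeGas d L lam - (μ : ℂ) • totalSpin 1 2) -
      (hardCoreLatticeGas d L lam - (μ : ℂ) • totalSpin 1 2) * totalSpin 1 1))).re =
      μ * (∑ x : TorusSite d L, ∑ y : TorusSite d L,
          (star Φ ⬝ᵥ ((siteSpin 1 x 0 * siteSpin 1 y 0 + siteSpin 1 x 1 * siteSpin 1 y 1) *ᵥ Φ)).re) / N := by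
    rw [hφ]
    simp only [hB]
    rw [hardCoreLatticeGas_sum_shiftProj_firstOrder L hd hL h3 lam μ hΦ hΦ1, ← mul_assoc, ← Complex.ofReal_mul,
      Complex.re_ofReal_mul, Complex.re_sum]
    simp only [Complex.re_sum]
    field_simp
  -- assemble
  refine hvar.trans (hT.trans (le_of_eq ?_))
  rw [h0, h1, hNdef]
  ring

end NoCusp

/-! ### §10 (nocusp) in the BEC phase: grand-canonical and canonical forms; (eq:gap) fails at macroscopic `k` -/

section NoCuspBEC

variable {ι : Type*} [Fintype ι] [DecidableEq ι]

/-- `E₀(A) ≤ E_K(A)` for a nonzero subspace `K`. [cite: Tasaki2020, §2.1 (2.1.6)] -/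
private theorem groundEnergy_le_minEnergyOn_nogap {A : Matrix ι ι ℂ} (hA : A.IsHermitian) {K : Submodule ℂ (ι → ℂ)}
    (hK : K ≠ ⊥) : A.groundEnergy ≤ A.minEnergyOn K := by
  obtain ⟨v, hvK, hv0⟩ := Submodule.exists_mem_ne_zero_of_ne_bot hK
  obtain ⟨c, hc⟩ := exists_real_smul_unit_nogap hv0
  unfold Matrix.minEnergyOn
  refine le_csInf ⟨_, (c : ℂ) • v, K.smul_mem _ hvK, hc, rfl⟩ ?_
  rintro E ⟨ψ, -, hψ1, rfl⟩
  exact Matrix.groundEnergy_le_rayleigh_holds hA ψ hψ1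

variable {Λ : Type*} [Fintype Λ] [DecidableEq Λ]

/-- **Legendre transform at finite volume.** If `[H, S³_tot] = 0`, the ground state of `H - μS³_tot` may be taken
in a magnetisation (particle-number) sector `S³_tot = M`, whence `∃ M, 𝓗_M ≠ 0 ∧ E_M - μM ≤ E_GS(H - μS³_tot)`
(in fact `min_M(E_M - μM) = E_GS(H - μS³_tot)`). [cite: AizenmanEtAl2004, §4 ("By taking a Legendre transform, we
arrive at (nocusp)")] [cite: Tasaki2020, §2.2 (simultaneous diagonalisation of `H` and `S³_tot`)] -/
theorem exists_sector_lowestEnergy_sub_le_groundEnergy (n : ℕ) {H : Op Λ (n + 1)} (hH : H.IsHermitian)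
    (hHZ : Commute H (totalSpin n 2)) (μ : ℝ) :
    ∃ M : ℝ, spinZSector (Λ := Λ) n M ≠ ⊥ ∧
      lowestEnergyInSector n H M - μ * M ≤ (H - (μ : ℂ) • totalSpin n 2).groundEnergy := by
  set Z : Op Λ (n + 1) := totalSpin n 2 with hZdef
  set K : Op Λ (n + 1) := H - (μ : ℂ) • Z with hKdef
  have hZh : Z.IsHermitian := totalSpin_isHermitian n 2
  have hμZ : ((μ : ℂ) • Z).IsHermitian := by
    unfold Matrix.IsHermitian; rw [conjTranspose_smul, hZh.eq, Complex.star_def, Complex.conj_ofReal]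
  have hKh : K.IsHermitian := hH.sub hμZ
  have hKZ : K * Z = Z * K := by
    rw [hKdef, Matrix.sub_mul, Matrix.mul_sub, Matrix.smul_mul, Matrix.mul_smul, hHZ.eq]
  have hinv : ∀ v ∈ K.groundSpace, Z *ᵥ v ∈ K.groundSpace := by
    intro v hv
    have h := Module.End.mem_eigenspace_iff.1 hv
    rw [Matrix.toLin'_apply] at h
    refine Module.End.mem_eigenspace_iff.2 ?_
    rw [Matrix.toLin'_apply, mulVec_mulVec, hKZ, ← mulVec_mulVec, h, mulVec_smul]
  obtain ⟨ψ, hψK, hψ1, hZψ⟩ :=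
    exists_unit_eigen_minEnergyOn hZh K.groundSpace hinv (Matrix.groundSpace_ne_bot_holds hKh)
  set M : ℝ := Z.minEnergyOn K.groundSpace with hM
  have hψ0 : ψ ≠ 0 := by intro h; rw [h, dotProduct_zero] at hψ1; exact zero_ne_one hψ1
  have hψS : ψ ∈ spinZSector (Λ := Λ) n M := by
    rw [spinZSector, Module.End.mem_eigenspace_iff, Matrix.toLin'_apply]; exact hZψ
  refine ⟨M, (Submodule.ne_bot_iff _).2 ⟨ψ, hψS, hψ0⟩, ?_⟩
  have hKψ : K *ᵥ ψ = ((K.groundEnergy : ℝ) : ℂ) • ψ := by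
    have h := Module.End.mem_eigenspace_iff.1 hψK; rwa [Matrix.toLin'_apply] at h
  have hray : (star ψ ⬝ᵥ (H *ᵥ ψ)).re = K.groundEnergy + μ * M := by
    have hH' : H = K + (μ : ℂ) • Z := by rw [hKdef, sub_add_cancel]
    rw [hH', Matrix.add_mulVec, Matrix.smul_mulVec, hKψ, hZψ, smul_smul, ← add_smul, dotProduct_smul, hψ1,
      smul_eq_mul, mul_one, ← Complex.ofReal_mul, ← Complex.ofReal_add, Complex.ofReal_re]
  have hle := minEnergyOn_le_rayleigh_of_mem hH (spinZSector n M) hψS hψ1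
  rw [hray] at hle
  show H.minEnergyOn (spinZSector n M) - μ * M ≤ K.groundEnergy
  linarith

variable {d : ℕ} (L : ℕ) [NeZero L]

/-- **(nocusp), grand-canonical form, in the BEC phase**: if the ground state has condensate density `q ≥ 0`,
`q|Λ|² ≤ Σ_{x,y}⟨S¹_xS¹_y + S²_xS²_y⟩₀`, then for every `μ`
`E_GS(H - μS³_tot) ≤ E₀(1 - |Λ|⁻¹) + λ/2 - cμ²|Λ|`, `c = q²/(2(2d + |λ|/2 + |μ|/2))` ("Choosing `ε` proportional to
the chemical potential `μ`, we obtain as an upper bound for the ground state energy of `H - μS³_tot`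
`E_0(1 - |Λ|^{-1}) + ½λ - cμ²|Λ|` for small `μ`, with `c > 0` in the case of BEC"; here `ε = -μA/(κ|Λ|²)`).
[cite: AizenmanEtAl2004, §4 (proof of (nocusp))] [cite: LSSY2005, Ch. 11 (11.30)] -/
theorem hardCoreLatticeGas_noCusp_grandCanonical (hd : 0 < d) (hL : Even L) (h3 : 3 ≤ L) (lam μ : ℝ)
    {Φ : TensorIndex (TorusSite d L) 2 → ℂ} (hΦ : Φ ∈ (hardCoreLatticeGas d L lam).groundSpace)
    (hΦ1 : star Φ ⬝ᵥ Φ = 1) {q : ℝ} (hq : 0 ≤ q)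
    (hlro : q * (Fintype.card (TorusSite d L) : ℝ) ^ 2 ≤ ∑ x : TorusSite d L, ∑ y : TorusSite d L,
      (star Φ ⬝ᵥ ((siteSpin 1 x 0 * siteSpin 1 y 0 + siteSpin 1 x 1 * siteSpin 1 y 1) *ᵥ Φ)).re) :
    (hardCoreLatticeGas d L lam - (μ : ℂ) • totalSpin 1 2).groundEnergy ≤
      (hardCoreLatticeGas d L lam).groundEnergy - (hardCoreLatticeGas d L lam).groundEnergy / Fintype.card (TorusSite d L) +
        lam / 2 - q ^ 2 / (2 * (2 * d + |lam| / 2 + |μ| / 2)) * μ ^ 2 * Fintype.card (TorusSite d L) := by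
  have h := hardCoreLatticeGas_groundEnergy_sub_chemPot_le L hd hL h3 lam μ
    (-(μ * (∑ x : TorusSite d L, ∑ y : TorusSite d L,
      (star Φ ⬝ᵥ ((siteSpin 1 x 0 * siteSpin 1 y 0 + siteSpin 1 x 1 * siteSpin 1 y 1) *ᵥ Φ)).re) /
      ((2 * d + |lam| / 2 + |μ| / 2) * (Fintype.card (TorusSite d L) : ℝ) ^ 2))) hΦ hΦ1
  set N : ℝ := ((Fintype.card (TorusSite d L) : ℕ) : ℝ) with hNdef
  set A : ℝ := ∑ x : TorusSite d L, ∑ y : TorusSite d L,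
    (star Φ ⬝ᵥ ((siteSpin 1 x 0 * siteSpin 1 y 0 + siteSpin 1 x 1 * siteSpin 1 y 1) *ᵥ Φ)).re with hAdef
  set κ : ℝ := 2 * d + |lam| / 2 + |μ| / 2 with hκdef
  set E₀ : ℝ := (hardCoreLatticeGas d L lam).groundEnergy with hE₀
  have hN : 0 < N := by rw [hNdef]; exact_mod_cast Fintype.card_pos
  have hd' : (0 : ℝ) < d := by exact_mod_cast hd
  have hκ : 0 < κ := by rw [hκdef]; positivity
  have hN0 : N ≠ 0 := hN.ne'
  have hκ0 : κ ≠ 0 := hκ.ne'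
  have hsq : q ^ 2 * N ^ 4 ≤ A ^ 2 := by
    calc q ^ 2 * N ^ 4 = (q * N ^ 2) ^ 2 := by ring
      _ ≤ A ^ 2 := pow_le_pow_left₀ (by positivity) hlro 2
  have hfin : q ^ 2 / (2 * κ) * μ ^ 2 * N ≤ μ ^ 2 * A ^ 2 / (2 * κ * N ^ 3) := by
    rw [div_mul_eq_mul_div, div_mul_eq_mul_div, div_le_div_iff₀ (by positivity) (by positivity)]
    nlinarith [mul_le_mul_of_nonneg_left hsq (by positivity : (0 : ℝ) ≤ 2 * κ * μ ^ 2)]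
  calc (hardCoreLatticeGas d L lam - (μ : ℂ) • totalSpin 1 2).groundEnergy ≤ _ := h
    _ = E₀ - E₀ / N + lam / 2 - μ ^ 2 * A ^ 2 / (2 * κ * N ^ 3) := by field_simp; ring
    _ ≤ E₀ - E₀ / N + lam / 2 - q ^ 2 / (2 * κ) * μ ^ 2 * N := by linarith

/-- **(nocusp), canonical form, in the BEC phase**: with condensate density `q` as above there is, for every `μ`,
a particle-number sector `M` (`𝓗_M ≠ 0`) with `E_M - μM ≤ E₀(1 - |Λ|⁻¹) + λ/2 - cμ²|Λ|`,
`c = q²/(2(2d + |λ|/2 + |μ|/2))` — the Legendre transform of the grand-canonical bound.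
[cite: AizenmanEtAl2004, §4 ((nocusp) and "By taking a Legendre transform")] [cite: LSSY2005, Ch. 11 (11.30)] -/
theorem hardCoreLatticeGas_noCusp_canonical (hd : 0 < d) (hL : Even L) (h3 : 3 ≤ L) (lam μ : ℝ)
    {Φ : TensorIndex (TorusSite d L) 2 → ℂ} (hΦ : Φ ∈ (hardCoreLatticeGas d L lam).groundSpace)
    (hΦ1 : star Φ ⬝ᵥ Φ = 1) {q : ℝ} (hq : 0 ≤ q)
    (hlro : q * (Fintype.card (TorusSite d L) : ℝ) ^ 2 ≤ ∑ x : TorusSite d L, ∑ y : TorusSite d L,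
      (star Φ ⬝ᵥ ((siteSpin 1 x 0 * siteSpin 1 y 0 + siteSpin 1 x 1 * siteSpin 1 y 1) *ᵥ Φ)).re) :
    ∃ M : ℝ, spinZSector (Λ := TorusSite d L) 1 M ≠ ⊥ ∧
      lowestEnergyInSector 1 (hardCoreLatticeGas d L lam) M - μ * M ≤
        (hardCoreLatticeGas d L lam).groundEnergy - (hardCoreLatticeGas d L lam).groundEnergy / Fintype.card (TorusSite d L) +
          lam / 2 - q ^ 2 / (2 * (2 * d + |lam| / 2 + |μ| / 2)) * μ ^ 2 * Fintype.card (TorusSite d L) := by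
  obtain ⟨M, hM, hle⟩ := exists_sector_lowestEnergy_sub_le_groundEnergy 1 (hardCoreLatticeGas_isHermitian d L lam)
    (HardCoreBoson.commute_hardCoreLatticeGas_totalSpin (d := d) (L := L) lam) μ
  exact ⟨M, hM, hle.trans (hardCoreLatticeGas_noCusp_grandCanonical L hd hL h3 lam μ hΦ hΦ1 hq hlro)⟩

/-- ★ **(nocusp) in the BEC window** [AizenmanEtAl2004 §4; LSSY2005 (11.30)]: for `d ≥ 3` and `λ` in the BEC window
`λ² < 1/c_d² - d(d+1)/4` there are `c > 0` and `L₀` such that on every even torus of side `L ≥ L₀` and for every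
`|μ| ≤ 1`: `E_GS(H - μS³_tot) ≤ E₀(1 - |Λ|⁻¹) + λ/2 - cμ²|Λ|` ("we obtain as an upper bound for the ground state
energy of `H - μS³_tot` `E_0(1-|Λ|^{-1}) + ½λ - cμ²|Λ|` for small `μ`, with `c > 0` in the case of BEC"), and
hence (Legendre transform) some particle-number sector `M` has `E_M - μM ≤ E₀(1 - |Λ|⁻¹) + λ/2 - cμ²|Λ|`.
The thermodynamic-limit reformulation `0 ≤ e_∞(ρ) - e_∞(½) ≤ const(ρ - ½)²` ((nocusp) as printed) additionally
uses the existence of `e_∞` (Appendix), not formalised here. [cite: AizenmanEtAl2004, §4 (nocusp)]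
[cite: LSSY2005, Ch. 11 (11.30)] -/
theorem hardCoreLatticeGas_noCusp (hd : 3 ≤ d) {lam : ℝ}
    (hwin : ((d : ℝ) * (d + 1) + 4 * lam ^ 2) * latticeGreen (0 : Site d) ^ 2 < 4) :
    ∃ c : ℝ, 0 < c ∧ ∃ L₀ : ℕ, ∀ (L : ℕ) [NeZero L], Even L → L₀ ≤ L → ∀ μ : ℝ, |μ| ≤ 1 →
      (hardCoreLatticeGas d L lam - (μ : ℂ) • totalSpin 1 2).groundEnergy ≤
          (hardCoreLatticeGas d L lam).groundEnergy -
            (hardCoreLatticeGas d L lam).groundEnergy / Fintype.card (TorusSite d L) + lam / 2 -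
              c * μ ^ 2 * Fintype.card (TorusSite d L) ∧
        ∃ M : ℝ, spinZSector (Λ := TorusSite d L) 1 M ≠ ⊥ ∧
          lowestEnergyInSector 1 (hardCoreLatticeGas d L lam) M - μ * M ≤
            (hardCoreLatticeGas d L lam).groundEnergy -
              (hardCoreLatticeGas d L lam).groundEnergy / Fintype.card (TorusSite d L) + lam / 2 -
                c * μ ^ 2 * Fintype.card (TorusSite d L) := by
  obtain ⟨hm, L₀, hL₀⟩ := hardCoreLatticeGas_groundState_lro_eventually_ge hd hwin
  set m : ℝ := 1 / 2 - 1 / 2 * Real.sqrt (1 / 2 * Real.sqrt ((d : ℝ) * (d + 1) + 4 * lam ^ 2) *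
    latticeGreen (0 : Site d)) with hmdef
  set q : ℝ := m / 2 with hq
  have hq0 : 0 < q := by positivity
  set κ₁ : ℝ := 2 * d + |lam| / 2 + 1 / 2 with hκ₁
  have hκ₁0 : 0 < κ₁ := by positivity
  refine ⟨q ^ 2 / (2 * κ₁), by positivity, max L₀ 3, fun L _ hLe hLge μ hμ => ?_⟩
  have hL₀L : L₀ ≤ L := le_trans (le_max_left _ _) hLge
  have h3 : 3 ≤ L := le_trans (le_max_right _ _) hLge
  have hd0 : 0 < d := by omega
  obtain ⟨ψ, hψ0, hψ, -⟩ := HardCoreBoson.exists_groundState_totalSpin_eq_zero (d := d) (L := L) hd0 hLe lam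
  obtain ⟨c, hc⟩ := exists_real_smul_unit_nogap hψ0
  have hΦ : (c : ℂ) • ψ ∈ (hardCoreLatticeGas d L lam).groundSpace := Submodule.smul_mem _ _ hψ
  have hlro := hL₀ L hLe hL₀L ((c : ℂ) • ψ) hΦ hc
  have hd' : (0 : ℝ) < d := by exact_mod_cast hd0
  have hκ : 0 < 2 * (2 * (d : ℝ) + |lam| / 2 + |μ| / 2) := by positivity
  have hcoef : q ^ 2 / (2 * κ₁) * μ ^ 2 * Fintype.card (TorusSite d L) ≤
      q ^ 2 / (2 * (2 * d + |lam| / 2 + |μ| / 2)) * μ ^ 2 * Fintype.card (TorusSite d L) := by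
    have h : q ^ 2 / (2 * κ₁) ≤ q ^ 2 / (2 * (2 * d + |lam| / 2 + |μ| / 2)) :=
      div_le_div_of_nonneg_left (sq_nonneg q) hκ (by rw [hκ₁]; linarith)
    have := mul_le_mul_of_nonneg_right h (by positivity : (0 : ℝ) ≤ μ ^ 2 * Fintype.card (TorusSite d L))
    nlinarith [this]
  have hGC := hardCoreLatticeGas_noCusp_grandCanonical L hd0 hLe h3 lam μ hΦ hc hq0.le hlro
  obtain ⟨M, hM, hCan⟩ := hardCoreLatticeGas_noCusp_canonical L hd0 hLe h3 lam μ hΦ hc hq0.le hlro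
  exact ⟨by linarith, M, hM, by linarith⟩

/-- ★ **(eq:gap) fails at macroscopic particle numbers in the BEC window**: for `d ≥ 3`, `λ` in the BEC window and
every candidate gap constant `c' > 0` there are a density `ρ > 0` and `L₀` such that every even torus of side
`L ≥ L₀` has a particle-number sector `M ≥ ρ|Λ|` with `E_M - E_0 < c'M` — so "`E_{-k} + E_k - 2E_0 ≥ c|k|` for all
`k`" fails, and fails at macroscopic `k`, in the BEC phase ("we prove that (eq:gap) fails for macroscopic `k` as
well"; obtained from the canonical (nocusp) bound at `μ = min(1, c'/2)` together with the a-priori bound (11.24)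
`E₀ ≥ (λ/2 - ¼[d(d+1)+4λ²]^{1/2})|Λ|`). [cite: AizenmanEtAl2004, §4 ((eq:gap), (nocusp))]
[cite: LSSY2005, Ch. 11 (11.24), (11.30)] -/
theorem hardCoreLatticeGas_gap_fails_macroscopic (hd : 3 ≤ d) {lam : ℝ}
    (hwin : ((d : ℝ) * (d + 1) + 4 * lam ^ 2) * latticeGreen (0 : Site d) ^ 2 < 4) {c' : ℝ} (hc' : 0 < c') :
    ∃ ρ : ℝ, 0 < ρ ∧ ∃ L₀ : ℕ, ∀ (L : ℕ) [NeZero L], Even L → L₀ ≤ L →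
      ∃ M : ℝ, spinZSector (Λ := TorusSite d L) 1 M ≠ ⊥ ∧ ρ * Fintype.card (TorusSite d L) ≤ M ∧
        lowestEnergyInSector 1 (hardCoreLatticeGas d L lam) M - (hardCoreLatticeGas d L lam).groundEnergy < c' * M := by
  obtain ⟨c, hc, L₀, hL₀⟩ := hardCoreLatticeGas_noCusp hd hwin
  set μ : ℝ := min 1 (c' / 2) with hμdef
  have hμ0 : 0 < μ := lt_min one_pos (by positivity)
  have hμ1 : |μ| ≤ 1 := by rw [abs_of_pos hμ0]; exact min_le_left _ _
  have hμc : μ ≤ c' / 2 := min_le_right _ _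
  set B₀ : ℝ := Real.sqrt ((d : ℝ) * (d + 1) + 4 * lam ^ 2) / 4 with hB₀
  have hB₀0 : 0 ≤ B₀ := by positivity
  obtain ⟨L₁, hL₁⟩ := exists_nat_ge (2 * B₀ / (c * μ ^ 2) + 1)
  refine ⟨c * μ / 2, by positivity, max L₀ (max L₁ 3), fun L _ hLe hLge => ?_⟩
  have hL₀L : L₀ ≤ L := le_trans (le_max_left _ _) hLge
  have hL₁L : L₁ ≤ L := le_trans (le_max_left _ _) (le_trans (le_max_right _ _) hLge)
  have h3 : 3 ≤ L := le_trans (le_max_right _ _) (le_trans (le_max_right _ _) hLge)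
  obtain ⟨-, M, hM, hle⟩ := hL₀ L hLe hL₀L μ hμ1
  set N : ℝ := ((Fintype.card (TorusSite d L) : ℕ) : ℝ) with hNdef
  set E₀ : ℝ := (hardCoreLatticeGas d L lam).groundEnergy with hE₀
  have hHh := hardCoreLatticeGas_isHermitian d L lam
  have hcard : N = (L : ℝ) ^ d := by
    rw [hNdef, Fintype.card_pi, Finset.prod_const, ZMod.card, Finset.card_univ, Fintype.card_fin]; push_cast; rfl
  have hN : 0 < N := by rw [hNdef]; exact_mod_cast Fintype.card_pos
  -- `N ≥ L ≥ L₁ ≥ 2B₀/(cμ²) + 1`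
  have hNL : (L₁ : ℝ) ≤ N := by
    rw [hcard]
    exact (Nat.cast_le.2 hL₁L).trans (le_self_pow₀ (by exact_mod_cast (show 1 ≤ L by omega)) (by omega))
  have hNbig : 2 * B₀ / (c * μ ^ 2) + 1 ≤ N := hL₁.trans hNL
  have hNbig' : 2 * B₀ + c * μ ^ 2 ≤ c * μ ^ 2 * N := by
    have := mul_le_mul_of_nonneg_left hNbig (by positivity : (0 : ℝ) ≤ c * μ ^ 2)
    rwa [mul_add, mul_div_cancel₀ _ (by positivity : c * μ ^ 2 ≠ 0), mul_one] at this
  -- the a-priori bound `λ/2 - E₀/N ≤ B₀`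
  have hapr : lam / 2 - E₀ / N ≤ B₀ := by
    have h := hardCoreLatticeGas_groundEnergy_ge (d := d) L h3 lam
    rw [← hcard, ← hE₀, ← hB₀] at h
    rw [sub_le_iff_le_add, ← sub_le_iff_le_add', le_div_iff₀ hN]
    exact h
  -- `E_M ≥ E₀`
  have hEM : E₀ ≤ lowestEnergyInSector 1 (hardCoreLatticeGas d L lam) M := groundEnergy_le_minEnergyOn_nogap hHh hM
  -- so `μM ≥ cμ²N - B₀`, `M ≥ (cμ/2)N`, and `E_M - E₀ ≤ μM + B₀ - cμ²N < c'M`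
  have hμM : c * μ ^ 2 * N - B₀ ≤ μ * M := by linarith
  have hMlow : c * μ / 2 * N ≤ M := by
    have h1 : μ * (c * μ / 2 * N) ≤ μ * M := by nlinarith
    exact le_of_mul_le_mul_left h1 hμ0
  refine ⟨M, hM, hMlow, ?_⟩
  have hMpos : 0 ≤ M := le_trans (by positivity) hMlow
  have hcμ : 0 < c * μ ^ 2 := by positivity
  have hμM' : μ * M ≤ c' / 2 * M := by nlinarith [hμc, hMpos]
  have hc'M : 0 ≤ c' / 2 * M := by positivity
  linarith [hle, hapr, hNbig', hEM]

end NoCuspBEC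

end Literature.MathematicalPhysics.QuantumLattice
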